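import Literature.MathematicalPhysics.StatisticalMechanics.EIPMinimizerSections
import HarnessLib

/-!
# The edge-isoperimetric problem in the cubic lattice `ℤ³` solved: `EIP³(n) = 2(ab + bc + ca + ⌈2√r⌉)`

For a finite `C ⊂ ℤ³` write `Θ₃(C)` for its (directed) edge boundary
(`boundaryPairs C`: pairs `(x, y)`, `|x − y| = 1`, `x ∈ C`, `y ∉ C`, as in
[MPSS19] eq. (1) / [MS20] §1) and `EIP³(n) = min {#Θ₃(C) : #C = n}`.  The main theorem of this
file is the EXACT VALUE of `EIP³(n)` for every `n` together with minimizers attaining it — the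
three-dimensional edge-isoperimetric inequality in its sharp integer form, i.e. the `d = 3` content of
[MS20] Theorem 2.2 (Ahlswede–Bezrukov: initial segments of the order `≺` are `EIP^d` minimizers, so
the minimal edge perimeter is that of a quasi-cube with a quasi-square layer) and the starting point
"`EIP_n` … for the cubic lattice" of [MPSS19]:

* `two_mul_cubicEIP_le_card_boundaryPairs`: for every finite `C ⊂ ℤ³`,
  `#Θ₃(C) ≥ 2·G₃(#C)`, where for `n = m·F + r` with `m = ⌊∛n⌋`, `F ∈ {m², m(m+1), (m+1)²}` the
  largest such face with `m·F ≤ n` (so `m·F` is the largest quasi-cube `j(j+δ)(j+θ) ≤ n`) and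
  `0 ≤ r < F`, `G₃(n) = F + m·⌈2√F⌉ + ⌈2√r⌉ = ab + bc + ca + ⌈2√r⌉` (`cubicEIP`);
* `exists_card_boundaryPairs_eq_two_mul_cubicEIP`: the bound is attained (by `m` layers of the
  `F`-point quasi-square and one layer of the `r`-point daisy: a quasi-cube plus a quasi-square plus
  a bar, the shape of Alonso–Cerf's Theorem 3.1);
* `isEIPMinimizer_iff_card_boundaryPairs_eq_three`: `C` is an `EIP³` minimizer iff
  `#Θ₃(C) = 2·G₃(#C)`; in particular `EIP³(n) = 2·G₃(n)` — twice the minimal area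
  `2(j(j+δ) + j(j+θ) + (j+δ)(j+θ)) + …` of Alonso–Cerf's Corollary 3.4 counted as directed pairs;
* `MaininiPiovanoSchmidtStefanelli2019_thm12_holds`: the lower bound of the `N^{3/4}` law
  ([MPSS19] Theorem 1.2) — a sequence of `EIP³` minimizers (slabs) whose distance from every
  translate of the Wulff cube is `≥ ¼ n^{3/4}`; `MaininiSchmidt2020_thm11_lower_three`: the same
  construction read as the `d = 3` instance of [MS20] Theorem 1.1 (ii) (`W_n = {1,…,⌊∛n⌋}³`);
* `MaininiSchmidt2020_lemma35_three`: the `d = 3` instance, hypotheses verbatim, of the vendored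
  fact `MaininiSchmidt2020_lemma35` — `P_{ℓ,3,p} = {1,…,ℓ−p} × {1,…,ℓ}²` is an `EIP³` minimizer for
  `1 ≤ p ≤ ⌊ℓ^{1/4}⌋` (the value `G₃((ℓ−p)ℓ²) = ℓ² + 2ℓ(ℓ−p)` by the three residues of `p` mod `3`);
* `isNestedMinimizerFamily_cubicle` (section `Nested`): **nested solutions** — [MS20] Theorem 2.2
  for `d = 3`: the Agnarsson–Lauria cubicles `⟦n⟧³` (`cubicle n`: the box of the largest quasi-cube
  `≤ n` inside `[1,m+1]³` plus the transposed daisy of the remaining points in the next coordinate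
  plane, orthogonal to `e₀ / e₁ / e₂` in the three regimes) satisfy `#⟦n⟧³ = n`,
  `⟦n⟧³ ⊆ ⟦n+1⟧³` and are `EIP³` minimizers; hence, by the rearrangement of
  `EIPMinimizerSections` (`IsNestedMinimizerFamily.isEIPMinimizer_latticeSection`),
  `MaininiSchmidt2020_cor33_four`: the `d = 4` instance of the vendored fact
  `MaininiSchmidt2020_cor33` — every three-dimensional section of an `EIP⁴` minimizer is an `EIP³`
  minimizer;
* `card_adjPairs_le_three`, `card_adjPairs_cubicle`, `isEIPMinimizer_iff_card_adjPairs_eq_three`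
  (section `Bonds`): the bond form — `n` points of `ℤ³` induce at most `3n − G₃(n)` edges, attained
  ([AL13] Theorem 6.4 at `d = 3`, `δ₃ = G₃`), and `C` is an `EIP³` minimizer iff it has exactly
  `3·#C − G₃(#C)` unit bonds ([MPSS19] §2).

## The proof

We follow the induction on the number of points of Agnarsson–Lauria's proof of the exact value of
the maximal number of induced edges of `n` points of `ℤ^d` ([AgnarssonLauria2013] §§4–6, the case
`d = 3`; `#Θ₃ = 6n − 2·(induced edges)`), in the form it takes for `d = 3` once the planar problem
is solved (the tree's `SquareLatticeEdgeIsoperimetry`: `EIP²(k) = 2⌈2√k⌉`, daisies) :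

1. *Slicing* ([AL13] Observation 3.1 and the slice decomposition of §4, here the tree's
   `sum_card_boundaryPairs_sliceAt_add_le`): slicing `C` perpendicular to the axis `e_s` meeting the
   most lattice hyperplanes (`T` of them, so `T³ ≥ #C` by `#C ≤ ∏ #projections`),
   `#Θ₃(C) ≥ Σ_t 2⌈2√m_t⌉ + 2·max_t m_t` with `m_t` the slice cardinalities.
2. *The sorted daisy stack* (`daisyStack`; [AL13] §2 "fully nested", [MS20] Proposition 3.2):
   the right-hand side of 1. is EXACTLY `#Θ₃` of the stack of the nested daisies `D_{m_(k)}`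
   (`daisyOf`, sizes sorted decreasingly) — so it suffices to treat stacks; removing the top
   (smallest) daisy `D_A` of the stack costs exactly `2⌈2√A⌉` ([AL13] §4, the special cut
   `k = h` along a side), and the rest has `#C − A` points, to which the induction hypothesis applies.
3. *The arithmetic of quasi-cubes* (`cubicEIP_le_cubicEIP_sub_add`, [AL13] §6 "first case /
   second case" with Observation 6.1 `A ≤ n/(m+1)`): for `T·A ≤ n ≤ T³`,
   `G₃(n) ≤ G₃(n − A) + ⌈2√A⌉`.  This rests on three facts about the planar optimum
   `g(k) = ⌈2√k⌉ = min {a + b : ab ≥ k}` (`halfPerim_le_iff`, a Galois connection with the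
   quasi-squares `q(s) = ⌊s/2⌋⌈s/2⌉`): subadditivity, the quasi-square exchange inequality
   `g(Q) + g(n₁ + n₂ − Q) ≤ g(n₁) + g(n₂)` for a quasi-square `Q ≥ n₁, n₂` ([AL13] property
   **P**(2, ·)), and the bar inequality `g(r) ≤ g(r − x) + 1` for `x(x+1) ≤ r` ([AL13] Lemma 6.3
   for `d − 1 = 2`: a bar of length `x` fits against the daisy of `r − x` points).

Everything here is PROVED (no named facts).  As an application the file DISCHARGES the vendored
fact `MaininiPiovanoSchmidtStefanelli2019_thm12` (the lower-bound half of the `N^{3/4}` law,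
`EdgeIsoperimetricFluctuations.lean`): `MaininiPiovanoSchmidtStefanelli2019_thm12_holds`, with the
explicit `EIP³` minimizers `slabMinimizer i` — slabs `((6t)⁴ − 6t) × (6t)⁴ × (6t)⁴`, `t = i + 1`, the
construction `P_{ℓ,3,p}` (`p ≈ ℓ^{1/4}`) of [MS20] Lemma 3.5 / Theorem 1.1 (ii) — which every
translate of the Wulff cube `[0, ⌊∛n⌋]³` misses in at least `¼·n^{3/4}` points
(`le_card_slabMinimizer_sdiff`); the proof lives here rather than next to the fact because it needs
the exact value `EIP³ = 2·G₃` of this file (which imports that one).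

## References

* [AgnarssonLauria2013] G. Agnarsson, K. Lauria, *Extremal subgraphs of the d-dimensional grid
  graph*, arXiv:1302.6517 (2013) — §2 (gravity, fully nested sets, Lemma 2.7), §3 Observation 3.1,
  §4 (Lemma 4.1 and the special cut `k = h`), §5 (Definition 5.1 pseudo-cubes `⟦m,ℓ⟧^d`,
  Proposition 5.3, the recursive definition of the cubicles `⟦n⟧^d` with Proposition 5.7 and
  Definition 5.8, Lemma 5.10, Definition 5.11 and Observation 5.12), §6 (Observation 6.1,
  Lemma 6.3, Theorem 6.4).
* [AlonsoCerf1996] L. Alonso, R. Cerf, *The three dimensional polyominoes of minimal area*,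
  Electron. J. Combin. 3 (1996) R27 — Theorem 3.1, Lemma 3.2, Corollary 3.4.
* [MaininiSchmidt2020] E. Mainini, B. Schmidt, *Maximal fluctuations around the Wulff shape for
  edge-isoperimetric sets in ℤ^d: a sharp scaling law*, Comm. Math. Phys. 380 (2020) — §1,
  Theorem 2.2, Proposition 3.2, Corollary 3.3, Lemma 3.5.
* [MaininiPiovanoSchmidtStefanelli2019] E. Mainini, P. Piovano, B. Schmidt, U. Stefanelli,
  *N^{3/4} law in the cubic lattice*, J. Stat. Phys. 176 (2019) — §1 (EIP_n), §2, Theorem 1.2.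
-/

open Finset

namespace Literature.MathematicalPhysics.StatisticalMechanics

open Literature.Probability.LatticeModels

/-! ### Quasi-squares and the planar optimum `⌈2√k⌉` -/

/-- The **quasi-square number** `q(s) = ⌊s/2⌋·⌈s/2⌉` — the largest number of lattice points of a
rectangle of half-perimeter `s` (`k²` for `s = 2k`, `k(k+1)` for `s = 2k+1`); Agnarsson–Lauria's
pseudo-squares `[k,ℓ]²`, Alonso–Cerf's quasisquares `l(l+ε)`.
[cite: AgnarssonLauria2013, Definition 5.1 (pseudo d-cubics, d = 2); AlonsoCerf1996, §2 (quasisquares)] -/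
def qsq (s : ℕ) : ℕ := s / 2 * ((s + 1) / 2)

/-- `4·q(s) ≤ s²`. [cite: AgnarssonLauria2013, Definition 5.1] -/
theorem four_mul_qsq_le (s : ℕ) : 4 * qsq s ≤ s ^ 2 := by
  rcases Nat.even_or_odd' s with ⟨k, rfl | rfl⟩
  · rw [qsq, show 2 * k / 2 = k by omega, show (2 * k + 1) / 2 = k by omega]; nlinarith
  · rw [qsq, show (2 * k + 1) / 2 = k by omega, show (2 * k + 1 + 1) / 2 = k + 1 by omega]
    nlinarith

/-- `s² ≤ 4·q(s) + 1`. [cite: AgnarssonLauria2013, Definition 5.1] -/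
theorem sq_le_four_mul_qsq_add_one (s : ℕ) : s ^ 2 ≤ 4 * qsq s + 1 := by
  rcases Nat.even_or_odd' s with ⟨k, rfl | rfl⟩
  · rw [qsq, show 2 * k / 2 = k by omega, show (2 * k + 1) / 2 = k by omega]; nlinarith
  · rw [qsq, show (2 * k + 1) / 2 = k by omega, show (2 * k + 1 + 1) / 2 = k + 1 by omega]
    nlinarith

/-- The growth of the quasi-squares: `q(s+1) = q(s) + ⌈s/2⌉ = q(s) + ⌊(s+1)/2⌋` (consecutive
pseudo-squares differ by a pseudo-segment, [AL13] Claim 5.2 for `d = 2`).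
[cite: AgnarssonLauria2013, Claim 5.2] -/
theorem qsq_succ (s : ℕ) : qsq (s + 1) = qsq s + (s + 1) / 2 := by
  rcases Nat.even_or_odd' s with ⟨k, rfl | rfl⟩
  · rw [qsq, qsq, show 2 * k / 2 = k by omega, show (2 * k + 1) / 2 = k by omega,
      show (2 * k + 1 + 1) / 2 = k + 1 by omega]
    ring
  · rw [qsq, qsq, show (2 * k + 1) / 2 = k by omega, show (2 * k + 1 + 1) / 2 = k + 1 by omega,
      show (2 * k + 1 + 1 + 1) / 2 = k + 1 by omega]
    ring

/-- `q(0) = 0`. [cite: AgnarssonLauria2013, Definition 5.1] -/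
theorem qsq_zero : qsq 0 = 0 := by simp [qsq]

/-- `q(2k) = k²`. [cite: AgnarssonLauria2013, Definition 5.1] -/
theorem qsq_two_mul (k : ℕ) : qsq (2 * k) = k ^ 2 := by
  rw [qsq, show 2 * k / 2 = k by omega, show (2 * k + 1) / 2 = k by omega, sq]

/-- `q(2k+1) = k(k+1)`. [cite: AgnarssonLauria2013, Definition 5.1] -/
theorem qsq_two_mul_add_one (k : ℕ) : qsq (2 * k + 1) = k * (k + 1) := by
  rw [qsq, show (2 * k + 1) / 2 = k by omega, show (2 * k + 1 + 1) / 2 = k + 1 by omega]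

/-- `q` is monotone. [cite: AgnarssonLauria2013, Claim 5.2] -/
theorem qsq_mono : Monotone qsq := by
  refine monotone_nat_of_le_succ fun s => ?_
  rw [qsq_succ]; omega

/-- `q` is superadditive: `q(s) + q(t) ≤ q(s + t)` (two rectangles of half-perimeters `s`, `t` hold at
most as many points as one of half-perimeter `s + t`). [cite: AgnarssonLauria2013, §6 (super-additivity of E_{d-1})] -/
theorem qsq_add_qsq_le (s t : ℕ) : qsq s + qsq t ≤ qsq (s + t) := by
  induction t with
  | zero => simp [qsq_zero]
  | succ t ih =>
    rw [← add_assoc, qsq_succ, qsq_succ]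
    have : (t + 1) / 2 ≤ (s + t + 1) / 2 := by omega
    omega

/-- **Discrete convexity of `q`, rearranged**: for `b ≤ a + 1` and `σ ≤ b`,
`q(a) + q(b) ≤ q(a + σ) + q(b − σ)` — spreading two half-perimeters apart never decreases the total
capacity (the increments `q(s+1) − q(s) = ⌈s/2⌉` are nondecreasing). [cite: AgnarssonLauria2013, §5 (property P(d,n), d = 2)] -/
theorem qsq_add_qsq_le_qsq_add_qsq_sub {a b : ℕ} (hab : b ≤ a + 1) {σ : ℕ} (hσ : σ ≤ b) :
    qsq a + qsq b ≤ qsq (a + σ) + qsq (b - σ) := by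
  induction σ with
  | zero => simp
  | succ σ ih =>
    have ih := ih (by omega)
    obtain ⟨c, hc⟩ : ∃ c, b - σ = c + 1 := ⟨b - σ - 1, by omega⟩
    rw [show b - (σ + 1) = c by omega]
    rw [hc, qsq_succ c] at ih
    rw [← add_assoc, qsq_succ]
    have : (c + 1) / 2 ≤ (a + σ + 1) / 2 := by omega
    omega

/-- The **planar optimum** `g(k) = ⌈2√k⌉`: half the minimal edge perimeter of `k` points of `ℤ²`
(`EIP²(k) = 2⌈2√k⌉`, the tree's `isEIPMinimizer_iff_card_boundaryPairs_eq`), equivalently the least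
half-perimeter `a + b` of a lattice rectangle with `ab ≥ k` (`halfPerim_le_iff`).
[cite: MaininiPiovanoSchmidtStefanelli2019, §2 (θ_d = 2⌈2√d⌉ in ℤ², recalled from [MPS14])] -/
noncomputable def halfPerim (k : ℕ) : ℕ := ⌈2 * Real.sqrt k⌉₊

/-- `halfPerim k = ⌈2√k⌉` (definitional unfolding). [cite: MaininiPiovanoSchmidtStefanelli2019, §2] -/
theorem halfPerim_def (k : ℕ) : halfPerim k = ⌈2 * Real.sqrt k⌉₊ := rfl

/-- **The Galois connection `⌈2√k⌉ ≤ s ↔ k ≤ q(s)`**: `k` lattice points fit into a rectangle of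
half-perimeter `s` iff `k ≤ ⌊s/2⌋⌈s/2⌉` (Alonso–Cerf's Proposition 2.1: a polyomino is minimal iff
no rectangle of area `≥ |c|` has smaller perimeter). [cite: AlonsoCerf1996, Proposition 2.1 and Corollary 2.5] -/
theorem halfPerim_le_iff {k s : ℕ} : halfPerim k ≤ s ↔ k ≤ qsq s := by
  rw [halfPerim, Nat.ceil_le]
  have h1 := four_mul_qsq_le s
  have h2 := sq_le_four_mul_qsq_add_one s
  have hk : (0 : ℝ) ≤ k := Nat.cast_nonneg k
  constructor
  · intro h
    have h0 : 0 ≤ 2 * Real.sqrt k := by positivity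
    have h3 : (4 : ℝ) * k ≤ (s : ℝ) ^ 2 := by
      nlinarith [Real.sq_sqrt hk, Real.sqrt_nonneg (k : ℝ)]
    have h4 : 4 * k ≤ s ^ 2 := by exact_mod_cast h3
    omega
  · intro h
    have h4 : 4 * k ≤ s ^ 2 := by omega
    have h3 : (4 : ℝ) * k ≤ (s : ℝ) ^ 2 := by exact_mod_cast h4
    have h5 : Real.sqrt 4 = 2 := by
      rw [show (4 : ℝ) = 2 ^ 2 by norm_num, Real.sqrt_sq (by norm_num : (0 : ℝ) ≤ 2)]
    calc 2 * Real.sqrt k = Real.sqrt (4 * k) := by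
          rw [Real.sqrt_mul (by norm_num : (0 : ℝ) ≤ 4), h5]
      _ ≤ Real.sqrt ((s : ℝ) ^ 2) := Real.sqrt_le_sqrt h3
      _ = s := Real.sqrt_sq (Nat.cast_nonneg s)

/-- `k ≤ q(⌈2√k⌉)`: `k` points fit into the optimal rectangle. [cite: AlonsoCerf1996, Proposition 2.1] -/
theorem le_qsq_halfPerim (k : ℕ) : k ≤ qsq (halfPerim k) := halfPerim_le_iff.1 le_rfl

/-- `q(s) < k` whenever `s < ⌈2√k⌉` (minimality of the optimal rectangle).
[cite: AlonsoCerf1996, Proposition 2.1] -/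
theorem qsq_lt_of_lt_halfPerim {k s : ℕ} (h : s < halfPerim k) : qsq s < k := by
  by_contra h'
  exact absurd (halfPerim_le_iff.2 (not_lt.1 h')) (not_le.2 h)

/-- `⌈2√k⌉ = s` as soon as `q(s−1) < k ≤ q(s)` (`s ≥ 1`). [cite: AlonsoCerf1996, Corollary 2.5] -/
theorem halfPerim_eq_of {k s : ℕ} (hs : 1 ≤ s) (h1 : k ≤ qsq s) (h2 : qsq (s - 1) < k) :
    halfPerim k = s := by
  refine le_antisymm (halfPerim_le_iff.2 h1) ?_
  by_contra h
  have : halfPerim k ≤ s - 1 := by omega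
  exact absurd (halfPerim_le_iff.1 this) (not_le.2 h2)

/-- `⌈2√0⌉ = 0`. [cite: MaininiPiovanoSchmidtStefanelli2019, §2] -/
theorem halfPerim_zero : halfPerim 0 = 0 :=
  Nat.le_zero.1 (halfPerim_le_iff.2 (Nat.zero_le _))

/-- `⌈2√(k²)⌉ = 2k`. [cite: MaininiPiovanoSchmidtStefanelli2019, §2 (squares R(s,s))] -/
theorem halfPerim_sq {k : ℕ} (hk : 1 ≤ k) : halfPerim (k ^ 2) = 2 * k := by
  refine halfPerim_eq_of (by omega) (by rw [qsq_two_mul]) ?_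
  rw [show 2 * k - 1 = 2 * (k - 1) + 1 by omega, qsq_two_mul_add_one,
    show k - 1 + 1 = k by omega, sq]
  exact Nat.mul_lt_mul_of_pos_right (by omega) (by omega)

/-- `⌈2√(k(k+1))⌉ = 2k + 1`. [cite: MaininiPiovanoSchmidtStefanelli2019, §2 (rectangles R(s,s+1))] -/
theorem halfPerim_mul_succ {k : ℕ} (hk : 1 ≤ k) : halfPerim (k * (k + 1)) = 2 * k + 1 := by
  refine halfPerim_eq_of (by omega) (by rw [qsq_two_mul_add_one]) ?_
  rw [show 2 * k + 1 - 1 = 2 * k by omega, qsq_two_mul, sq]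
  exact Nat.mul_lt_mul_of_pos_left (by omega) (by omega)

/-- `⌈2√·⌉` is monotone. [cite: AlonsoCerf1996, Corollary 2.5] -/
theorem halfPerim_mono {a b : ℕ} (h : a ≤ b) : halfPerim a ≤ halfPerim b :=
  halfPerim_le_iff.2 (h.trans (le_qsq_halfPerim b))

/-- **Subadditivity** `⌈2√(a+b)⌉ ≤ ⌈2√a⌉ + ⌈2√b⌉` (two optimal rectangles side by side fit into
one of the total half-perimeter; the super-additivity of the maximal bond number `E₂`).
[cite: AgnarssonLauria2013, §6 (E_{d-1} is super-additive)] -/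
theorem halfPerim_add_le (a b : ℕ) : halfPerim (a + b) ≤ halfPerim a + halfPerim b :=
  halfPerim_le_iff.2
    ((add_le_add (le_qsq_halfPerim a) (le_qsq_halfPerim b)).trans (qsq_add_qsq_le _ _))

/-- Beyond a quasi-square the optimum jumps: `⌈2√(q(s) + x)⌉ ≥ s + 1` for `x ≥ 1`
(Alonso–Cerf: "except the quasisquares, no rectangle can grow and stay minimal").
[cite: AlonsoCerf1996, Proposition 2.15 and Lemma 2.12] -/
theorem succ_le_halfPerim_qsq_add {s x : ℕ} (hx : 1 ≤ x) : s + 1 ≤ halfPerim (qsq s + x) := by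
  by_contra h
  have : halfPerim (qsq s + x) ≤ s := by omega
  have := halfPerim_le_iff.1 this
  omega

/-- **The quasi-square exchange inequality** ([AL13] property **P**(2,·), the planar input of the
three-dimensional induction): if `n₁, n₂ ≤ Q = q(s) ≤ n₁ + n₂` then
`⌈2√Q⌉ + ⌈2√(n₁ + n₂ − Q)⌉ ≤ ⌈2√n₁⌉ + ⌈2√n₂⌉` — filling a quasi-square first is never worse.
[cite: AgnarssonLauria2013, §5 (statements P(d,n), P'(d,n) and the implication (15), d = 2)] -/
theorem halfPerim_qsq_add_halfPerim_sub_le {s n₁ n₂ : ℕ} (h₁ : n₁ ≤ qsq s) (h₂ : n₂ ≤ qsq s)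
    (h : qsq s ≤ n₁ + n₂) :
    halfPerim (qsq s) + halfPerim (n₁ + n₂ - qsq s) ≤ halfPerim n₁ + halfPerim n₂ := by
  -- the degenerate case `n₁ = n₂ = 0`
  rcases Nat.eq_zero_or_pos (n₁ + n₂) with h0 | hpos
  · have hq : qsq s = 0 := by omega
    rw [hq, show n₁ = 0 by omega, show n₂ = 0 by omega, halfPerim_zero]
  set s₁ := halfPerim n₁ with hs₁
  set s₂ := halfPerim n₂ with hs₂
  have hs₁s : s₁ ≤ s := halfPerim_le_iff.2 h₁
  have hs₂s : s₂ ≤ s := halfPerim_le_iff.2 h₂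
  have hn₁ : n₁ ≤ qsq s₁ := le_qsq_halfPerim n₁
  have hn₂ : n₂ ≤ qsq s₂ := le_qsq_halfPerim n₂
  -- `s ≤ s₁ + s₂`
  have hss : s ≤ s₁ + s₂ := by
    by_contra hlt
    have hle : s₁ + s₂ + 1 ≤ s := by omega
    have h3 : qsq (s₁ + s₂ + 1) ≤ qsq s := qsq_mono hle
    rw [qsq_succ] at h3
    have h4 := qsq_add_qsq_le s₁ s₂
    have h5 : 1 ≤ (s₁ + s₂ + 1) / 2 := by
      have : 1 ≤ s₁ + s₂ := by
        by_contra h6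
        have : s₁ = 0 ∧ s₂ = 0 := by omega
        rw [this.1, qsq_zero] at hn₁; rw [this.2, qsq_zero] at hn₂
        omega
      omega
    omega
  -- capacity rearrangement: `q(s₁) + q(s₂) ≤ q(s) + q(s₁ + s₂ − s)`
  have key : qsq s₁ + qsq s₂ ≤ qsq s + qsq (s₁ + s₂ - s) := by
    rcases le_total s₂ s₁ with h12 | h12
    · have := qsq_add_qsq_le_qsq_add_qsq_sub (a := s₁) (b := s₂) (by omega) (σ := s - s₁) (by omega)
      rwa [show s₁ + (s - s₁) = s by omega, show s₂ - (s - s₁) = s₁ + s₂ - s by omega] at this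
    · have := qsq_add_qsq_le_qsq_add_qsq_sub (a := s₂) (b := s₁) (by omega) (σ := s - s₂) (by omega)
      rw [show s₂ + (s - s₂) = s by omega, show s₁ - (s - s₂) = s₁ + s₂ - s by omega] at this
      omega
  have hA : halfPerim (qsq s) ≤ s := halfPerim_le_iff.2 le_rfl
  have hB : halfPerim (n₁ + n₂ - qsq s) ≤ s₁ + s₂ - s := halfPerim_le_iff.2 (by omega)
  omega

/-- **The bar inequality**: `⌈2√r⌉ ≤ ⌈2√(r − x)⌉ + 1` when `x(x+1) ≤ r` — a bar of `x ≤ ⌊√(r−x)⌋`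
points fits against a side of the optimal `(r − x)`-point daisy ([AL13] Lemma 6.3 one dimension
down, used in the "second case" of the induction). [cite: AgnarssonLauria2013, Lemma 6.3 and §6 (proof of Theorem 6.4, second case)] -/
theorem halfPerim_le_halfPerim_sub_add_one {r x : ℕ} (h : x * (x + 1) ≤ r) :
    halfPerim r ≤ halfPerim (r - x) + 1 := by
  set t := halfPerim (r - x) with ht
  have h1 : r - x ≤ qsq t := le_qsq_halfPerim _
  have h2 : x ^ 2 ≤ qsq t := by
    have hx : x * (x + 1) = x ^ 2 + x := by ring
    omega
  have h3 : 2 * x ≤ t := by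
    have h4 : (2 * x) ^ 2 ≤ t ^ 2 := by
      have := four_mul_qsq_le t
      calc (2 * x) ^ 2 = 4 * x ^ 2 := by ring
        _ ≤ t ^ 2 := by omega
    exact (Nat.pow_le_pow_iff_left (by norm_num)).1 h4
  refine halfPerim_le_iff.2 ?_
  rw [qsq_succ]
  omega


/-! ### Quasi-cubes and the three-dimensional optimum `G₃` -/

/-- `⌊∛n⌋³ ≤ n < (⌊∛n⌋ + 1)³` for the tree's `latticeRootFloor 3 n = ⌊n^{1/3}⌋`.
[cite: MaininiPiovanoSchmidtStefanelli2019, §1 eq. (2) (ℓ_n = ⌊∛n⌋)] -/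
theorem latticeRootFloor_three_spec (n : ℕ) :
    latticeRootFloor 3 n ^ 3 ≤ n ∧ n < (latticeRootFloor 3 n + 1) ^ 3 :=
  ⟨latticeRootFloor_pow_le (by norm_num) n, lt_latticeRootFloor_succ_pow (by norm_num) n⟩

/-- `⌊∛n⌋` is characterised by `m³ ≤ n < (m+1)³`. [cite: MaininiPiovanoSchmidtStefanelli2019, §1 eq. (2)] -/
theorem latticeRootFloor_three_eq {n m : ℕ} (h1 : m ^ 3 ≤ n) (h2 : n < (m + 1) ^ 3) :
    latticeRootFloor 3 n = m := by
  obtain ⟨h3, h4⟩ := latticeRootFloor_three_spec n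
  have hrm : latticeRootFloor 3 n ≤ m := by
    by_contra h0
    have : (m + 1) ^ 3 ≤ latticeRootFloor 3 n ^ 3 := Nat.pow_le_pow_left (Nat.lt_of_not_le h0) 3
    omega
  have hmr : m ≤ latticeRootFloor 3 n := by
    by_contra h0
    have : (latticeRootFloor 3 n + 1) ^ 3 ≤ m ^ 3 := Nat.pow_le_pow_left (Nat.lt_of_not_le h0) 3
    omega
  omega

/-- The **face of the maximal quasi-cube below `n`** (given `m = ⌊∛n⌋`): the largest
`F ∈ {m², m(m+1), (m+1)²}` with `m·F ≤ n`, so that `m·F ∈ {m³, m²(m+1), m(m+1)²}` is the largest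
quasi-cube `j(j+δ)(j+θ) ≤ n` (Alonso–Cerf) / pseudo-cubic `[m,ℓ]³ ≤ n` (Agnarsson–Lauria), made of
`m` layers of the quasi-square `F`. [cite: AlonsoCerf1996, Lemma 3.2; AgnarssonLauria2013, Definition 5.1 and Proposition 5.3] -/
def cubicFace (m n : ℕ) : ℕ :=
  if m * (m + 1) ^ 2 ≤ n then (m + 1) ^ 2 else if m ^ 2 * (m + 1) ≤ n then m * (m + 1) else m ^ 2

/-- **Half the minimal edge perimeter of `n` points of `ℤ³`**: for `n = m·F + r` (`m = ⌊∛n⌋`,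
`F = cubicFace m n`, `0 ≤ r < F`), `G₃(n) = F + m·⌈2√F⌉ + ⌈2√r⌉` — the three face areas
`ab + bc + ca` of the quasi-cube plus the half-perimeter of the extra quasi-square layer with its bar
(Alonso–Cerf's minimal area, halved; Agnarsson–Lauria's `δ₃(n)`). `G₃(0) = 0`.
[cite: AlonsoCerf1996, Corollary 3.4; AgnarssonLauria2013, Observation 5.12 and Theorem 6.4 (d = 3)] -/
noncomputable def cubicEIP (n : ℕ) : ℕ :=
  if n = 0 then 0 else
    cubicFace (latticeRootFloor 3 n) n +
        latticeRootFloor 3 n * halfPerim (cubicFace (latticeRootFloor 3 n) n) +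
      halfPerim (n - latticeRootFloor 3 n * cubicFace (latticeRootFloor 3 n) n)

/-- `G₃(0) = 0`. [cite: AlonsoCerf1996, Corollary 3.4] -/
theorem cubicEIP_zero : cubicEIP 0 = 0 := if_pos rfl

/-- Unfolding `G₃` once `⌊∛n⌋` and the face are known. [cite: AlonsoCerf1996, Corollary 3.4] -/
theorem cubicEIP_eq {n m F : ℕ} (hn : n ≠ 0) (h1 : m ^ 3 ≤ n) (h2 : n < (m + 1) ^ 3)
    (hF : cubicFace m n = F) : cubicEIP n = F + m * halfPerim F + halfPerim (n - m * F) := by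
  rw [cubicEIP, if_neg hn, latticeRootFloor_three_eq h1 h2, hF]

/-- The face in the top regime `m(m+1)² ≤ n`. [cite: AlonsoCerf1996, Lemma 3.2] -/
theorem cubicFace_of_top {m n : ℕ} (h : m * (m + 1) ^ 2 ≤ n) : cubicFace m n = (m + 1) ^ 2 :=
  if_pos h

/-- The face in the middle regime `m²(m+1) ≤ n < m(m+1)²`. [cite: AlonsoCerf1996, Lemma 3.2] -/
theorem cubicFace_of_mid {m n : ℕ} (h1 : n < m * (m + 1) ^ 2) (h2 : m ^ 2 * (m + 1) ≤ n) :
    cubicFace m n = m * (m + 1) := by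
  rw [cubicFace, if_neg (not_le.2 h1), if_pos h2]

/-- The face in the bottom regime `n < m²(m+1)`. [cite: AlonsoCerf1996, Lemma 3.2] -/
theorem cubicFace_of_bot {m n : ℕ} (h1 : n < m ^ 2 * (m + 1)) : cubicFace m n = m ^ 2 := by
  have h0 : n < m * (m + 1) ^ 2 := by
    have : m ^ 2 * (m + 1) ≤ m * (m + 1) ^ 2 := by nlinarith
    omega
  rw [cubicFace, if_neg (not_le.2 h0), if_neg (not_le.2 h1)]

/-- `G₃(1) = 3` (a single point has `6` boundary pairs). [cite: AlonsoCerf1996, Corollary 3.4] -/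
theorem cubicEIP_one : cubicEIP 1 = 3 := by
  have hF : cubicFace 1 1 = 1 ^ 2 := cubicFace_of_bot (by norm_num)
  rw [cubicEIP_eq one_ne_zero (m := 1) (by norm_num) (by norm_num) hF, halfPerim_sq le_rfl]
  simp [halfPerim_zero]

/-! #### The inductive inequality `G₃(n) ≤ G₃(n − A) + ⌈2√A⌉`, regime by regime -/

section Arithmetic

variable {n m A : ℕ}

/-- Top regime, first case (`A ≤ r`): subadditivity. [cite: AgnarssonLauria2013, §6 (proof of Theorem 6.4, first case)] -/
private theorem step_top_first (hn0 : n ≠ 0) (hnA : n - A ≠ 0) (hm2 : n < (m + 1) ^ 3)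
    (htop : m * (m + 1) ^ 2 ≤ n) (hc : A ≤ n - m * (m + 1) ^ 2) :
    cubicEIP n ≤ cubicEIP (n - A) + halfPerim A := by
  have e2 : m ^ 3 ≤ m * (m + 1) ^ 2 := by nlinarith
  rw [cubicEIP_eq hn0 (m := m) (by omega) hm2 (cubicFace_of_top htop),
    cubicEIP_eq hnA (m := m) (by omega) (by omega) (cubicFace_of_top (by omega))]
  have := halfPerim_add_le (n - A - m * (m + 1) ^ 2) A
  rw [show n - A - m * (m + 1) ^ 2 + A = n - m * (m + 1) ^ 2 by omega] at this
  omega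

/-- Top regime, second case (`A > r`): `n − A` lies in `[m²(m+1), m(m+1)²)`; quasi-square exchange
at `Q = m(m+1)`, or the bar inequality when `A > m(m+1)`. [cite: AgnarssonLauria2013, §6 (proof of Theorem 6.4, second case)] -/
private theorem step_top_second (hm0 : 1 ≤ m) (hnA : n - A ≠ 0) (hm2 : n < (m + 1) ^ 3)
    (htop : m * (m + 1) ^ 2 ≤ n) (hc : n - m * (m + 1) ^ 2 < A) (hA2 : (m + 1) * A ≤ n)
    (hAn : A ≤ n) : cubicEIP n ≤ cubicEIP (n - A) + halfPerim A := by
  have hn0 : n ≠ 0 := by omega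
  have e1 : (m + 1) ^ 3 = m * (m + 1) ^ 2 + (m + 1) ^ 2 := by ring
  have e2 : m * (m + 1) ^ 2 = m ^ 2 * (m + 1) + m * (m + 1) := by ring
  have e3 : m ^ 2 * (m + 1) = m ^ 3 + m ^ 2 := by ring
  have e4 : (m + 1) ^ 2 = m * (m + 1) + (m + 1) := by ring
  have e9 : m * (m * (m + 1)) = m ^ 2 * (m + 1) := by ring
  have e7 : (m + 1) * (n - A) + (m + 1) * A = (m + 1) * n := by
    rw [← Nat.mul_add, Nat.sub_add_cancel hAn]
  have e8 : (m + 1) * n = m * n + n := by ring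
  have hN1 : m ^ 2 * (m + 1) ≤ n - A := by
    have h9 : m * (m * (m + 1) ^ 2) ≤ m * n := Nat.mul_le_mul_left m htop
    have h10 : m * (m * (m + 1) ^ 2) = (m + 1) * (m ^ 2 * (m + 1)) := by ring
    have h11 : (m + 1) * (m ^ 2 * (m + 1)) ≤ (m + 1) * (n - A) := by omega
    exact Nat.le_of_mul_le_mul_left h11 (by omega)
  rw [cubicEIP_eq hn0 (m := m) (by omega) hm2 (cubicFace_of_top htop),
    halfPerim_sq (by omega : 1 ≤ m + 1),
    cubicEIP_eq hnA (m := m) (by omega) (by omega) (cubicFace_of_mid (by omega) hN1),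
    halfPerim_mul_succ hm0]
  have hq : qsq (2 * m + 1) = m * (m + 1) := qsq_two_mul_add_one m
  have e11 : m * (2 * (m + 1)) = 2 * m ^ 2 + 2 * m := by ring
  have e12 : m * (2 * m + 1) = 2 * m ^ 2 + m := by ring
  clear e7 e8
  by_cases hsub : A ≤ m * (m + 1)
  · have hP := halfPerim_qsq_add_halfPerim_sub_le (s := 2 * m + 1)
      (n₁ := n - A - m * (m * (m + 1))) (n₂ := A) (by omega) (by omega) (by omega)
    rw [hq, halfPerim_mul_succ hm0,
      show n - A - m * (m * (m + 1)) + A - m * (m + 1) = n - m * (m + 1) ^ 2 by omega] at hP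
    omega
  · obtain ⟨x, hx⟩ : ∃ x, A = x + m * (m + 1) := ⟨A - m * (m + 1), by omega⟩
    have e10 : (m + 1) * A = (m + 1) * x + m * (m + 1) ^ 2 := by rw [hx]; ring
    have hx1 : (m + 1) * x ≤ n - m * (m + 1) ^ 2 := by omega
    have hx2 : x + 1 ≤ m + 1 := by
      have h14 : (m + 1) * A < (m + 1) * (m + 1) ^ 2 := by
        calc (m + 1) * A ≤ n := hA2
          _ < (m + 1) ^ 3 := hm2
          _ = (m + 1) * (m + 1) ^ 2 := by ring
      have := Nat.lt_of_mul_lt_mul_left h14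
      omega
    have hx3 : x * (x + 1) ≤ n - m * (m + 1) ^ 2 :=
      (Nat.mul_le_mul_left _ hx2).trans (by rw [Nat.mul_comm]; exact hx1)
    have hbar := halfPerim_le_halfPerim_sub_add_one hx3
    rw [show n - m * (m + 1) ^ 2 - x = n - A - m * (m * (m + 1)) by omega] at hbar
    have hjump : 2 * m + 1 + 1 ≤ halfPerim A := by
      have h15 := succ_le_halfPerim_qsq_add (s := 2 * m + 1) (x := x) (by omega)
      rwa [hq, show m * (m + 1) + x = A by omega] at h15
    omega

/-- Middle regime, first case. [cite: AgnarssonLauria2013, §6 (first case)] -/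
private theorem step_mid_first (hn0 : n ≠ 0) (hnA : n - A ≠ 0)
    (htop : n < m * (m + 1) ^ 2) (hmid : m ^ 2 * (m + 1) ≤ n)
    (hc : A ≤ n - m * (m * (m + 1))) : cubicEIP n ≤ cubicEIP (n - A) + halfPerim A := by
  have e1 : (m + 1) ^ 3 = m * (m + 1) ^ 2 + (m + 1) ^ 2 := by ring
  have e3 : m ^ 2 * (m + 1) = m ^ 3 + m ^ 2 := by ring
  have e9 : m * (m * (m + 1)) = m ^ 2 * (m + 1) := by ring
  rw [cubicEIP_eq hn0 (m := m) (by omega) (by omega) (cubicFace_of_mid htop hmid),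
    cubicEIP_eq hnA (m := m) (by omega) (by omega) (cubicFace_of_mid (by omega) (by omega))]
  have := halfPerim_add_le (n - A - m * (m * (m + 1))) A
  rw [show n - A - m * (m * (m + 1)) + A = n - m * (m * (m + 1)) by omega] at this
  omega

/-- Middle regime, second case: `n − A ∈ [m³, m²(m+1))`; exchange at `Q = m²`, or the bar
inequality when `A > m²`. [cite: AgnarssonLauria2013, §6 (second case)] -/
private theorem step_mid_second (hm0 : 1 ≤ m) (hnA : n - A ≠ 0)
    (htop : n < m * (m + 1) ^ 2) (hmid : m ^ 2 * (m + 1) ≤ n) (hc : n - m * (m * (m + 1)) < A)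
    (hA2 : (m + 1) * A ≤ n) (hAn : A ≤ n) : cubicEIP n ≤ cubicEIP (n - A) + halfPerim A := by
  have hn0 : n ≠ 0 := by omega
  have e1 : (m + 1) ^ 3 = m * (m + 1) ^ 2 + (m + 1) ^ 2 := by ring
  have e2 : m * (m + 1) ^ 2 = m ^ 2 * (m + 1) + m * (m + 1) := by ring
  have e3 : m ^ 2 * (m + 1) = m ^ 3 + m ^ 2 := by ring
  have e5 : m * (m + 1) = m ^ 2 + m := by ring
  have e9 : m * (m * (m + 1)) = m ^ 2 * (m + 1) := by ring
  have e13 : m * m ^ 2 = m ^ 3 := by ring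
  have e7 : (m + 1) * (n - A) + (m + 1) * A = (m + 1) * n := by
    rw [← Nat.mul_add, Nat.sub_add_cancel hAn]
  have e8 : (m + 1) * n = m * n + n := by ring
  have hN1 : m ^ 3 ≤ n - A := by
    have h9 : m * (m ^ 2 * (m + 1)) ≤ m * n := Nat.mul_le_mul_left m hmid
    have h10 : m * (m ^ 2 * (m + 1)) = (m + 1) * m ^ 3 := by ring
    have h11 : (m + 1) * m ^ 3 ≤ (m + 1) * (n - A) := by omega
    exact Nat.le_of_mul_le_mul_left h11 (by omega)
  rw [cubicEIP_eq hn0 (m := m) (by omega) (by omega) (cubicFace_of_mid htop hmid),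
    halfPerim_mul_succ hm0,
    cubicEIP_eq hnA (m := m) hN1 (by omega) (cubicFace_of_bot (by omega)), halfPerim_sq hm0]
  have hq : qsq (2 * m) = m ^ 2 := qsq_two_mul m
  have e12 : m * (2 * m + 1) = 2 * m ^ 2 + m := by ring
  have e14 : m * (2 * m) = 2 * m ^ 2 := by ring
  clear e7 e8
  by_cases hsub : A ≤ m ^ 2
  · have hP := halfPerim_qsq_add_halfPerim_sub_le (s := 2 * m)
      (n₁ := n - A - m * m ^ 2) (n₂ := A) (by omega) (by omega) (by omega)
    rw [hq, halfPerim_sq hm0,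
      show n - A - m * m ^ 2 + A - m ^ 2 = n - m * (m * (m + 1)) by omega] at hP
    omega
  · obtain ⟨x, hx⟩ : ∃ x, A = x + m ^ 2 := ⟨A - m ^ 2, by omega⟩
    have e10 : (m + 1) * A = (m + 1) * x + m ^ 2 * (m + 1) := by rw [hx]; ring
    have hx1 : (m + 1) * x ≤ n - m * (m * (m + 1)) := by omega
    have hx2 : x + 1 ≤ m + 1 := by
      have h14 : (m + 1) * A < (m + 1) * (m * (m + 1)) := by
        calc (m + 1) * A ≤ n := hA2
          _ < m * (m + 1) ^ 2 := htop
          _ = (m + 1) * (m * (m + 1)) := by ring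
      have := Nat.lt_of_mul_lt_mul_left h14
      omega
    have hx3 : x * (x + 1) ≤ n - m * (m * (m + 1)) :=
      (Nat.mul_le_mul_left _ hx2).trans (by rw [Nat.mul_comm]; exact hx1)
    have hbar := halfPerim_le_halfPerim_sub_add_one hx3
    rw [show n - m * (m * (m + 1)) - x = n - A - m * m ^ 2 by omega] at hbar
    have hjump : 2 * m + 1 ≤ halfPerim A := by
      have h15 := succ_le_halfPerim_qsq_add (s := 2 * m) (x := x) (by omega)
      rwa [hq, show m ^ 2 + x = A by omega] at h15
    omega

/-- Bottom regime, first case. [cite: AgnarssonLauria2013, §6 (first case)] -/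
private theorem step_bot_first (hn0 : n ≠ 0) (hnA : n - A ≠ 0) (hm1 : m ^ 3 ≤ n)
    (hmid : n < m ^ 2 * (m + 1)) (hc : A ≤ n - m * m ^ 2) :
    cubicEIP n ≤ cubicEIP (n - A) + halfPerim A := by
  have e1 : (m + 1) ^ 3 = m * (m + 1) ^ 2 + (m + 1) ^ 2 := by ring
  have e2 : m * (m + 1) ^ 2 = m ^ 2 * (m + 1) + m * (m + 1) := by ring
  have e13 : m * m ^ 2 = m ^ 3 := by ring
  rw [cubicEIP_eq hn0 (m := m) hm1 (by omega) (cubicFace_of_bot hmid),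
    cubicEIP_eq hnA (m := m) (by omega) (by omega) (cubicFace_of_bot (by omega))]
  have := halfPerim_add_le (n - A - m * m ^ 2) A
  rw [show n - A - m * m ^ 2 + A = n - m * m ^ 2 by omega] at this
  omega

/-- Bottom regime, second case: `n − A ∈ [m³ − m², m³)`, so `⌊∛(n − A)⌋ = m − 1` with face `m²`;
exchange at `Q = m²`. [cite: AgnarssonLauria2013, §6 (second case with ℓ_d = 0)] -/
private theorem step_bot_second (hm2' : 2 ≤ m) (hnA : n - A ≠ 0) (hm1 : m ^ 3 ≤ n)
    (hmid : n < m ^ 2 * (m + 1)) (hc : n - m * m ^ 2 < A) (hAm : A ≤ m ^ 2) :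
    cubicEIP n ≤ cubicEIP (n - A) + halfPerim A := by
  have hn0 : n ≠ 0 := by omega
  have hm0 : 1 ≤ m := by omega
  have e1 : (m + 1) ^ 3 = m * (m + 1) ^ 2 + (m + 1) ^ 2 := by ring
  have e2 : m * (m + 1) ^ 2 = m ^ 2 * (m + 1) + m * (m + 1) := by ring
  have e13 : m * m ^ 2 = m ^ 3 := by ring
  have e15 : (m - 1) * m ^ 2 + m ^ 2 = m ^ 3 := by
    have : (m - 1) * m ^ 2 + m ^ 2 = (m - 1 + 1) * m ^ 2 := by ring
    rw [this, Nat.sub_add_cancel hm0]; ring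
  have hN1 : (m - 1) * m ^ 2 ≤ n - A := by omega
  have hN2 : n - A < m ^ 3 := by omega
  have hroot1 : (m - 1) ^ 3 ≤ n - A := by
    have : (m - 1) ^ 3 ≤ (m - 1) * m ^ 2 := by
      rw [show (m - 1) ^ 3 = (m - 1) * (m - 1) ^ 2 by ring]
      exact Nat.mul_le_mul_left _ (Nat.pow_le_pow_left (Nat.sub_le m 1) 2)
    omega
  have hface : cubicFace (m - 1) (n - A) = (m - 1 + 1) ^ 2 :=
    cubicFace_of_top (by rw [Nat.sub_add_cancel hm0]; exact hN1)
  rw [Nat.sub_add_cancel hm0] at hface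
  rw [cubicEIP_eq hn0 (m := m) hm1 (by omega) (cubicFace_of_bot hmid), halfPerim_sq hm0,
    cubicEIP_eq hnA hroot1 (by rw [Nat.sub_add_cancel hm0]; exact hN2) hface, halfPerim_sq hm0]
  have hq : qsq (2 * m) = m ^ 2 := qsq_two_mul m
  have hP := halfPerim_qsq_add_halfPerim_sub_le (s := 2 * m)
    (n₁ := n - A - (m - 1) * m ^ 2) (n₂ := A) (by omega) (by omega) (by omega)
  rw [hq, halfPerim_sq hm0,
    show n - A - (m - 1) * m ^ 2 + A - m ^ 2 = n - m * m ^ 2 by omega] at hP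
  have e14 : m * (2 * m) = 2 * m ^ 2 := by ring
  have e16 : (m - 1) * (2 * m) + 2 * m = 2 * m ^ 2 := by
    have : (m - 1) * (2 * m) + 2 * m = (m - 1 + 1) * (2 * m) := by ring
    rw [this, Nat.sub_add_cancel hm0]; ring
  omega

end Arithmetic

/-- **The arithmetic of quasi-cubes** (the inductive step of [AL13] §6 for `d = 3`, both cases, with
Observation 6.1): if `h·A ≤ n ≤ h³` (a configuration of `n ≥ 2` points met by `h` parallel
lattice planes, the least occupied of which carries `A` points) then
`G₃(n) ≤ G₃(n − A) + ⌈2√A⌉`.  First case (`A ≤ r`): subadditivity of `⌈2√·⌉`; second case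
(`A > r`, so that `n − A` lies in the quasi-cube interval just below): the quasi-square exchange
inequality, or — when the removed layer exceeds the smaller face — the bar inequality.
[cite: AgnarssonLauria2013, §6 (Observations 6.1–6.2, Lemma 6.3, proof of Theorem 6.4: first and second case)] -/
theorem cubicEIP_le_cubicEIP_sub_add {n A h : ℕ} (hn : 2 ≤ n) (hhA : h * A ≤ n)
    (hh : n ≤ h ^ 3) : cubicEIP n ≤ cubicEIP (n - A) + halfPerim A := by
  obtain ⟨hm1, hm2⟩ := latticeRootFloor_three_spec n
  set m := latticeRootFloor 3 n with hm
  have e3 : m ^ 2 * (m + 1) = m ^ 3 + m ^ 2 := by ring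
  have e13 : m * m ^ 2 = m ^ 3 := by ring
  have hm0 : 1 ≤ m := by
    rcases Nat.eq_zero_or_pos m with h00 | h00
    · rw [h00] at hm2; norm_num at hm2; omega
    · exact h00
  have hmsq : 1 ≤ m ^ 2 := Nat.one_le_pow _ _ hm0
  have hmh : m ≤ h := by
    by_contra h0
    have : h ^ 3 < m ^ 3 := Nat.pow_lt_pow_left (Nat.lt_of_not_le h0) (by norm_num)
    omega
  have key : (m + 1) * A ≤ n ∨ (n = m ^ 3 ∧ m * A ≤ n) := by
    rcases Nat.lt_or_ge m h with hlt | hge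
    · exact Or.inl ((Nat.mul_le_mul_right A hlt).trans hhA)
    · have hhm : h = m := le_antisymm hge hmh
      rw [hhm] at hh hhA
      exact Or.inr ⟨le_antisymm hh hm1, hhA⟩
  have e6 : (m + 1) * A = m * A + A := by ring
  have hmA : A ≤ m * A := Nat.le_mul_of_pos_left A hm0
  have hAn : A < n := by
    rcases key with k | ⟨k1, k2⟩
    · omega
    · have hm2' : 2 ≤ m := by
        by_contra h0
        have h01 : m = 1 := by omega
        rw [h01] at k1; norm_num at k1; omega
      have : 2 * A ≤ m * A := Nat.mul_le_mul_right A hm2'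
      omega
  have hnA : n - A ≠ 0 := by omega
  have hn0 : n ≠ 0 := by omega
  clear hhA hh hmh
  by_cases htop : m * (m + 1) ^ 2 ≤ n
  · by_cases hc : A ≤ n - m * (m + 1) ^ 2
    · exact step_top_first hn0 hnA hm2 htop hc
    · refine step_top_second hm0 hnA hm2 htop (Nat.lt_of_not_le hc) ?_ hAn.le
      rcases key with k | ⟨k1, -⟩
      · exact k
      · exfalso
        have : m ^ 3 < m * (m + 1) ^ 2 := by nlinarith
        omega
  · by_cases hmid : m ^ 2 * (m + 1) ≤ n
    · by_cases hc : A ≤ n - m * (m * (m + 1))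
      · exact step_mid_first hn0 hnA (Nat.lt_of_not_le htop) hmid hc
      · refine step_mid_second hm0 hnA (Nat.lt_of_not_le htop) hmid (Nat.lt_of_not_le hc) ?_ hAn.le
        rcases key with k | ⟨k1, -⟩
        · exact k
        · exfalso; omega
    · by_cases hc : A ≤ n - m * m ^ 2
      · exact step_bot_first hn0 hnA hm1 (Nat.lt_of_not_le hmid) hc
      · have hAm : A ≤ m ^ 2 := by
          rcases key with k | ⟨k1, k2⟩
          · have h14 : (m + 1) * A < (m + 1) * m ^ 2 := by
              calc (m + 1) * A ≤ n := k
                _ < m ^ 2 * (m + 1) := Nat.lt_of_not_le hmid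
                _ = (m + 1) * m ^ 2 := by ring
            exact (Nat.lt_of_mul_lt_mul_left h14).le
          · rw [k1, ← e13] at k2
            exact Nat.le_of_mul_le_mul_left k2 hm0
        have hm2' : 2 ≤ m := by
          by_contra h0
          have h01 : m = 1 := by omega
          rw [h01] at hmid; norm_num at hmid; omega
        exact step_bot_second hm2' hnA hm1 (Nat.lt_of_not_le hmid) (Nat.lt_of_not_le hc) hAm


/-! ### Sorted daisy stacks -/

section DaisyStack

/-- The **daisy stack** of a profile `f`: the daisies `D_{f(k)}` (`daisyOf`) placed in the horizontal
planes `x₀ = k`, `k < T` — for a nonincreasing profile this is the "fully nested" configuration of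
[AL13] §2 (every slice a nested planar minimizer, [MS20] Proposition 3.2's rearrangement `C_s` after
the decreasing reordering of the levels). [cite: AgnarssonLauria2013, Definition 2.1 and Corollary 2.8; MaininiSchmidt2020, Proposition 3.2] -/
noncomputable def daisyStack (f : ℕ → ℕ) (T : ℕ) : Finset (Site 3) :=
  (range T).biUnion fun k => (daisyOf (f k)).image (Fin.cons (k : ℤ))

variable {f : ℕ → ℕ} {T : ℕ}

/-- Membership in a daisy stack. [cite: AgnarssonLauria2013, Definition 2.1] -/
theorem mem_daisyStack {x : Site 3} :
    x ∈ daisyStack f T ↔ ∃ k, k < T ∧ x 0 = k ∧ Fin.tail x ∈ daisyOf (f k) := by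
  simp only [daisyStack, mem_biUnion, mem_range, mem_image]
  constructor
  · rintro ⟨k, hk, y, hy, rfl⟩
    exact ⟨k, hk, by simp, by simpa using hy⟩
  · rintro ⟨k, hk, h0, hy⟩
    exact ⟨k, hk, Fin.tail x, hy, by rw [← h0, Fin.cons_self_tail]⟩

/-- The slice of a daisy stack at an occupied height. [cite: MaininiSchmidt2020, Proposition 3.2 (P S_{s,k}(C_s) = D_{s,σ(k)})] -/
theorem sliceAt_daisyStack_natCast (hT : ∀ k, T ≤ k → f k = 0) (k : ℕ) :
    sliceAt (daisyStack f T) (k : ℤ) = daisyOf (f k) := by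
  ext y
  rw [mem_sliceAt, mem_daisyStack]
  constructor
  · rintro ⟨k', -, h0, hy⟩
    simp only [Fin.cons_zero, Nat.cast_inj] at h0
    subst h0
    simpa using hy
  · intro hy
    by_cases hk : k < T
    · exact ⟨k, hk, by simp, by simpa using hy⟩
    · exfalso
      have h0 : daisyOf (f k) = ∅ := by
        rw [← card_eq_zero, card_daisyOf, hT k (Nat.le_of_not_lt hk)]
      rw [h0] at hy
      simp at hy

/-- Below the stack the slice is empty. [cite: MaininiSchmidt2020, Proposition 3.2] -/
theorem sliceAt_daisyStack_neg_one : sliceAt (daisyStack f T) (-1) = ∅ := by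
  refine eq_empty_of_forall_notMem fun y hy => ?_
  rw [mem_sliceAt, mem_daisyStack] at hy
  obtain ⟨k, -, h0, -⟩ := hy
  simp only [Fin.cons_zero] at h0
  omega

/-- The occupied heights of a daisy stack with positive profile are `0, …, T−1`.
[cite: AgnarssonLauria2013, Definition 2.1] -/
theorem firstCoords_daisyStack (hpos : ∀ k, k < T → 0 < f k) :
    firstCoords (daisyStack f T) = (range T).image (Nat.cast : ℕ → ℤ) := by
  ext t
  rw [firstCoords, mem_image, mem_image]
  constructor
  · rintro ⟨x, hx, rfl⟩
    obtain ⟨k, hk, h0, -⟩ := mem_daisyStack.1 hx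
    exact ⟨k, mem_range.2 hk, h0.symm⟩
  · rintro ⟨k, hk, rfl⟩
    have hne : (daisyOf (f k)).Nonempty := by
      rw [← card_pos, card_daisyOf]; exact hpos k (mem_range.1 hk)
    obtain ⟨y, hy⟩ := hne
    exact ⟨Fin.cons (k : ℤ) y, mem_daisyStack.2 ⟨k, mem_range.1 hk, by simp, by simpa using hy⟩,
      by simp⟩

/-- **A daisy stack has `Σ_k f(k)` points.** [cite: MaininiSchmidt2020, Proposition 3.2 (#C_s = #C)] -/
theorem card_daisyStack (f : ℕ → ℕ) (T : ℕ) : #(daisyStack f T) = ∑ k ∈ range T, f k := by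
  rw [daisyStack, card_biUnion]
  · refine sum_congr rfl fun k _ => ?_
    rw [card_image_of_injective _ ((Fin.cons_injective2 (α := fun _ : Fin 3 => ℤ)).right _),
      card_daisyOf]
  · intro k _ k' _ hkk'
    rw [Function.onFun, Finset.disjoint_left]
    intro x hx hx'
    obtain ⟨y, -, rfl⟩ := mem_image.1 hx
    obtain ⟨y', -, h⟩ := mem_image.1 hx'
    have h0 := congrFun h 0
    simp only [Fin.cons_zero, Nat.cast_inj] at h0
    exact hkk' h0.symm

/-- The planar daisy `D_m` has exactly `2⌈2√m⌉` boundary pairs (it is an `EIP²` minimizer and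
`EIP²(m) = 2⌈2√m⌉`). [cite: MaininiPiovanoSchmidtStefanelli2019, §2 (θ_d = #Θ(D_d) = 2⌈2√d⌉)] -/
theorem card_boundaryPairs_daisyOf (m : ℕ) : #(boundaryPairs (daisyOf m)) = 2 * halfPerim m := by
  have h := (isEIPMinimizer_iff_card_boundaryPairs_eq (daisyOf m)).1 (isEIPMinimizer_daisyOf m)
  rw [card_daisyOf] at h
  rw [h, halfPerim_def]

/-- Telescoping for a nonincreasing profile: `Σ_{k<T} (f k − f (k+1)) = f 0 − f T`.
[cite: MaininiSchmidt2020, Proposition 3.2 (proof: Σ min{f(k_{i−1}), f(k_i)})] -/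
theorem sum_range_sub_succ_of_antitone (hf : Antitone f) (T : ℕ) :
    ∑ k ∈ range T, (f k - f (k + 1)) = f 0 - f T := by
  induction T with
  | zero => simp
  | succ T ih =>
    rw [sum_range_succ, ih]
    have h1 : f (T + 1) ≤ f T := hf (Nat.le_succ T)
    have h2 : f T ≤ f 0 := hf (Nat.zero_le T)
    omega

/-- **The edge perimeter of a sorted daisy stack**: for a nonincreasing profile `f`, positive below
`T` and vanishing from `T` on, `#Θ₃(daisyStack f T) = Σ_{k<T} 2⌈2√f(k)⌉ + 2·f(0)` — the slices
contribute their planar optima and the vertical pairs telescope to twice the largest slice (the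
quantity `Σ_k #Θ_{d−1} + Σ |f(k_i) − f(k_{i−1})|` of [MS20] Proposition 3.2 evaluated on `C_s`;
[AL13] Observation 3.1). [cite: MaininiSchmidt2020, Proposition 3.2; AgnarssonLauria2013, Observation 3.1] -/
theorem card_boundaryPairs_daisyStack (hpos : ∀ k, k < T → 0 < f k) (hf : Antitone f)
    (hT : f T = 0) :
    #(boundaryPairs (daisyStack f T)) = ∑ k ∈ range T, 2 * halfPerim (f k) + 2 * f 0 := by
  have hT' : ∀ k, T ≤ k → f k = 0 := fun k hk => Nat.le_zero.1 (hT ▸ hf hk)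
  have hinj : Set.InjOn (Nat.cast : ℕ → ℤ) ↑(range T) := fun a _ b _ h => by exact_mod_cast h
  rw [card_boundaryPairs_eq_sum_sliceAt_add (daisyStack f T),
    card_vertBoundaryPairs_eq_sum (daisyStack f T), card_vertBoundaryPairs_eq_sum (daisyStack f T),
    firstCoords_daisyStack hpos, sum_image hinj, sum_image hinj, sum_image hinj]
  simp only [if_true, Bool.false_eq_true, if_false]
  have hs1 : ∑ k ∈ range T, #(boundaryPairs (sliceAt (daisyStack f T) (k : ℤ))) =
      ∑ k ∈ range T, 2 * halfPerim (f k) := by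
    refine sum_congr rfl fun k _ => ?_
    rw [sliceAt_daisyStack_natCast hT', card_boundaryPairs_daisyOf]
  have hs2 : ∑ k ∈ range T, #(sliceAt (daisyStack f T) (k : ℤ) \ sliceAt (daisyStack f T) (k + 1)) =
      f 0 := by
    have : ∀ k ∈ range T, #(sliceAt (daisyStack f T) (k : ℤ) \ sliceAt (daisyStack f T) (k + 1)) =
        f k - f (k + 1) := by
      intro k _
      rw [show (k : ℤ) + 1 = ((k + 1 : ℕ) : ℤ) by push_cast; ring, sliceAt_daisyStack_natCast hT',
        sliceAt_daisyStack_natCast hT', isNestedMinimizerFamily_daisyOf.card_sdiff]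
    rw [sum_congr rfl this, sum_range_sub_succ_of_antitone hf, hT, Nat.sub_zero]
  have hs3 : ∑ k ∈ range T, #(sliceAt (daisyStack f T) (k : ℤ) \ sliceAt (daisyStack f T) (k + -1)) =
      f 0 := by
    cases T with
    | zero => rw [sum_range_zero, hT]
    | succ S =>
      rw [sum_range_succ']
      have h0 : #(sliceAt (daisyStack f (S + 1)) ((0 : ℕ) : ℤ) \
          sliceAt (daisyStack f (S + 1)) ((0 : ℕ) + -1)) = f 0 := by
        rw [show ((0 : ℕ) : ℤ) + -1 = -1 by simp, sliceAt_daisyStack_neg_one, sdiff_empty,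
          sliceAt_daisyStack_natCast hT', card_daisyOf]
      have h1 : ∀ k ∈ range S, #(sliceAt (daisyStack f (S + 1)) ((k + 1 : ℕ) : ℤ) \
          sliceAt (daisyStack f (S + 1)) ((k + 1 : ℕ) + -1)) = 0 := by
        intro k _
        rw [show ((k + 1 : ℕ) : ℤ) + -1 = ((k : ℕ) : ℤ) by push_cast; ring,
          sliceAt_daisyStack_natCast hT', sliceAt_daisyStack_natCast hT',
          isNestedMinimizerFamily_daisyOf.card_sdiff]
        exact Nat.sub_eq_zero_of_le (hf (Nat.le_succ k))
      rw [sum_congr rfl h1, sum_const_zero, h0, zero_add]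
  rw [hs1, hs2, hs3]
  ring

/-- Dropping the profile to zero from `S` on. [folklore] -/
private theorem antitone_truncate (hf : Antitone f) (S : ℕ) :
    Antitone (fun k => if k < S then f k else 0) := by
  intro a b hab
  dsimp only
  split_ifs with h1 h2
  · exact hf hab
  · omega
  · exact Nat.zero_le _
  · exact le_rfl

/-- **Removing the top daisy of a sorted stack costs exactly its planar perimeter**: with
`T = S + 1` levels, `#Θ₃(stack of S + 1) = #Θ₃(stack of the first S) + 2⌈2√f(S)⌉` (`S ≥ 1`) — the
cut along a side, [AL13] §4: `E_d(S) = E_d(S₁) + E_{d−1}(π(S₂)) + |S₂|`, in perimeter form.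
[cite: AgnarssonLauria2013, §4 (the special cut k = h before Lemma 4.1's discussion of equality)] -/
theorem card_boundaryPairs_daisyStack_succ {S : ℕ} (hS : 1 ≤ S) (hpos : ∀ k, k < S + 1 → 0 < f k)
    (hf : Antitone f) (hT : f (S + 1) = 0) :
    #(boundaryPairs (daisyStack f (S + 1))) =
      #(boundaryPairs (daisyStack (fun k => if k < S then f k else 0) S)) + 2 * halfPerim (f S) := by
  have hstack : daisyStack (fun k => if k < S then f k else 0) S = daisyStack f S := by
    unfold daisyStack
    refine biUnion_congr rfl fun k hk => ?_
    simp only [if_pos (mem_range.1 hk)]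
  rw [card_boundaryPairs_daisyStack hpos hf hT,
    card_boundaryPairs_daisyStack (f := fun k => if k < S then f k else 0)
      (fun k hk => by simp only [if_pos hk]; exact hpos k (by omega)) (antitone_truncate hf S)
      (by simp),
    sum_range_succ, if_pos (by omega : 0 < S)]
  have : ∑ k ∈ range S, 2 * halfPerim (if k < S then f k else 0) =
      ∑ k ∈ range S, 2 * halfPerim (f k) :=
    sum_congr rfl fun k hk => by rw [if_pos (mem_range.1 hk)]
  rw [this]
  ring

/-- The truncated stack has `Σ_{k<S} f(k)` points. [folklore] -/
private theorem card_daisyStack_truncate (S : ℕ) :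
    #(daisyStack (fun k => if k < S then f k else 0) S) = ∑ k ∈ range S, f k := by
  rw [card_daisyStack]
  exact sum_congr rfl fun k hk => by rw [if_pos (mem_range.1 hk)]

end DaisyStack


/-! ### The three-dimensional edge-isoperimetric inequality -/

section Main

/-- A finite subset of `ℤ^d` lies in the product of its coordinate projections, so
`#C ≤ ∏_i #{x_i : x ∈ C}` ([AL13]: "`m_d^d < n < h_1 ⋯ h_d`"). [cite: AgnarssonLauria2013, §6 (before Observation 6.1)] -/
theorem card_le_prod_card_image_apply {d : ℕ} (C : Finset (Site d)) :
    #C ≤ ∏ i, #(C.image fun x => x i) := by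
  rw [← Fintype.card_piFinset]
  exact card_le_card fun x hx => Fintype.mem_piFinset.2 fun i => mem_image_of_mem _ hx

/-- Hence some axis `e_s` meets `C` in at least `∛#C` lattice planes: `#C ≤ #{x_s : x ∈ C}³`
([AL13] Observation 6.1: "there is at least one `i` with `h_i ≥ m_d + 1`").
[cite: AgnarssonLauria2013, Observation 6.1] -/
theorem exists_card_le_card_image_apply_pow (C : Finset (Site 3)) :
    ∃ s : Fin 3, #C ≤ #(C.image fun x => x s) ^ 3 := by
  have h := card_le_prod_card_image_apply C
  rw [Fin.prod_univ_three] at h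
  set a := #(C.image fun x => x (0 : Fin 3))
  set b := #(C.image fun x => x (1 : Fin 3))
  set c := #(C.image fun x => x (2 : Fin 3))
  set M := max a (max b c) with hM
  have ha : a ≤ M := le_max_left _ _
  have hb : b ≤ M := (le_max_left _ _).trans (le_max_right _ _)
  have hc : c ≤ M := (le_max_right _ _).trans (le_max_right _ _)
  have hle : #C ≤ M ^ 3 := by
    calc #C ≤ a * b * c := h
      _ ≤ M * M * M := Nat.mul_le_mul (Nat.mul_le_mul ha hb) hc
      _ = M ^ 3 := by ring
  rcases max_choice a (max b c) with h1 | h1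
  · rw [hM, h1] at hle; exact ⟨0, hle⟩
  · rcases max_choice b c with h2 | h2
    · rw [hM, h1, h2] at hle; exact ⟨1, hle⟩
    · rw [hM, h1, h2] at hle; exact ⟨2, hle⟩

/-- Summing a function over a list, by position. [folklore] -/
private theorem sum_map_eq_sum_range_getD (l : List ℕ) (g : ℕ → ℕ) :
    (l.map g).sum = ∑ k ∈ range l.length, g (l.getD k 0) := by
  induction l with
  | nil => simp
  | cons a l ih =>
    rw [List.map_cons, List.sum_cons, List.length_cons, Finset.sum_range_succ', ih]
    simp [add_comm]

/-- **The decreasing rearrangement of the slice cardinalities** ([MS20] Proposition 3.2: "a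
bijection `σ` … such that `τ = f ∘ σ` is non increasing"): the slice sizes of `C ⊂ ℤ³` sorted into
a nonincreasing profile `f(0) ≥ f(1) ≥ ⋯ ≥ f(T−1) ≥ 1` (`T` = number of occupied heights, `f = 0`
from `T` on), with `Σ f = #C`, the same multiset of planar optima, and `f(0) ≤ #(projection)`.
[cite: MaininiSchmidt2020, Proposition 3.2 (decreasing rearrangement τ = f ∘ σ)] -/
theorem exists_sorted_sliceProfile (C : Finset (Site 3)) :
    ∃ f : ℕ → ℕ, Antitone f ∧ (∀ k, k < #(firstCoords C) → 0 < f k) ∧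
      (∀ k, #(firstCoords C) ≤ k → f k = 0) ∧
      ∑ k ∈ range #(firstCoords C), f k = #C ∧
      ∑ k ∈ range #(firstCoords C), 2 * halfPerim (f k) =
        ∑ t ∈ firstCoords C, 2 * halfPerim #(sliceAt C t) ∧
      (0 < #(firstCoords C) → f 0 ≤ #(dropFirst C)) := by
  classical
  set μ : Multiset ℕ := (firstCoords C).val.map fun t => #(sliceAt C t) with hμ
  set L : List ℕ := (μ.sort (· ≤ ·)).reverse with hL
  have hLlen : L.length = #(firstCoords C) := by
    rw [hL, List.length_reverse, Multiset.length_sort, hμ, Multiset.card_map, card_val]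
  have hLmem : ∀ a ∈ L, ∃ t ∈ firstCoords C, a = #(sliceAt C t) := by
    intro a ha
    rw [hL, List.mem_reverse, Multiset.mem_sort, hμ, Multiset.mem_map] at ha
    obtain ⟨t, ht, rfl⟩ := ha
    exact ⟨t, by simpa using ht, rfl⟩
  have hLpw : L.Pairwise (· ≥ ·) := by
    rw [hL, List.pairwise_reverse]
    exact Multiset.pairwise_sort _ _
  have hmapsum : ∀ g : ℕ → ℕ, (L.map g).sum = ∑ t ∈ firstCoords C, g #(sliceAt C t) := by
    intro g
    rw [hL, List.map_reverse, List.sum_reverse, ← Multiset.sum_coe, ← Multiset.map_coe,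
      Multiset.sort_eq, hμ, Multiset.map_map, sum_eq_multiset_sum]
    rfl
  have hgetD : ∀ k, (hk : k < L.length) → L.getD k 0 = L[k] := fun k hk => by
    simp [List.getD_eq_getElem?_getD, List.getElem?_eq_getElem hk]
  have hmemk : ∀ k, k < L.length → L.getD k 0 ∈ L := fun k hk => by
    rw [hgetD k hk]; exact List.getElem_mem hk
  refine ⟨fun k => L.getD k 0, ?_, ?_, ?_, ?_, ?_, ?_⟩
  · intro a b hab
    dsimp only
    by_cases hb : b < L.length
    · have ha : a < L.length := lt_of_le_of_lt hab hb
      rw [hgetD b hb, hgetD a ha]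
      rcases hab.lt_or_eq with hlt | heq
      · exact List.pairwise_iff_getElem.1 hLpw a b ha hb hlt
      · subst heq; exact le_rfl
    · have : L.getD b 0 = 0 := by
        simp [List.getD_eq_getElem?_getD, Nat.le_of_not_lt hb]
      rw [this]; exact Nat.zero_le _
  · intro k hk
    rw [← hLlen] at hk
    obtain ⟨t, ht, h⟩ := hLmem _ (hmemk k hk)
    dsimp only
    rw [h, card_pos]
    exact sliceAt_nonempty ht
  · intro k hk
    rw [← hLlen] at hk
    simp [List.getD_eq_getElem?_getD, hk]
  · show ∑ k ∈ range #(firstCoords C), L.getD k 0 = #C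
    have h := sum_map_eq_sum_range_getD L id
    simp only [List.map_id, id] at h
    rw [← hLlen, ← h, ← List.map_id L, hmapsum, card_eq_sum_card_sliceAt (A := C)]
    rfl
  · rw [← hLlen, ← sum_map_eq_sum_range_getD L (fun a => 2 * halfPerim a), hmapsum]
  · intro hT
    rw [← hLlen] at hT
    obtain ⟨t, -, h⟩ := hLmem _ (hmemk 0 hT)
    dsimp only
    rw [h]
    exact card_sliceAt_le_card_dropFirst t

/-- `⌈2√1⌉ = 2`. [cite: MaininiPiovanoSchmidtStefanelli2019, §2] -/
theorem halfPerim_one : halfPerim 1 = 2 := by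
  simpa using halfPerim_sq (le_refl 1)

/-- **The edge-isoperimetric inequality in `ℤ³` (sharp integer form).**  Every finite `C ⊂ ℤ³` has
`#Θ₃(C) ≥ 2·G₃(#C)`, `G₃ = cubicEIP` — twice Alonso–Cerf's minimal area of `#C` unit cubes; the
value content for `d = 3` of the Ahlswede–Bezrukov theorem quoted as [MS20] Theorem 2.2, and of
[AL13] Theorem 6.4 (`E₃(n) = 3n − G₃(n)` induced edges at most).  Proof: induction on `#C` along
[AL13] §6 — slice perpendicular to the axis meeting the most lattice planes, rearrange into the
sorted daisy stack, remove its top daisy, apply the induction hypothesis and the arithmetic of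
quasi-cubes. [cite: AlonsoCerf1996, Theorem 3.1 and Corollary 3.4; AgnarssonLauria2013, Theorem 6.4; MaininiSchmidt2020, Theorem 2.2] -/
theorem two_mul_cubicEIP_le_card_boundaryPairs (C : Finset (Site 3)) :
    2 * cubicEIP #C ≤ #(boundaryPairs C) := by
  classical
  suffices h : ∀ n (C : Finset (Site 3)), #C = n → 2 * cubicEIP n ≤ #(boundaryPairs C) from
    h _ C rfl
  intro n
  induction n using Nat.strong_induction_on with
  | _ n ih =>
  intro C hCn
  rcases Nat.eq_zero_or_pos n with hn0 | hnpos
  · rw [hn0, cubicEIP_zero]; exact Nat.zero_le _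
  -- the axis meeting the most lattice planes, moved to the front
  obtain ⟨s, hs⟩ := exists_card_le_card_image_apply_pow C
  set C' := C.image (relabel (Fin.cycleRange s).symm) with hC'
  have hcardC' : #C' = n := by rw [hC', card_image_of_injective _ (relabel_injective _), hCn]
  have hbp : #(boundaryPairs C') = #(boundaryPairs C) := card_boundaryPairs_image_relabel _ C
  have hfc : firstCoords C' = C.image fun x => x s := by
    rw [firstCoords, hC', image_image]
    refine image_congr fun x _ => ?_
    simp [Function.comp, relabel_cycleRange_symm_eq_cons]
  set T := #(firstCoords C') with hTdef
  have hT3 : n ≤ T ^ 3 := by rw [hTdef, hfc, ← hCn]; exact hs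
  -- the sorted slice profile
  obtain ⟨f, hanti, hpos, hzero, hsum, hsumg, hmax⟩ := exists_sorted_sliceProfile C'
  rw [← hTdef] at hpos hzero hsum hsumg hmax
  rw [hcardC'] at hsum
  have hTpos : 0 < T := by
    by_contra h0
    have : T = 0 := by omega
    rw [this, sum_range_zero] at hsum
    omega
  -- the slicing lower bound: `#Θ(C) ≥ Σ_k 2⌈2√f(k)⌉ + 2 f(0)`
  have hLB : ∑ k ∈ range T, 2 * halfPerim (f k) + 2 * f 0 ≤ #(boundaryPairs C) := by
    rw [← hbp, hsumg]
    have h1 := sum_card_boundaryPairs_sliceAt_add_le (A := C')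
    have h2 : ∑ t ∈ firstCoords C', 2 * halfPerim #(sliceAt C' t) ≤
        ∑ t ∈ firstCoords C', #(boundaryPairs (sliceAt C' t)) :=
      sum_le_sum fun t _ => two_mul_ceil_two_sqrt_le_card_boundaryPairs _
    have h3 := hmax hTpos
    omega
  -- `T · f(T−1) ≤ n`
  obtain ⟨S, hS⟩ : ∃ S, T = S + 1 := ⟨T - 1, by omega⟩
  have hTA : T * f S ≤ n := by
    have h := card_nsmul_le_sum (range T) f (f S) fun k hk =>
      hanti (show k ≤ S by rw [mem_range] at hk; omega)
    rwa [card_range, smul_eq_mul, hsum] at h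
  have hApos : 0 < f S := hpos S (by omega)
  rcases Nat.lt_or_ge 1 n |>.symm with hn1 | hn2
  · -- `n = 1`: one slice with one point, `2⌈2√1⌉ + 2 = 6 = 2·G₃(1)`
    have hn1' : n = 1 := by omega
    have hT1 : T = 1 := by
      have : T * 1 ≤ T * f S := Nat.mul_le_mul_left T hApos
      omega
    have hS0 : S = 0 := by omega
    rw [hS0] at hApos
    rw [hT1] at hsum hLB
    rw [sum_range_one] at hsum hLB
    have hf0 : f 0 = 1 := by omega
    rw [hf0, halfPerim_one] at hLB
    rw [hn1', cubicEIP_one]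
    omega
  · -- `n ≥ 2`: remove the top daisy of the sorted stack and induct
    have hS1 : 1 ≤ S := by
      by_contra h0
      have hS0 : S = 0 := by omega
      rw [hS0] at hS
      rw [hS] at hT3
      omega
    rw [hS] at hLB hpos hzero hsum
    rw [card_boundaryPairs_daisyStack hpos hanti (hzero (S + 1) le_rfl) |>.symm,
      card_boundaryPairs_daisyStack_succ hS1 hpos hanti (hzero (S + 1) le_rfl)] at hLB
    -- the truncated stack has `n − f S` points
    have hcard : #(daisyStack (fun k => if k < S then f k else 0) S) = n - f S := by
      rw [card_daisyStack_truncate, ← hsum, sum_range_succ, Nat.add_sub_cancel]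
    have hIH := ih (n - f S) (by omega) _ hcard
    have hstep := cubicEIP_le_cubicEIP_sub_add (A := f S) (h := T) hn2 (hS ▸ hTA) hT3
    omega

/-- **The bound is attained**: for every `n` there is an `n`-point configuration in `ℤ³` with exactly
`2·G₃(n)` boundary pairs — `m = ⌊∛n⌋` layers of the `F`-point quasi-square and one layer of the
`r`-point daisy (Alonso–Cerf's quasicube + quasisquare + bar, [AL13]'s cubicle `⟦n⟧³`).
[cite: AlonsoCerf1996, Theorem 3.1; AgnarssonLauria2013, §5 (recursive definition of ⟦n⟧^d) and Definition 5.8] -/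
theorem exists_card_boundaryPairs_eq_two_mul_cubicEIP (n : ℕ) :
    ∃ C : Finset (Site 3), #C = n ∧ #(boundaryPairs C) = 2 * cubicEIP n := by
  classical
  rcases Nat.eq_zero_or_pos n with hn0 | hnpos
  · refine ⟨∅, by rw [hn0, card_empty], ?_⟩
    rw [hn0, cubicEIP_zero]
    simp [boundaryPairs]
  obtain ⟨hm1, hm2⟩ := latticeRootFloor_three_spec n
  set m := latticeRootFloor 3 n with hm
  set F := cubicFace m n with hFdef
  have hm0 : 1 ≤ m := by
    rcases Nat.eq_zero_or_pos m with h00 | h00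
    · rw [h00] at hm2; norm_num at hm2; omega
    · exact h00
  -- `m·F ≤ n < m·F + F` and `F ≥ 1`
  have hF : m * F ≤ n ∧ n < m * F + F ∧ 1 ≤ F := by
    have e1 : (m + 1) ^ 3 = m * (m + 1) ^ 2 + (m + 1) ^ 2 := by ring
    have e2 : m * (m + 1) ^ 2 = m ^ 2 * (m + 1) + m * (m + 1) := by ring
    have e3 : m ^ 2 * (m + 1) = m ^ 3 + m ^ 2 := by ring
    have e9 : m * (m * (m + 1)) = m ^ 2 * (m + 1) := by ring
    have e13 : m * m ^ 2 = m ^ 3 := by ring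
    have hmsq : 1 ≤ m ^ 2 := Nat.one_le_pow _ _ hm0
    by_cases htop : m * (m + 1) ^ 2 ≤ n
    · rw [hFdef, cubicFace_of_top htop]; omega
    · by_cases hmid : m ^ 2 * (m + 1) ≤ n
      · rw [hFdef, cubicFace_of_mid (Nat.lt_of_not_le htop) hmid]; omega
      · rw [hFdef, cubicFace_of_bot (Nat.lt_of_not_le hmid)]; omega
  obtain ⟨hF1, hF2, hF3⟩ := hF
  set r := n - m * F with hr
  -- the profile: `m` layers of `F`, then one of `r` (absent if `r = 0`)
  let f : ℕ → ℕ := fun k => if k < m then F else if k = m then r else 0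
  have hfanti : Antitone f := by
    intro a b hab
    dsimp only [f]
    split_ifs <;> omega
  have hf0 : f 0 = F := by simp only [f, if_pos (show 0 < m by omega)]
  have hfm : f m = r := by simp [f]
  have hsumf : ∑ k ∈ range m, f k = m * F := by
    rw [sum_congr rfl fun k hk => (if_pos (mem_range.1 hk) : f k = F), sum_const, card_range,
      smul_eq_mul]
  have hsumg : ∑ k ∈ range m, 2 * halfPerim (f k) = m * (2 * halfPerim F) := by
    have hfk : ∀ k ∈ range m, 2 * halfPerim (f k) = 2 * halfPerim F := fun k hk => by
      simp only [f, if_pos (mem_range.1 hk)]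
    rw [sum_congr rfl hfk, sum_const, card_range, smul_eq_mul]
  have hG : cubicEIP n = F + m * halfPerim F + halfPerim r :=
    cubicEIP_eq (by omega) hm1 hm2 hFdef.symm
  by_cases hr0 : r = 0
  · refine ⟨daisyStack f m, ?_, ?_⟩
    · rw [card_daisyStack, hsumf]
      omega
    · rw [card_boundaryPairs_daisyStack (fun k hk => by simp only [f, if_pos hk]; omega) hfanti
          (by simp [f, hr0]), hsumg, hf0, hG, hr0, halfPerim_zero]
      ring
  · refine ⟨daisyStack f (m + 1), ?_, ?_⟩
    · rw [card_daisyStack, sum_range_succ, hsumf, hfm]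
      omega
    · rw [card_boundaryPairs_daisyStack (T := m + 1)
          (fun k hk => by
            dsimp only [f]
            split_ifs <;> omega) hfanti (by simp [f]),
        sum_range_succ, hsumg, hfm, hf0, hG]
      ring

/-- **The edge-isoperimetric problem in `ℤ³` solved: `EIP³(n) = 2·G₃(n)`.**  A finite `C ⊂ ℤ³` is an
`EIP³` minimizer if and only if `#Θ₃(C) = 2·G₃(#C)` with
`G₃(n) = F + ⌊∛n⌋·⌈2√F⌉ + ⌈2√(n − ⌊∛n⌋F)⌉` (`F = cubicFace ⌊∛n⌋ n`) — the cubic-lattice counterpart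
of the tree's planar `isEIPMinimizer_iff_card_boundaryPairs_eq` (`EIP²(n) = 2⌈2√n⌉`), and the
`d = 3` value content of [MS20] Theorem 2.2 / [MPSS19]'s `EIP_n`.
[cite: MaininiPiovanoSchmidtStefanelli2019, §1 (EIP_n) and §2; MaininiSchmidt2020, Theorem 2.2; AlonsoCerf1996, Corollary 3.4] -/
theorem isEIPMinimizer_iff_card_boundaryPairs_eq_three (C : Finset (Site 3)) :
    IsEIPMinimizer C ↔ #(boundaryPairs C) = 2 * cubicEIP #C := by
  obtain ⟨D, hD, hbp⟩ := exists_card_boundaryPairs_eq_two_mul_cubicEIP #C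
  constructor
  · intro h
    refine le_antisymm ?_ (two_mul_cubicEIP_le_card_boundaryPairs C)
    rw [← hbp]
    exact h _ hD
  · intro h C' hC'
    rw [h, ← hC']
    exact two_mul_cubicEIP_le_card_boundaryPairs C'

end Main


/-! ### The lower half of the `N^{3/4}` law: slab minimizers far from the Wulff cube -/

section Fluctuation

open Filter Asymptotics
open scoped symmDiff

/-- In `D_{s²}` = the `s × s` square `[1, s]²` (the daisy of a perfect square has no extra line).
[cite: MaininiPiovanoSchmidtStefanelli2019, §2 (R(s,s))] -/
theorem mem_daisyOf_sq {s : ℕ} {z : Site 2} :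
    z ∈ daisyOf (s ^ 2) ↔ 1 ≤ z 0 ∧ z 0 ≤ s ∧ 1 ≤ z 1 ∧ z 1 ≤ s := by
  rw [mem_daisyOf, Nat.sqrt_eq' s]
  constructor
  · rintro (h | h | h)
    · exact h
    · omega
    · omega
  · intro h; exact Or.inl h

/-- **The slabs of the lower-bound construction are `EIP³` minimizers** — a parametric form of
[MS20] Lemma 3.5 at `d = 3` / [MPSS19] §4: the box `(T₀+1) × (T₀+6t+1) × (T₀+6t+1)` (short side
`u − 4t`, long sides `u + 2t`, `u = T₀ + 4t + 1`), realised as the daisy stack of `T₀ + 1` squares,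
has exactly `2·G₃` boundary pairs as soon as `36t⁴ + 16t³ + 6t² < u` (so that `⌊∛n⌋ = u − 1`, the
face is `u²` and the leftover layer `u² − 12t²u − 16t³` has planar optimum `2u − 12t²`).
[cite: MaininiSchmidt2020, Lemma 3.5 (d = 3) and Theorem 1.1 (ii); MaininiPiovanoSchmidtStefanelli2019, Theorem 1.2 (proof, §4)] -/
theorem card_boundaryPairs_slabStack (T₀ t : ℕ) (ht : 1 ≤ t)
    (hC : 36 * t ^ 4 + 16 * t ^ 3 + 6 * t ^ 2 < T₀ + 4 * t + 1) :
    #(boundaryPairs (daisyStack (fun k => if k < T₀ + 1 then (T₀ + 6 * t + 1) ^ 2 else 0)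
        (T₀ + 1))) = 2 * cubicEIP ((T₀ + 1) * (T₀ + 6 * t + 1) ^ 2) := by
  have ht2 : t ≤ t ^ 2 := by nlinarith
  have ht3 : t ^ 2 ≤ t ^ 3 := by nlinarith
  have ht4 : t ^ 3 ≤ t ^ 4 := by nlinarith
  -- the left-hand side: `(T₀+1)` squares of perimeter `4(T₀+6t+1)`, plus `2(T₀+6t+1)²`
  rw [card_boundaryPairs_daisyStack (T := T₀ + 1)
      (fun k hk => by simp only [if_pos hk]; positivity)
      (antitone_truncate (f := fun _ => (T₀ + 6 * t + 1) ^ 2) (fun _ _ _ => le_rfl) (T₀ + 1))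
      (by simp),
    sum_congr rfl fun k hk => by rw [if_pos (mem_range.1 hk)], sum_const, card_range, smul_eq_mul,
    if_pos (Nat.succ_pos T₀), halfPerim_sq (by omega : 1 ≤ T₀ + 6 * t + 1)]
  -- the right-hand side: `⌊∛n⌋ = m := T₀ + 4t`, face `(m+1)²`, leftover `r₀`, `⌈2√r₀⌉ = 2w`
  set m := T₀ + 4 * t with hm
  have E1 : (T₀ + 1) * (T₀ + 6 * t + 1) ^ 2 + 12 * t ^ 2 * (m + 1) + 16 * t ^ 3 = (m + 1) ^ 3 := by
    rw [hm]; ring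
  have E2 : (T₀ + 1) * (T₀ + 6 * t + 1) ^ 2 + (3 * (m + 1) + 12 * t ^ 2 * (m + 1) + 16 * t ^ 3) =
      m ^ 3 + 3 * (m + 1) ^ 2 + 1 := by
    rw [hm]; ring
  have hu : 16 * t ^ 3 + 12 * t ^ 2 + 2 ≤ m + 1 := by omega
  have hm3 : m ^ 3 ≤ (T₀ + 1) * (T₀ + 6 * t + 1) ^ 2 := by
    have h1 : (m + 1) * (16 * t ^ 3 + 12 * t ^ 2 + 2) ≤ (m + 1) * (m + 1) := Nat.mul_le_mul_left _ hu
    have h2 : t ^ 3 ≤ t ^ 3 * (m + 1) := Nat.le_mul_of_pos_right _ (by omega)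
    have h3 : (m + 1) * (16 * t ^ 3 + 12 * t ^ 2 + 2) = 16 * (t ^ 3 * (m + 1)) +
        12 * t ^ 2 * (m + 1) + 2 * (m + 1) := by ring
    have h4 : 3 * (m + 1) ^ 2 = 3 * ((m + 1) * (m + 1)) := by ring
    omega
  have hlt : (T₀ + 1) * (T₀ + 6 * t + 1) ^ 2 < (m + 1) ^ 3 := by
    have : 0 < 16 * t ^ 3 := by positivity
    omega
  -- the leftover layer `r₀ = u² − 12t²u − 16t³`
  have hr₀ex : 12 * t ^ 2 * (m + 1) + 16 * t ^ 3 ≤ (m + 1) ^ 2 := by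
    have h1 : (m + 1) * (16 * t ^ 3 + 12 * t ^ 2 + 2) ≤ (m + 1) * (m + 1) := Nat.mul_le_mul_left _ hu
    have h2 : t ^ 3 ≤ t ^ 3 * (m + 1) := Nat.le_mul_of_pos_right _ (by omega)
    have h3 : (m + 1) * (16 * t ^ 3 + 12 * t ^ 2 + 2) = 16 * (t ^ 3 * (m + 1)) +
        12 * t ^ 2 * (m + 1) + 2 * (m + 1) := by ring
    have h4 : (m + 1) ^ 2 = (m + 1) * (m + 1) := by ring
    omega
  obtain ⟨r₀, hr₀⟩ : ∃ r₀, r₀ + 12 * t ^ 2 * (m + 1) + 16 * t ^ 3 = (m + 1) ^ 2 :=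
    ⟨(m + 1) ^ 2 - (12 * t ^ 2 * (m + 1) + 16 * t ^ 3), by omega⟩
  have hn : (T₀ + 1) * (T₀ + 6 * t + 1) ^ 2 = m * (m + 1) ^ 2 + r₀ := by
    have : m * (m + 1) ^ 2 + (m + 1) ^ 2 = (m + 1) ^ 3 := by ring
    omega
  have htop : m * (m + 1) ^ 2 ≤ (T₀ + 1) * (T₀ + 6 * t + 1) ^ 2 := by omega
  rw [cubicEIP_eq (by positivity) hm3 hlt (cubicFace_of_top htop), halfPerim_sq (by omega), hn,
    Nat.add_sub_cancel_left]
  -- `⌈2√r₀⌉ = 2w`, `w = u − 6t²`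
  obtain ⟨w, hw⟩ : ∃ w, w + 6 * t ^ 2 = m + 1 := ⟨m + 1 - 6 * t ^ 2, by omega⟩
  have hw1 : 36 * t ^ 4 + 16 * t ^ 3 < w := by omega
  have hrw : r₀ + 36 * t ^ 4 + 16 * t ^ 3 = w ^ 2 := by
    rw [← hw] at hr₀
    ring_nf at hr₀ ⊢
    omega
  have hg : halfPerim r₀ = 2 * w := by
    refine halfPerim_eq_of (by omega) (by rw [qsq_two_mul]; omega) ?_
    obtain ⟨w₁, rfl⟩ : ∃ w₁, w = w₁ + 1 := ⟨w - 1, by omega⟩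
    rw [show 2 * (w₁ + 1) - 1 = 2 * w₁ + 1 by omega, qsq_two_mul_add_one]
    have e1 : (w₁ + 1) ^ 2 = w₁ * (w₁ + 1) + w₁ + 1 := by ring
    omega
  rw [hg, hm]
  -- both sides equal `2(3u² − 12t²)`
  rw [hm] at hw
  ring_nf
  ring_nf at hw
  omega

/-- The short side of the `i`-th slab of the lower-bound family: `T(i) + 1`, with
`T(i) + 6t + 1 = (6t)⁴`, `t = i + 1`. [cite: MaininiPiovanoSchmidtStefanelli2019, Theorem 1.2 (proof, §4)] -/
def slabShortSide (i : ℕ) : ℕ := 1296 * (i + 1) ^ 4 - 6 * (i + 1) - 1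

/-- The number of points `n_i = (T(i)+1)·(6t)⁸` of the `i`-th slab. [cite: MaininiPiovanoSchmidtStefanelli2019, Theorem 1.2] -/
def slabCard (i : ℕ) : ℕ := (slabShortSide i + 1) * (slabShortSide i + 6 * (i + 1) + 1) ^ 2

/-- The `i`-th slab `M_{n_i}`: `(T(i)+1) × (6t)⁴ × (6t)⁴` lattice points, as a stack of squares.
[cite: MaininiPiovanoSchmidtStefanelli2019, Theorem 1.2 (proof, §4); MaininiSchmidt2020, Lemma 3.5] -/
noncomputable def slabMinimizer (i : ℕ) : Finset (Site 3) :=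
  daisyStack (fun k => if k < slabShortSide i + 1 then (slabShortSide i + 6 * (i + 1) + 1) ^ 2 else 0)
    (slabShortSide i + 1)

/-- `T(i) + 6t + 1 = 1296 t⁴ = (6t)⁴`. [cite: MaininiPiovanoSchmidtStefanelli2019, Theorem 1.2] -/
theorem slabShortSide_add (i : ℕ) :
    slabShortSide i + 6 * (i + 1) + 1 = 1296 * (i + 1) ^ 4 := by
  have h : i + 1 ≤ (i + 1) ^ 4 := Nat.le_self_pow (by norm_num) _
  unfold slabShortSide
  omega

/-- The size hypothesis `36t⁴ + 16t³ + 6t² < u = T(i) + 4t + 1` of the slab family.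
[cite: MaininiPiovanoSchmidtStefanelli2019, Theorem 1.2] -/
theorem slabShortSide_large (i : ℕ) :
    36 * (i + 1) ^ 4 + 16 * (i + 1) ^ 3 + 6 * (i + 1) ^ 2 < slabShortSide i + 4 * (i + 1) + 1 := by
  have h1 := slabShortSide_add i
  have h2 : (i + 1) ^ 2 ≤ (i + 1) ^ 4 := Nat.pow_le_pow_right (Nat.succ_pos i) (by norm_num)
  have h3 : (i + 1) ^ 3 ≤ (i + 1) ^ 4 := Nat.pow_le_pow_right (Nat.succ_pos i) (by norm_num)
  have h4 : i + 1 ≤ (i + 1) ^ 4 := Nat.le_self_pow (by norm_num) _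
  omega

/-- `#M_{n_i} = n_i`. [cite: MaininiPiovanoSchmidtStefanelli2019, Theorem 1.2] -/
theorem card_slabMinimizer (i : ℕ) : #(slabMinimizer i) = slabCard i := by
  rw [slabMinimizer, card_daisyStack, sum_congr rfl fun k hk => by rw [if_pos (mem_range.1 hk)],
    sum_const, card_range, smul_eq_mul, slabCard]

/-- **The slabs are `EIP³` minimizers.** [cite: MaininiPiovanoSchmidtStefanelli2019, Theorem 1.2 (the minimizers M_{n_i}); MaininiSchmidt2020, Lemma 3.5] -/
theorem isEIPMinimizer_slabMinimizer (i : ℕ) : IsEIPMinimizer (slabMinimizer i) := by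
  rw [isEIPMinimizer_iff_card_boundaryPairs_eq_three, card_slabMinimizer, slabMinimizer, slabCard]
  exact card_boundaryPairs_slabStack _ _ (Nat.succ_pos i) (slabShortSide_large i)

/-- Membership in the `i`-th slab: `0 ≤ x₀ ≤ T(i)`, `1 ≤ x₁, x₂ ≤ (6t)⁴`.
[cite: MaininiPiovanoSchmidtStefanelli2019, Theorem 1.2] -/
theorem mem_slabMinimizer {i : ℕ} {x : Site 3} :
    x ∈ slabMinimizer i ↔ 0 ≤ x 0 ∧ x 0 < slabShortSide i + 1 ∧
      1 ≤ x 1 ∧ x 1 ≤ slabShortSide i + 6 * (i + 1) + 1 ∧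
      1 ≤ x 2 ∧ x 2 ≤ slabShortSide i + 6 * (i + 1) + 1 := by
  rw [slabMinimizer, mem_daisyStack]
  constructor
  · rintro ⟨k, hk, h0, hy⟩
    rw [if_pos hk, mem_daisyOf_sq] at hy
    simp only [Fin.tail] at hy
    refine ⟨by omega, by omega, ?_⟩
    simpa using hy
  · rintro ⟨h0, h0', hrest⟩
    refine ⟨(x 0).toNat, by omega, by omega, ?_⟩
    rw [if_pos (by omega), mem_daisyOf_sq]
    simpa [Fin.tail] using hrest

/-- `⌊∛n_i⌋ = T(i) + 4t` (the Wulff cube `W_{n_i}` has side `u = T(i) + 4t + 1`, `2t` less than the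
long sides of the slab). [cite: MaininiPiovanoSchmidtStefanelli2019, Theorem 1.2 (proof)] -/
theorem latticeRootFloor_slabCard (i : ℕ) :
    latticeRootFloor 3 (slabCard i) = slabShortSide i + 4 * (i + 1) := by
  have hC := slabShortSide_large i
  have ht1 : 1 ≤ i + 1 := Nat.succ_pos i
  unfold slabCard
  set T₀ := slabShortSide i
  set t := i + 1 with ht
  set m := T₀ + 4 * t with hm
  have E1 : (T₀ + 1) * (T₀ + 6 * t + 1) ^ 2 + 12 * t ^ 2 * (m + 1) + 16 * t ^ 3 = (m + 1) ^ 3 := by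
    rw [hm]; ring
  have E2 : (T₀ + 1) * (T₀ + 6 * t + 1) ^ 2 + (3 * (m + 1) + 12 * t ^ 2 * (m + 1) + 16 * t ^ 3) =
      m ^ 3 + 3 * (m + 1) ^ 2 + 1 := by
    rw [hm]; ring
  have ht3 : t ^ 2 ≤ t ^ 3 := by nlinarith
  have ht4 : t ^ 3 ≤ t ^ 4 := by nlinarith
  have hu : 16 * t ^ 3 + 12 * t ^ 2 + 2 ≤ m + 1 := by omega
  refine latticeRootFloor_three_eq ?_ ?_
  · have h1 : (m + 1) * (16 * t ^ 3 + 12 * t ^ 2 + 2) ≤ (m + 1) * (m + 1) := Nat.mul_le_mul_left _ hu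
    have h2 : t ^ 3 ≤ t ^ 3 * (m + 1) := Nat.le_mul_of_pos_right _ (by omega)
    have h3 : (m + 1) * (16 * t ^ 3 + 12 * t ^ 2 + 2) = 16 * (t ^ 3 * (m + 1)) +
        12 * t ^ 2 * (m + 1) + 2 * (m + 1) := by ring
    have h4 : 3 * (m + 1) ^ 2 = 3 * ((m + 1) * (m + 1)) := by ring
    omega
  · have : 0 < 16 * t ^ 3 := by positivity
    omega

/-- **The slabs are far from every set with a short `x₁`-shadow**: if all points of `Q` have their
coordinate `x₁` in an interval of `⌊∛n_i⌋ + 1 = u` consecutive values, then `M_{n_i} ∖ Q` has at least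
`2t·(T(i)+1)·(6t)⁴` points (the slab occupies `u + 2t` values of `x₁`, each with a full rectangle).
[cite: MaininiSchmidt2020, Theorem 1.1 (ii) (proof via Lemma 3.5); MaininiPiovanoSchmidtStefanelli2019, Theorem 1.2] -/
theorem le_card_slabMinimizer_sdiff_of (i : ℕ) (Q : Finset (Site 3)) (b : ℤ)
    (hQ : ∀ x ∈ Q, b ≤ x 1 ∧ x 1 ≤ b + (slabShortSide i + 4 * (i + 1))) :
    2 * (i + 1) * ((slabShortSide i + 1) * (slabShortSide i + 6 * (i + 1) + 1)) ≤
      #(slabMinimizer i \ Q) := by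
  classical
  set T₀ := slabShortSide i with hT₀
  set t := i + 1 with ht
  set s := T₀ + 6 * t + 1 with hs
  set m := T₀ + 4 * t with hm
  -- the occupied values of `x₁` missed by `Q`
  set Y : Finset ℤ := (Icc (1 : ℤ) s).filter fun y => y ∉ Icc b (b + m) with hY
  have hYcard : 2 * t ≤ #Y := by
    have h1 := Finset.card_filter_add_card_filter_not (s := Icc (1 : ℤ) s)
      (fun y => y ∈ Icc b (b + m))
    have h2 : #((Icc (1 : ℤ) s).filter fun y => y ∈ Icc b (b + m)) ≤ m + 1 := by
      calc #((Icc (1 : ℤ) s).filter fun y => y ∈ Icc b (b + m))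
          ≤ #(Icc b (b + m)) := card_le_card fun y hy => (mem_filter.1 hy).2
        _ = m + 1 := by rw [Int.card_Icc]; omega
    have h3 : #(Icc (1 : ℤ) s) = s := by rw [Int.card_Icc]; omega
    rw [h3] at h1
    rw [hY]
    omega
  -- the sub-box `[0, T₀] × Y × [1, s]` of the slab, disjoint from `Q`
  set B : Finset (Site 3) := Fintype.piFinset ![Icc (0 : ℤ) T₀, Y, Icc (1 : ℤ) s] with hB
  have hBcard : #B = (T₀ + 1) * #Y * s := by
    rw [hB, Fintype.card_piFinset, Fin.prod_univ_three]
    simp only [Matrix.cons_val_zero, Matrix.cons_val_one, Matrix.cons_val_two, Matrix.head_cons,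
      Matrix.tail_cons, Int.card_Icc]
    have e1 : ((T₀ : ℤ) + 1 - 0).toNat = T₀ + 1 := by omega
    have e2 : ((s : ℤ) + 1 - 1).toNat = s := by omega
    rw [e1, e2]
  have hBsub : B ⊆ slabMinimizer i \ Q := by
    intro x hx
    rw [hB, Fintype.mem_piFinset] at hx
    have hx0 := hx 0
    have hx1 := hx 1
    have hx2 := hx 2
    simp only [Matrix.cons_val_zero, Matrix.cons_val_one, Matrix.cons_val_two, Matrix.head_cons,
      Matrix.tail_cons, mem_Icc] at hx0 hx1 hx2
    have hx1' : x 1 ∈ Y := hx1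
    rw [hY, mem_filter, mem_Icc, mem_Icc] at hx1'
    rw [Finset.mem_sdiff, mem_slabMinimizer]
    exact ⟨⟨hx0.1, by omega, hx1'.1.1, hx1'.1.2, hx2.1, hx2.2⟩, fun hxQ => hx1'.2 (hQ x hxQ)⟩
  calc 2 * (i + 1) * ((slabShortSide i + 1) * (slabShortSide i + 6 * (i + 1) + 1))
      = (T₀ + 1) * (2 * t) * s := by rw [hT₀, ht, hs]; ring
    _ ≤ (T₀ + 1) * #Y * s := Nat.mul_le_mul_right _ (Nat.mul_le_mul_left _ hYcard)
    _ = #B := hBcard.symm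
    _ ≤ _ := card_le_card hBsub

/-- **The slabs deviate from every translate of the Wulff cube by at least `2t·(T(i)+1)·(6t)⁴`
points**: the cube `a + W_{n_i}` meets only `u` of the `u + 2t` occupied values of the coordinate
`x₁`, and every missed value carries a full `(T(i)+1) × (6t)⁴` rectangle of the slab.
[cite: MaininiPiovanoSchmidtStefanelli2019, Theorem 1.2; MaininiSchmidt2020, Theorem 1.1 (ii) (proof: "This follows directly from Lemma 3.5")] -/
theorem le_card_slabMinimizer_sdiff (i : ℕ) (a : Site 3) :
    2 * (i + 1) * ((slabShortSide i + 1) * (slabShortSide i + 6 * (i + 1) + 1)) ≤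
      #(slabMinimizer i \ (wulffCubeZero (slabCard i)).image fun w => a + w) := by
  classical
  refine le_card_slabMinimizer_sdiff_of i _ (a 1) fun x hx => ?_
  obtain ⟨w, hw, rfl⟩ := mem_image.1 hx
  rw [wulffCubeZero, Fintype.mem_piFinset, latticeRootFloor_slabCard] at hw
  have hw1 := hw 1
  rw [mem_Icc] at hw1
  simp only [Pi.add_apply]
  constructor <;> omega

/-- **Mainini–Piovano–Schmidt–Stefanelli 2019, Theorem 1.2 (Lower Bound) — DISCHARGED.**  With
`K₂ = 1/4`, the slabs `M_{n_i}` (`(T(i)+1) × (6t)⁴ × (6t)⁴` points, `t = i + 1`, short side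
`(6t)⁴ − 6t`) are `EIP³` minimizers (by the exact value `EIP³ = 2·G₃` of this file), `n_i → ∞`,
and every translate of the Wulff cube `W_{n_i} = [0, ⌊∛n_i⌋]³` misses at least
`2t·(T(i)+1)·(6t)⁴ ≥ ¼·n_i^{3/4}` of their points (remainder `o(n_i^{3/4})` taken to be `0`):
`min_a #(M_{n_i} △ (a + W_{n_i})) ≥ K₂ n_i^{3/4}`.  This is the construction "`P_{ℓ,3,p}` with
`p ≈ ℓ^{1/4}`" of [MS20] Lemma 3.5 / Theorem 1.1 (ii) specialised to `ℓ = (6t)⁴`, `p = 6t`.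
[cite: MaininiPiovanoSchmidtStefanelli2019, Theorem 1.2; MaininiSchmidt2020, Theorem 1.1 (ii) and Lemma 3.5] -/
theorem MaininiPiovanoSchmidtStefanelli2019_thm12_holds : MaininiPiovanoSchmidtStefanelli2019_thm12 := by
  classical
  refine ⟨1 / 4, by norm_num, slabCard, slabMinimizer, fun _ => 0, ?_, ?_, fun i => ⟨?_, ?_, ?_⟩⟩
  · -- `n_i → ∞` (`n_i ≥ i`)
    refine tendsto_atTop_atTop.2 fun b => ⟨b, fun i hi => hi.trans ?_⟩
    rw [slabCard]
    have h1 : 1 ≤ (slabShortSide i + 6 * (i + 1) + 1) ^ 2 := Nat.one_le_pow _ _ (by omega)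
    have h2 := slabShortSide_large i
    nlinarith
  · exact isLittleO_zero _ _
  · exact isEIPMinimizer_slabMinimizer i
  · exact card_slabMinimizer i
  · intro a
    rw [add_zero]
    have hcount := le_card_slabMinimizer_sdiff i a
    set t := i + 1 with ht
    have hs : slabShortSide i + 6 * t + 1 = 1296 * t ^ 4 := slabShortSide_add i
    -- `n_i ≤ ((6t)⁴)³ = (6t)¹²`
    have hn12 : slabCard i ≤ (6 * t) ^ 12 := by
      rw [slabCard, ← ht, hs]
      have : slabShortSide i + 1 ≤ 1296 * t ^ 4 := by omega
      calc (slabShortSide i + 1) * (1296 * t ^ 4) ^ 2 ≤ (1296 * t ^ 4) * (1296 * t ^ 4) ^ 2 :=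
            Nat.mul_le_mul_right _ this
        _ = (6 * t) ^ 12 := by ring
    -- `(6t)⁹ ≤ 4 · (the deviation count)`
    have hdev : (6 * t) ^ 9 ≤ 4 * (2 * t * ((slabShortSide i + 1) * (slabShortSide i + 6 * t + 1))) := by
      rw [hs]
      have h4 : t ≤ t ^ 4 := Nat.le_self_pow (by norm_num) t
      have h972 : 7776 * t ^ 4 ≤ 8 * (slabShortSide i + 1) := by omega
      calc (6 * t) ^ 9 = 7776 * t ^ 4 * (1296 * t ^ 5) := by ring
        _ ≤ 8 * (slabShortSide i + 1) * (1296 * t ^ 5) := Nat.mul_le_mul_right _ h972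
        _ = 4 * (2 * t * ((slabShortSide i + 1) * (1296 * t ^ 4))) := by ring
    -- assemble in `ℝ`
    have h1 : ((slabCard i : ℕ) : ℝ) ^ ((3 : ℝ) / 4) ≤ (((6 * t) ^ 12 : ℕ) : ℝ) ^ ((3 : ℝ) / 4) :=
      Real.rpow_le_rpow (by positivity) (by exact_mod_cast hn12) (by norm_num)
    have h2 : (((6 * t) ^ 12 : ℕ) : ℝ) ^ ((3 : ℝ) / 4) = (((6 * t) ^ 9 : ℕ) : ℝ) := by
      push_cast
      rw [← Real.rpow_natCast _ 12, ← Real.rpow_mul (by positivity), ← Real.rpow_natCast _ 9]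
      norm_num
    have h3 : (((6 * t) ^ 9 : ℕ) : ℝ) ≤
        4 * ((2 * t * ((slabShortSide i + 1) * (slabShortSide i + 6 * t + 1)) : ℕ) : ℝ) := by
      exact_mod_cast hdev
    have h4 : ((2 * t * ((slabShortSide i + 1) * (slabShortSide i + 6 * t + 1)) : ℕ) : ℝ) ≤
        (#(slabMinimizer i \ (wulffCubeZero (slabCard i)).image fun w => a + w) : ℝ) := by
      rw [ht]; exact_mod_cast (by rw [mul_assoc] at hcount ⊢; exact hcount)
    have h5 : (#(slabMinimizer i \ (wulffCubeZero (slabCard i)).image fun w => a + w) : ℝ) ≤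
        (#(slabMinimizer i ∆ ((wulffCubeZero (slabCard i)).image fun w => a + w)) : ℝ) := by
      exact_mod_cast card_le_card (by rw [symmDiff_def]; exact subset_union_left)
    linarith

/-- `n_i > i`: the slab cardinalities are unbounded. [cite: MaininiPiovanoSchmidtStefanelli2019, Theorem 1.2 (n_i → ∞)] -/
theorem lt_slabCard (i : ℕ) : i < slabCard i := by
  rw [slabCard]
  have h1 : 1 ≤ (slabShortSide i + 6 * (i + 1) + 1) ^ 2 := Nat.one_le_pow _ _ (by omega)
  have h2 := slabShortSide_large i
  nlinarith

/-- `¼ · n_i^{3/4} ≤ 2t·(T(i)+1)·(6t)⁴` — the deviation count dominates `n^{3/4}`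
(`n_i ≤ (6t)¹²`). [cite: MaininiPiovanoSchmidtStefanelli2019, Theorem 1.2; MaininiSchmidt2020, Theorem 1.1 (ii)] -/
theorem quarter_mul_rpow_slabCard_le (i : ℕ) :
    (1 / 4 : ℝ) * (slabCard i : ℝ) ^ ((3 : ℝ) / 4) ≤
      ((2 * (i + 1) * ((slabShortSide i + 1) * (slabShortSide i + 6 * (i + 1) + 1)) : ℕ) : ℝ) := by
  set t := i + 1 with ht
  have hs : slabShortSide i + 6 * t + 1 = 1296 * t ^ 4 := slabShortSide_add i
  have hn12 : slabCard i ≤ (6 * t) ^ 12 := by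
    rw [slabCard, ← ht, hs]
    have : slabShortSide i + 1 ≤ 1296 * t ^ 4 := by omega
    calc (slabShortSide i + 1) * (1296 * t ^ 4) ^ 2 ≤ (1296 * t ^ 4) * (1296 * t ^ 4) ^ 2 :=
          Nat.mul_le_mul_right _ this
      _ = (6 * t) ^ 12 := by ring
  have hdev : (6 * t) ^ 9 ≤ 4 * (2 * t * ((slabShortSide i + 1) * (slabShortSide i + 6 * t + 1))) := by
    rw [hs]
    have h4 : t ≤ t ^ 4 := Nat.le_self_pow (by norm_num) t
    have h972 : 7776 * t ^ 4 ≤ 8 * (slabShortSide i + 1) := by omega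
    calc (6 * t) ^ 9 = 7776 * t ^ 4 * (1296 * t ^ 5) := by ring
      _ ≤ 8 * (slabShortSide i + 1) * (1296 * t ^ 5) := Nat.mul_le_mul_right _ h972
      _ = 4 * (2 * t * ((slabShortSide i + 1) * (1296 * t ^ 4))) := by ring
  have h1 : ((slabCard i : ℕ) : ℝ) ^ ((3 : ℝ) / 4) ≤ (((6 * t) ^ 12 : ℕ) : ℝ) ^ ((3 : ℝ) / 4) :=
    Real.rpow_le_rpow (by positivity) (by exact_mod_cast hn12) (by norm_num)
  have h2 : (((6 * t) ^ 12 : ℕ) : ℝ) ^ ((3 : ℝ) / 4) = (((6 * t) ^ 9 : ℕ) : ℝ) := by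
    push_cast
    rw [← Real.rpow_natCast _ 12, ← Real.rpow_mul (by positivity), ← Real.rpow_natCast _ 9]
    norm_num
  have h3 : (((6 * t) ^ 9 : ℕ) : ℝ) ≤
      4 * ((2 * t * ((slabShortSide i + 1) * (slabShortSide i + 6 * t + 1)) : ℕ) : ℝ) := by
    exact_mod_cast hdev
  have h4 : ((2 * t * ((slabShortSide i + 1) * (slabShortSide i + 6 * t + 1)) : ℕ) : ℝ) =
      ((2 * (i + 1) * ((slabShortSide i + 1) * (slabShortSide i + 6 * (i + 1) + 1)) : ℕ) : ℝ) := by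
    rw [ht]
  linarith

/-- **Mainini–Schmidt 2020, Theorem 1.1 (ii) AT `d = 3` — a theorem** (the `d = 3` instance of the
vendored fact `MaininiSchmidt2020_thm11_lower`, with `K₃ = ¼`): for every `ε > 0` there are
infinitely many `n` (all the `n_i`) admitting an `EIP³` minimizer `C` (the slab `M_{n_i}`) with
`#((C − a) △ W_n) ≥ (¼ − ε)·n^{3/4}` for every `a ∈ ℤ³`, `W_n = {1,…,⌊∛n⌋}³`, `3/4 =
(d−1+2^{1−d})/d` at `d = 3` — "This follows directly from Lemma 3.5".
[cite: MaininiSchmidt2020, Theorem 1.1 (ii) and Lemma 3.5 (d = 3)] -/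
theorem MaininiSchmidt2020_thm11_lower_three :
    ∃ K : ℝ, 0 < K ∧ ∀ ε : ℝ, 0 < ε →
      {n : ℕ | ∃ C : Finset (Site 3), IsEIPMinimizer C ∧ #C = n ∧
        ∀ a : Site 3,
          (K - ε) * (n : ℝ) ^ maximalFluctuationExponent 3 ≤
            (#((C.image fun x => x - a) ∆ wulffCube 3 n) : ℝ)}.Infinite := by
  classical
  refine ⟨1 / 4, by norm_num, fun ε hε => ?_⟩
  refine Set.infinite_of_forall_exists_gt fun k => ⟨slabCard k, ?_, lt_slabCard k⟩
  refine ⟨slabMinimizer k, isEIPMinimizer_slabMinimizer k, card_slabMinimizer k, fun a => ?_⟩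
  rw [maximalFluctuationExponent_three]
  -- `#((C − a) △ W) = #(C △ (W + a)) ≥ #(C ∖ (W + a))`
  have hsub : Function.Injective fun x : Site 3 => x - a := sub_left_injective
  have hW : (((wulffCube 3 (slabCard k)).image fun w => w + a).image fun x => x - a) =
      wulffCube 3 (slabCard k) := by
    rw [image_image]
    have : ((fun x : Site 3 => x - a) ∘ fun w => w + a) = id := by funext w; simp
    rw [this, image_id]
  have hcard : #((slabMinimizer k).image (fun x => x - a) ∆ wulffCube 3 (slabCard k)) =
      #(slabMinimizer k ∆ (wulffCube 3 (slabCard k)).image fun w => w + a) := by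
    conv_lhs => rw [← hW, ← image_symmDiff _ _ hsub]
    exact card_image_of_injective _ hsub
  have hQ : ∀ x ∈ (wulffCube 3 (slabCard k)).image (fun w => w + a),
      a 1 + 1 ≤ x 1 ∧ x 1 ≤ a 1 + 1 + (slabShortSide k + 4 * (k + 1)) := by
    intro x hx
    obtain ⟨w, hw, rfl⟩ := mem_image.1 hx
    rw [wulffCube, Fintype.mem_piFinset, latticeRootFloor_slabCard] at hw
    have hw1 := hw 1
    rw [mem_Icc] at hw1
    simp only [Pi.add_apply]
    constructor <;> omega
  have hcount := le_card_slabMinimizer_sdiff_of k _ _ hQ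
  have h5 : (#(slabMinimizer k \ (wulffCube 3 (slabCard k)).image fun w => w + a) : ℝ) ≤
      (#(slabMinimizer k ∆ (wulffCube 3 (slabCard k)).image fun w => w + a) : ℝ) := by
    exact_mod_cast card_le_card (by rw [Finset.symmDiff_def]; exact subset_union_left)
  have h6 := quarter_mul_rpow_slabCard_le k
  have h7 : ((2 * (k + 1) * ((slabShortSide k + 1) * (slabShortSide k + 6 * (k + 1) + 1)) : ℕ) : ℝ)
      ≤ (#(slabMinimizer k \ (wulffCube 3 (slabCard k)).image fun w => w + a) : ℝ) := by
    exact_mod_cast hcount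
  have h8 : 0 ≤ ε * (slabCard k : ℝ) ^ ((3 : ℝ) / 4) := by positivity
  rw [hcard]
  nlinarith

end Fluctuation

/-! ### [MS20] Lemma 3.5 in the cubic lattice: `P_{ℓ,3,p}` is an `EIP³` minimizer for `p ≤ ℓ^{1/4}` -/

section SlabLemma

/-- Parity-free evaluation of `⌈2√r⌉`: if `4r + 1 ≤ s²` and `(s − 1)² < 4r` then `⌈2√r⌉ = s`
(via `4q(s) ≤ s² ≤ 4q(s) + 1`). [cite: AlonsoCerf1996, Corollary 2.5] -/
theorem halfPerim_eq_of_sq_bounds {r s : ℕ} (hs : 1 ≤ s) (h1 : 4 * r + 1 ≤ s ^ 2)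
    (h2 : (s - 1) ^ 2 < 4 * r) : halfPerim r = s := by
  refine halfPerim_eq_of hs ?_ ?_
  · have := sq_le_four_mul_qsq_add_one s; omega
  · have := four_mul_qsq_le (s - 1); omega

/-- **The edge perimeter is translation invariant**: `#Θ(A + v) = #Θ(A)`.
[cite: MaininiSchmidt2020, §1 (Θ_d(C), min over translations in Theorem 1.1)] -/
theorem card_boundaryPairs_image_add_right {d : ℕ} (v : Site d) (A : Finset (Site d)) :
    #(boundaryPairs (A.image fun x => x + v)) = #(boundaryPairs A) := by
  classical
  symm
  refine card_bij' (fun u _ => (u.1 + v, u.2.1, u.2.2)) (fun u _ => (u.1 - v, u.2.1, u.2.2))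
    ?_ ?_ ?_ ?_
  · rintro ⟨x, i, b⟩ hu
    rw [mem_boundaryPairs] at hu ⊢
    refine ⟨mem_image_of_mem _ hu.1, fun h => hu.2 ?_⟩
    obtain ⟨y, hy, hyx⟩ := mem_image.1 h
    have : y = x + unitStep i b := by
      have := congrArg (fun z => z - v) hyx
      simp only [add_sub_cancel_right] at this
      rw [this]; abel
    rwa [this] at hy
  · rintro ⟨y, i, b⟩ hu
    rw [mem_boundaryPairs] at hu ⊢
    obtain ⟨hy, hy'⟩ := hu
    obtain ⟨x, hx, rfl⟩ := mem_image.1 hy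
    simp only [add_sub_cancel_right]
    refine ⟨hx, fun h => hy' (mem_image.2 ⟨x + unitStep i b, h, ?_⟩)⟩
    dsimp only
    exact add_right_comm _ _ _
  · rintro ⟨x, i, b⟩ _; simp
  · rintro ⟨y, i, b⟩ _; simp

/-- Membership in `P_{ℓ,3,p} = {1,…,ℓ−p} × {1,…,ℓ}²`. [cite: MaininiSchmidt2020, Lemma 3.5 (P_{ℓ,d,p})] -/
theorem mem_slabConfig_three {ℓ p : ℕ} {z : Site 3} :
    z ∈ slabConfig 3 ℓ p ↔
      1 ≤ z 0 ∧ z 0 ≤ (ℓ : ℤ) - p ∧ 1 ≤ z 1 ∧ z 1 ≤ ℓ ∧ 1 ≤ z 2 ∧ z 2 ≤ ℓ := by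
  simp [slabConfig, Fintype.mem_piFinset, Fin.forall_fin_succ, and_assoc]

/-- `P_{ℓ,3,p}` is the translate by `e₀` of the stack of `ℓ − p` squares of side `ℓ`.
[cite: MaininiSchmidt2020, Lemma 3.5 (P_{ℓ,d,p})] -/
theorem slabConfig_three_eq_image_daisyStack (ℓ p : ℕ) :
    slabConfig 3 ℓ p =
      (daisyStack (fun k => if k < ℓ - p then ℓ ^ 2 else 0) (ℓ - p)).image
        fun x => x + unitStep 0 true := by
  ext z
  rw [mem_slabConfig_three, mem_image]
  constructor
  · rintro ⟨h0, h0', h1, h1', h2, h2'⟩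
    refine ⟨z - unitStep 0 true, ?_, sub_add_cancel _ _⟩
    rw [mem_daisyStack]
    refine ⟨(z 0 - 1).toNat, by omega, ?_, ?_⟩
    · simp [unitStep]; omega
    · rw [if_pos (by omega), mem_daisyOf_sq]
      simp [Fin.tail, unitStep]
      omega
  · rintro ⟨x, hx, rfl⟩
    rw [mem_daisyStack] at hx
    obtain ⟨k, hk, hk0, hx⟩ := hx
    rw [if_pos hk, mem_daisyOf_sq] at hx
    simp only [Fin.tail] at hx
    simp [unitStep]
    have : (x (Fin.succ 0) = x 1) ∧ (x (Fin.succ 1) = x 2) := ⟨rfl, rfl⟩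
    omega

/-- `#P_{ℓ,3,p} = (ℓ − p)·ℓ²`. [cite: MaininiSchmidt2020, Lemma 3.5 (P_{ℓ,d,p})] -/
theorem card_slabConfig_three (ℓ p : ℕ) : #(slabConfig 3 ℓ p) = (ℓ - p) * ℓ ^ 2 := by
  rw [slabConfig_three_eq_image_daisyStack, card_image_of_injective _ (add_left_injective _),
    card_daisyStack, sum_congr rfl fun k hk => by rw [if_pos (mem_range.1 hk)], sum_const,
    card_range, smul_eq_mul]

/-- `#Θ₃(P_{ℓ,3,p}) = 2(ℓ² + 2ℓ(ℓ − p))` for `p < ℓ` (a box: every lattice line through it carries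
two boundary pairs). [cite: MaininiSchmidt2020, Lemma 3.5 (proof: edge perimeter of P_{ℓ,d,p})] -/
theorem card_boundaryPairs_slabConfig_three {ℓ p : ℕ} (h : p < ℓ) :
    #(boundaryPairs (slabConfig 3 ℓ p)) = 2 * (ℓ ^ 2 + 2 * ℓ * (ℓ - p)) := by
  rw [slabConfig_three_eq_image_daisyStack, card_boundaryPairs_image_add_right,
    card_boundaryPairs_daisyStack (T := ℓ - p)
      (fun k hk => by rw [if_pos hk]; exact Nat.pow_pos (by omega))
      (antitone_truncate (f := fun _ => ℓ ^ 2) (fun _ _ _ => le_rfl) (ℓ - p)) (by simp),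
    sum_congr rfl fun k hk => by rw [if_pos (mem_range.1 hk)], sum_const, card_range, smul_eq_mul,
    if_pos (by omega : 0 < ℓ - p), halfPerim_sq (by omega : 1 ≤ ℓ)]
  ring

/-! #### `G₃((ℓ − p)ℓ²) = ℓ² + 2ℓ(ℓ − p)` for `p⁴ ≤ ℓ`: the three residues of `p` modulo `3`

With `ℓ = u + j`, `j = ⌊p/3⌋`: `⌊∛((ℓ−p)ℓ²)⌋ = u − 1` and the face regime is top / middle /
bottom according as `p ≡ 0 / 1 / 2 (mod 3)` (`p = 1`: the quasi-cube `(u−1)u²` itself). -/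

/-- `p = 3j` (`j ≥ 1`): `n = (u − 2j)(u + j)² = u³ − 3j²u − 2j³`, top regime, leftover
`u² − 3j²u − 2j³` with planar optimum `2u − 3j²`. Here `u = T + 2j + 1`, `ℓ = T + 3j + 1`.
[cite: MaininiSchmidt2020, Lemma 3.5 (d = 3)] -/
theorem cubicEIP_slab_mod_zero (T j : ℕ) (hj : 1 ≤ j)
    (hreg : 3 * j ^ 2 * (T + 2 * j + 1) + 2 * j ^ 3 ≤ (T + 2 * j + 1) ^ 2)
    (hgal : 9 * j ^ 4 + 8 * j ^ 3 + 6 * j ^ 2 + 1 < 4 * (T + 2 * j + 1)) :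
    cubicEIP ((T + 1) * (T + 3 * j + 1) ^ 2) =
      (T + 3 * j + 1) ^ 2 + 2 * (T + 3 * j + 1) * (T + 1) := by
  obtain ⟨m, hm⟩ : ∃ m, m = T + 2 * j := ⟨_, rfl⟩
  have hu : T + 2 * j + 1 = m + 1 := by rw [hm]
  rw [hu] at hreg hgal
  have E1 : (T + 1) * (T + 3 * j + 1) ^ 2 + 3 * j ^ 2 * (m + 1) + 2 * j ^ 3 = (m + 1) ^ 3 := by
    rw [hm]; ring
  have E2 : (m + 1) ^ 3 = m ^ 3 + 3 * m ^ 2 + 3 * m + 1 := by ring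
  have E3 : (m + 1) ^ 2 = m ^ 2 + 2 * m + 1 := by ring
  have E4 : m * (m + 1) ^ 2 + (m + 1) ^ 2 = (m + 1) ^ 3 := by ring
  have E5 : (m + 1) ^ 2 = (m + 1) * (m + 1) := by ring
  have hj3 : 1 ≤ j ^ 3 := Nat.one_le_pow _ _ hj
  have hm3 : m ^ 3 ≤ (T + 1) * (T + 3 * j + 1) ^ 2 := by omega
  have hlt : (T + 1) * (T + 3 * j + 1) ^ 2 < (m + 1) ^ 3 := by omega
  have htop : m * (m + 1) ^ 2 ≤ (T + 1) * (T + 3 * j + 1) ^ 2 := by omega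
  rw [cubicEIP_eq (by positivity) hm3 hlt (cubicFace_of_top htop), halfPerim_sq (by omega)]
  -- the leftover `r` and `s = 2u − 3j²`
  obtain ⟨r, hr⟩ : ∃ r, (T + 1) * (T + 3 * j + 1) ^ 2 - m * (m + 1) ^ 2 = r := ⟨_, rfl⟩
  have hr' : r + 3 * j ^ 2 * (m + 1) + 2 * j ^ 3 = (m + 1) ^ 2 := by omega
  have hc : 3 * j ^ 2 ≤ m + 1 :=
    Nat.le_of_mul_le_mul_right (c := m + 1) (by rw [← E5]; omega) (by omega)
  obtain ⟨s, hs⟩ : ∃ s, s + 3 * j ^ 2 = 2 * (m + 1) := ⟨2 * (m + 1) - 3 * j ^ 2, by omega⟩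
  have hs2 : s ^ 2 + 12 * (j ^ 2 * (m + 1)) = 4 * (m + 1) ^ 2 + 9 * j ^ 4 := by
    have e := congrArg (fun x => x ^ 2) hs
    have e' := congrArg (fun x => 6 * j ^ 2 * x) hs
    ring_nf at e e' ⊢
    omega
  have h1s : 1 ≤ s := by omega
  have hsq : (s - 1) ^ 2 + 2 * s = s ^ 2 + 1 := by
    obtain ⟨s', rfl⟩ : ∃ s', s = s' + 1 := ⟨s - 1, by omega⟩
    rw [Nat.add_sub_cancel]; ring
  have hj4 : 1 ≤ j ^ 4 := Nat.one_le_pow _ _ hj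
  have e12 : 12 * (j ^ 2 * (m + 1)) = 4 * (3 * j ^ 2 * (m + 1)) := by ring
  have hgs : halfPerim r = s := halfPerim_eq_of_sq_bounds h1s (by omega) (by omega)
  rw [hr, hgs, hm]
  rw [hm] at hs
  ring_nf
  ring_nf at hs
  omega

/-- `p = 1`: `n = (u − 1)u²` is the quasi-cube `u²·(u−1)` itself (`u = ℓ = T + 2`).
[cite: MaininiSchmidt2020, Lemma 3.5 (d = 3)] -/
theorem cubicEIP_slab_one (T : ℕ) :
    cubicEIP ((T + 1) * (T + 2) ^ 2) = (T + 2) ^ 2 + 2 * (T + 2) * (T + 1) := by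
  have hm3 : (T + 1) ^ 3 ≤ (T + 1) * (T + 2) ^ 2 := by nlinarith
  have hlt : (T + 1) * (T + 2) ^ 2 < (T + 1 + 1) ^ 3 := by nlinarith
  have htop : (T + 1) * (T + 1 + 1) ^ 2 ≤ (T + 1) * (T + 2) ^ 2 := le_of_eq (by ring)
  rw [cubicEIP_eq (by positivity) hm3 hlt (cubicFace_of_top htop),
    show (T + 1) * (T + 2) ^ 2 - (T + 1) * (T + 1 + 1) ^ 2 = 0 from
      Nat.sub_eq_zero_of_le (le_of_eq (by ring)),
    halfPerim_zero, halfPerim_sq (by omega)]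
  ring

/-- `p = 3j + 1` (`j ≥ 1`): `n = u³ − u² − (3j²+2j)u − (2j³+j²)`, middle regime (`F = (u−1)u`),
leftover `u² − (3j²+2j+1)u − (2j³+j²)` with planar optimum `2u − 3j² − 2j − 1`.  Here
`u = T + 2j + 2`, `ℓ = T + 3j + 2`. [cite: MaininiSchmidt2020, Lemma 3.5 (d = 3)] -/
theorem cubicEIP_slab_mod_one (T j : ℕ) (hj : 1 ≤ j)
    (hreg : (3 * j ^ 2 + 2 * j + 1) * (T + 2 * j + 2) + 2 * j ^ 3 + j ^ 2 ≤ (T + 2 * j + 2) ^ 2)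
    (hgal : (3 * j ^ 2 + 2 * j + 1) ^ 2 + 2 * (3 * j ^ 2 + 2 * j + 1) + 8 * j ^ 3 + 4 * j ^ 2 + 1 <
      4 * (T + 2 * j + 2)) :
    cubicEIP ((T + 1) * (T + 3 * j + 2) ^ 2) =
      (T + 3 * j + 2) ^ 2 + 2 * (T + 3 * j + 2) * (T + 1) := by
  obtain ⟨m, hm⟩ : ∃ m, m = T + 2 * j + 1 := ⟨_, rfl⟩
  have hu : T + 2 * j + 2 = m + 1 := by rw [hm]
  rw [hu] at hreg hgal
  obtain ⟨c, hc⟩ : ∃ c, c = 3 * j ^ 2 + 2 * j + 1 := ⟨_, rfl⟩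
  rw [← hc] at hreg hgal
  have E1 : (T + 1) * (T + 3 * j + 2) ^ 2 + (m + 1) ^ 2 + (3 * j ^ 2 + 2 * j) * (m + 1) +
      (2 * j ^ 3 + j ^ 2) = (m + 1) ^ 3 := by
    rw [hm]; ring
  have E2 : m ^ 2 * (m + 1) + 2 * (m + 1) ^ 2 = (m + 1) ^ 3 + (m + 1) := by ring
  have E3 : m * (m + 1) ^ 2 + (m + 1) ^ 2 = (m + 1) ^ 3 := by ring
  have E4 : m ^ 2 * (m + 1) = m ^ 3 + m ^ 2 := by ring
  have E5 : m * (m * (m + 1)) = m ^ 2 * (m + 1) := by ring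
  have E6 : c * (m + 1) = (3 * j ^ 2 + 2 * j) * (m + 1) + (m + 1) := by rw [hc]; ring
  have E7 : (m + 1) ^ 2 = (m + 1) * (m + 1) := by ring
  have hj3 : 1 ≤ j ^ 3 := Nat.one_le_pow _ _ hj
  have hmid : m ^ 2 * (m + 1) ≤ (T + 1) * (T + 3 * j + 2) ^ 2 := by omega
  have hnt : (T + 1) * (T + 3 * j + 2) ^ 2 < m * (m + 1) ^ 2 := by omega
  have hm3 : m ^ 3 ≤ (T + 1) * (T + 3 * j + 2) ^ 2 := by omega
  have hlt : (T + 1) * (T + 3 * j + 2) ^ 2 < (m + 1) ^ 3 := by omega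
  rw [cubicEIP_eq (by positivity) hm3 hlt (cubicFace_of_mid hnt hmid), halfPerim_mul_succ (by omega)]
  obtain ⟨r, hr⟩ : ∃ r, (T + 1) * (T + 3 * j + 2) ^ 2 - m * (m * (m + 1)) = r := ⟨_, rfl⟩
  have hr' : r + c * (m + 1) + (2 * j ^ 3 + j ^ 2) = (m + 1) ^ 2 := by omega
  have hcu : c ≤ m + 1 := Nat.le_of_mul_le_mul_right (c := m + 1) (by rw [← E7]; omega) (by omega)
  obtain ⟨s, hs⟩ : ∃ s, s + c = 2 * (m + 1) := ⟨2 * (m + 1) - c, by omega⟩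
  have hs2 : s ^ 2 + 4 * (c * (m + 1)) = 4 * (m + 1) ^ 2 + c ^ 2 := by
    have e := congrArg (fun x => x ^ 2) hs
    have e' := congrArg (fun x => 2 * c * x) hs
    ring_nf at e e' ⊢
    omega
  have h1s : 1 ≤ s := by omega
  have hsq : (s - 1) ^ 2 + 2 * s = s ^ 2 + 1 := by
    obtain ⟨s', rfl⟩ : ∃ s', s = s' + 1 := ⟨s - 1, by omega⟩
    rw [Nat.add_sub_cancel]; ring
  have hc1 : 1 ≤ c ^ 2 := Nat.one_le_pow _ _ (by omega)
  have hgs : halfPerim r = s := halfPerim_eq_of_sq_bounds h1s (by omega) (by omega)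
  rw [hr, hgs, hm]
  rw [hm, hc] at hs
  ring_nf
  ring_nf at hs
  omega

/-- `p = 3j + 2` (`j ≥ 0`): `n = u³ − 2u² − (3j²+4j)u − (2j³+2j²)`, bottom regime (`F = (u−1)²`),
leftover `u² − (3j²+4j+3)u − 2j³ − 2j² + 1` with planar optimum `2u − 3j² − 4j − 3`.  Here
`u = T + 2j + 3`, `ℓ = T + 3j + 3`. [cite: MaininiSchmidt2020, Lemma 3.5 (d = 3)] -/
theorem cubicEIP_slab_mod_two (T j : ℕ)
    (hreg : (3 * j ^ 2 + 4 * j + 3) * (T + 2 * j + 3) + 2 * j ^ 3 + 2 * j ^ 2 ≤ (T + 2 * j + 3) ^ 2)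
    (hgal : (3 * j ^ 2 + 4 * j + 3) ^ 2 + 2 * (3 * j ^ 2 + 4 * j + 3) + 8 * j ^ 3 + 8 * j ^ 2 <
      4 * (T + 2 * j + 3) + 3) :
    cubicEIP ((T + 1) * (T + 3 * j + 3) ^ 2) =
      (T + 3 * j + 3) ^ 2 + 2 * (T + 3 * j + 3) * (T + 1) := by
  obtain ⟨m, hm⟩ : ∃ m, m = T + 2 * j + 2 := ⟨_, rfl⟩
  have hu : T + 2 * j + 3 = m + 1 := by rw [hm]
  rw [hu] at hreg hgal
  obtain ⟨c, hc⟩ : ∃ c, c = 3 * j ^ 2 + 4 * j + 3 := ⟨_, rfl⟩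
  rw [← hc] at hreg hgal
  have E1 : (T + 1) * (T + 3 * j + 3) ^ 2 + 2 * (m + 1) ^ 2 + (3 * j ^ 2 + 4 * j) * (m + 1) +
      (2 * j ^ 3 + 2 * j ^ 2) = (m + 1) ^ 3 := by
    rw [hm]; ring
  have E2 : m ^ 2 * (m + 1) + 2 * (m + 1) ^ 2 = (m + 1) ^ 3 + (m + 1) := by ring
  have E3 : m ^ 3 + 3 * (m + 1) ^ 2 + 1 = (m + 1) ^ 3 + 3 * (m + 1) := by ring
  have E4 : m * m ^ 2 = m ^ 3 := by ring
  have E6 : c * (m + 1) = (3 * j ^ 2 + 4 * j) * (m + 1) + 3 * (m + 1) := by rw [hc]; ring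
  have E7 : (m + 1) ^ 2 = (m + 1) * (m + 1) := by ring
  have hbot : (T + 1) * (T + 3 * j + 3) ^ 2 < m ^ 2 * (m + 1) := by omega
  have hm3 : m ^ 3 ≤ (T + 1) * (T + 3 * j + 3) ^ 2 := by omega
  have hlt : (T + 1) * (T + 3 * j + 3) ^ 2 < (m + 1) ^ 3 := by omega
  rw [cubicEIP_eq (by positivity) hm3 hlt (cubicFace_of_bot hbot), halfPerim_sq (by omega)]
  obtain ⟨r, hr⟩ : ∃ r, (T + 1) * (T + 3 * j + 3) ^ 2 - m * m ^ 2 = r := ⟨_, rfl⟩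
  have hr' : r + c * (m + 1) + (2 * j ^ 3 + 2 * j ^ 2) = (m + 1) ^ 2 + 1 := by omega
  have hcu : c ≤ m + 1 := Nat.le_of_mul_le_mul_right (c := m + 1) (by rw [← E7]; omega) (by omega)
  obtain ⟨s, hs⟩ : ∃ s, s + c = 2 * (m + 1) := ⟨2 * (m + 1) - c, by omega⟩
  have hs2 : s ^ 2 + 4 * (c * (m + 1)) = 4 * (m + 1) ^ 2 + c ^ 2 := by
    have e := congrArg (fun x => x ^ 2) hs
    have e' := congrArg (fun x => 2 * c * x) hs
    ring_nf at e e' ⊢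
    omega
  have h1s : 1 ≤ s := by omega
  have hsq : (s - 1) ^ 2 + 2 * s = s ^ 2 + 1 := by
    obtain ⟨s', rfl⟩ : ∃ s', s = s' + 1 := ⟨s - 1, by omega⟩
    rw [Nat.add_sub_cancel]; ring
  have hc9 : 9 ≤ c ^ 2 := by
    have h3 : 3 ≤ c := by omega
    calc 9 = 3 ^ 2 := by norm_num
      _ ≤ c ^ 2 := Nat.pow_le_pow_left h3 2
  have hgs : halfPerim r = s := halfPerim_eq_of_sq_bounds h1s (by omega) (by omega)
  rw [hr, hgs, hm]
  rw [hm, hc] at hs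
  ring_nf
  ring_nf at hs
  omega

/-- **Mainini–Schmidt 2020, Lemma 3.5 AT `d = 3` — a theorem** (the cubic-lattice instance of the
vendored fact `MaininiSchmidt2020_lemma35`, hypotheses verbatim): for `ℓ ≥ 1` and
`1 ≤ p ≤ ⌊h_{ℓ,3}⌋ = ⌊ℓ^{1/4}⌋` the slab-deficient cube `P_{ℓ,3,p} = {1,…,ℓ−p} × {1,…,ℓ}²` is an
`EIP³` minimizer: its edge perimeter `2(ℓ² + 2ℓ(ℓ−p))` equals `2·G₃((ℓ−p)ℓ²)` (cases `p mod 3`).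
[cite: MaininiSchmidt2020, Lemma 3.5 (with Definition 3.1, h_{ℓ,d} = ℓ^{2^{1−d}})] -/
theorem MaininiSchmidt2020_lemma35_three (ℓ p : ℕ) (hℓ : 1 ≤ ℓ) (hp : 1 ≤ p)
    (hpℓ : p ≤ ⌊(ℓ : ℝ) ^ ((2 : ℝ) ^ (1 - ((3 : ℕ) : ℝ)))⌋₊) :
    IsEIPMinimizer (slabConfig 3 ℓ p) := by
  -- `p ≤ ⌊ℓ^{1/4}⌋`, so `p⁴ ≤ ℓ`
  have hexp : (2 : ℝ) ^ (1 - ((3 : ℕ) : ℝ)) = 1 / 4 := by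
    rw [show (1 : ℝ) - ((3 : ℕ) : ℝ) = ((-2 : ℤ) : ℝ) by norm_num, Real.rpow_intCast]
    norm_num
  have hpr : (p : ℝ) ≤ (ℓ : ℝ) ^ ((1 : ℝ) / 4) := by
    have h1 : ((⌊(ℓ : ℝ) ^ ((2 : ℝ) ^ (1 - ((3 : ℕ) : ℝ)))⌋₊ : ℕ) : ℝ) ≤ (ℓ : ℝ) ^ ((1 : ℝ) / 4) := by
      rw [← hexp]
      exact Nat.floor_le (by positivity)
    exact le_trans (by exact_mod_cast hpℓ) h1
  have hp4 : p ^ 4 ≤ ℓ := by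
    have h2 : (p : ℝ) ^ 4 ≤ ((ℓ : ℝ) ^ ((1 : ℝ) / 4)) ^ 4 := pow_le_pow_left₀ (by positivity) hpr 4
    have h3 : ((ℓ : ℝ) ^ ((1 : ℝ) / 4)) ^ (4 : ℕ) = ℓ := by
      rw [← Real.rpow_natCast, ← Real.rpow_mul (by positivity)]; norm_num
    rw [h3] at h2
    exact_mod_cast h2
  rcases Nat.lt_or_ge p ℓ with hlt | hge
  · -- `p < ℓ`: perimeter `2(ℓ² + 2ℓ(ℓ−p))` versus `2·G₃((ℓ−p)ℓ²)`
    rw [isEIPMinimizer_iff_card_boundaryPairs_eq_three, card_boundaryPairs_slabConfig_three hlt,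
      card_slabConfig_three]
    congr 1
    symm
    obtain ⟨T, hT⟩ : ∃ T, ℓ - p = T + 1 := ⟨ℓ - p - 1, by omega⟩
    rw [hT]
    -- `p = 3j + ρ`, `ℓ = T + p + 1`
    obtain ⟨j, ρ, hρ, hpj⟩ : ∃ j ρ, ρ < 3 ∧ p = 3 * j + ρ :=
      ⟨p / 3, p % 3, Nat.mod_lt _ (by norm_num), (Nat.div_add_mod p 3).symm⟩
    have hl : ℓ = T + 3 * j + ρ + 1 := by omega
    subst hpj
    subst hl
    have hpow : ∀ {a b : ℕ}, 1 ≤ a → a ≤ b → j ^ a ≤ j ^ b := by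
      intro a b ha hab
      rcases Nat.eq_zero_or_pos j with h0 | h0
      · rw [h0, zero_pow (by omega)]; exact Nat.zero_le _
      · exact Nat.pow_le_pow_right h0 hab
    have hj4 : j ≤ j ^ 4 := Nat.le_self_pow (by norm_num) j
    have hj24 : j ^ 2 ≤ j ^ 4 := hpow (by norm_num) (by norm_num)
    have hj34 : j ^ 3 ≤ j ^ 4 := hpow (by norm_num) (by norm_num)
    have hj23 : j ^ 2 ≤ j ^ 3 := hpow (by norm_num) (by norm_num)
    interval_cases ρ
    · -- `p = 3j`, `j ≥ 1`
      have hj : 1 ≤ j := by omega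
      have e4 : (3 * j + 0) ^ 4 = 81 * j ^ 4 := by ring
      rw [e4] at hp4
      have hu : 3 * j ^ 2 + 2 * j ^ 3 ≤ T + 2 * j + 1 := by omega
      have h1 := Nat.mul_le_mul_right (T + 2 * j + 1) hu
      have h2 : 2 * j ^ 3 ≤ 2 * j ^ 3 * (T + 2 * j + 1) := Nat.le_mul_of_pos_right _ (by omega)
      have hmain := cubicEIP_slab_mod_zero T j hj (by linarith [h1, h2]) (by omega)
      rw [show T + 3 * j + 0 + 1 = T + 3 * j + 1 by ring]
      exact hmain
    · rcases Nat.eq_zero_or_pos j with hj0 | hj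
      · -- `p = 1`
        subst hj0
        rw [show T + 3 * 0 + 1 + 1 = T + 2 by ring]
        exact cubicEIP_slab_one T
      · -- `p = 3j + 1`, `j ≥ 1`
        have e4 : (3 * j + 1) ^ 4 = 81 * j ^ 4 + 108 * j ^ 3 + 54 * j ^ 2 + 12 * j + 1 := by ring
        rw [e4] at hp4
        have hu : 3 * j ^ 2 + 2 * j + 1 + (2 * j ^ 3 + j ^ 2) ≤ T + 2 * j + 2 := by omega
        have h1 := Nat.mul_le_mul_right (T + 2 * j + 2) hu
        have h2 : 2 * j ^ 3 + j ^ 2 ≤ (2 * j ^ 3 + j ^ 2) * (T + 2 * j + 2) :=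
          Nat.le_mul_of_pos_right _ (by omega)
        have e2 : (3 * j ^ 2 + 2 * j + 1) ^ 2 = 9 * j ^ 4 + 12 * j ^ 3 + 10 * j ^ 2 + 4 * j + 1 := by
          ring
        have hmain := cubicEIP_slab_mod_one T j hj (by linarith [h1, h2]) (by rw [e2]; omega)
        rw [show T + 3 * j + 1 + 1 = T + 3 * j + 2 by ring]
        exact hmain
    · -- `p = 3j + 2`
      have e4 : (3 * j + 2) ^ 4 = 81 * j ^ 4 + 216 * j ^ 3 + 216 * j ^ 2 + 96 * j + 16 := by ring
      rw [e4] at hp4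
      have hu : 3 * j ^ 2 + 4 * j + 3 + (2 * j ^ 3 + 2 * j ^ 2) ≤ T + 2 * j + 3 := by omega
      have h1 := Nat.mul_le_mul_right (T + 2 * j + 3) hu
      have h2 : 2 * j ^ 3 + 2 * j ^ 2 ≤ (2 * j ^ 3 + 2 * j ^ 2) * (T + 2 * j + 3) :=
        Nat.le_mul_of_pos_right _ (by omega)
      have e2 : (3 * j ^ 2 + 4 * j + 3) ^ 2 = 9 * j ^ 4 + 24 * j ^ 3 + 34 * j ^ 2 + 24 * j + 9 := by
        ring
      have hmain := cubicEIP_slab_mod_two T j (by linarith [h1, h2]) (by rw [e2]; omega)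
      rw [show T + 3 * j + 2 + 1 = T + 3 * j + 3 by ring]
      exact hmain
  · -- `ℓ ≤ p` forces `ℓ = p = 1`: the empty configuration
    have : slabConfig 3 ℓ p = ∅ := by
      rw [← card_eq_zero, card_slabConfig_three, Nat.sub_eq_zero_of_le hge, zero_mul]
    rw [this]
    exact isEIPMinimizer_empty

end SlabLemma

/-! ### Nested solutions in `ℤ³` ([MS20] Theorem 2.2 at `d = 3`): the cubicles -/

section Nested

/-! #### Stacks of an arbitrary nested family of planar minimizers -/

/-- The stack of the members `D(f k)` of a planar family `D` in the planes `x₀ = k`, `k < T`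
(`daisyStack = familyStack daisyOf`). [cite: AgnarssonLauria2013, Definition 2.1 and §5 (cubicles ⟦n⟧^d, Definition 5.8); MaininiSchmidt2020, Proposition 3.2] -/
noncomputable def familyStack (D : ℕ → Finset (Site 2)) (f : ℕ → ℕ) (T : ℕ) : Finset (Site 3) :=
  (range T).biUnion fun k => (D (f k)).image (Fin.cons (k : ℤ))

/-- `daisyStack` is the stack of the daisies. [cite: MaininiSchmidt2020, Proposition 3.2] -/
theorem daisyStack_eq_familyStack (f : ℕ → ℕ) (T : ℕ) :
    daisyStack f T = familyStack daisyOf f T := rfl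

variable {D : ℕ → Finset (Site 2)} {f : ℕ → ℕ} {T : ℕ}

/-- Membership in a family stack. [cite: AgnarssonLauria2013, Definition 2.1] -/
theorem mem_familyStack {x : Site 3} :
    x ∈ familyStack D f T ↔ ∃ k, k < T ∧ x 0 = k ∧ Fin.tail x ∈ D (f k) := by
  simp only [familyStack, mem_biUnion, mem_range, mem_image]
  constructor
  · rintro ⟨k, hk, y, hy, rfl⟩
    exact ⟨k, hk, by simp, by simpa using hy⟩
  · rintro ⟨k, hk, h0, hy⟩
    exact ⟨k, hk, Fin.tail x, hy, by rw [← h0, Fin.cons_self_tail]⟩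

/-- A family stack grows with its profile (nested family). [cite: AgnarssonLauria2013, Proposition 5.7 (⟦n⟧ ⊆ ⟦n'⟧ iff n ≤ n')] -/
theorem familyStack_mono (hD : IsNestedMinimizerFamily D) {f g : ℕ → ℕ} (hfg : ∀ k, f k ≤ g k)
    {T T' : ℕ} (hT : T ≤ T') : familyStack D f T ⊆ familyStack D g T' := by
  intro x hx
  rw [mem_familyStack] at hx ⊢
  obtain ⟨k, hk, h0, hy⟩ := hx
  exact ⟨k, lt_of_lt_of_le hk hT, h0, hD.mono (hfg k) hy⟩

/-- The slice of a family stack at an occupied height. [cite: MaininiSchmidt2020, Proposition 3.2] -/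
theorem sliceAt_familyStack_natCast (hD : IsNestedMinimizerFamily D) (hT : ∀ k, T ≤ k → f k = 0)
    (k : ℕ) : sliceAt (familyStack D f T) (k : ℤ) = D (f k) := by
  ext y
  rw [mem_sliceAt, mem_familyStack]
  constructor
  · rintro ⟨k', -, h0, hy⟩
    simp only [Fin.cons_zero, Nat.cast_inj] at h0
    subst h0
    simpa using hy
  · intro hy
    by_cases hk : k < T
    · exact ⟨k, hk, by simp, by simpa using hy⟩
    · exfalso
      have h0 : D (f k) = ∅ := by
        rw [← card_eq_zero, hD.card_eq, hT k (Nat.le_of_not_lt hk)]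
      rw [h0] at hy
      simp at hy

/-- Below the stack the slice is empty. [cite: MaininiSchmidt2020, Proposition 3.2] -/
theorem sliceAt_familyStack_neg_one : sliceAt (familyStack D f T) (-1) = ∅ := by
  refine eq_empty_of_forall_notMem fun y hy => ?_
  rw [mem_sliceAt, mem_familyStack] at hy
  obtain ⟨k, -, h0, -⟩ := hy
  simp only [Fin.cons_zero] at h0
  omega

/-- The occupied heights of a family stack with positive profile are `0, …, T−1`.
[cite: AgnarssonLauria2013, Definition 2.1] -/
theorem firstCoords_familyStack (hD : IsNestedMinimizerFamily D) (hpos : ∀ k, k < T → 0 < f k) :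
    firstCoords (familyStack D f T) = (range T).image (Nat.cast : ℕ → ℤ) := by
  ext t
  rw [firstCoords, mem_image, mem_image]
  constructor
  · rintro ⟨x, hx, rfl⟩
    obtain ⟨k, hk, h0, -⟩ := mem_familyStack.1 hx
    exact ⟨k, mem_range.2 hk, h0.symm⟩
  · rintro ⟨k, hk, rfl⟩
    have hne : (D (f k)).Nonempty := by
      rw [← card_pos, hD.card_eq]; exact hpos k (mem_range.1 hk)
    obtain ⟨y, hy⟩ := hne
    exact ⟨Fin.cons (k : ℤ) y, mem_familyStack.2 ⟨k, mem_range.1 hk, by simp, by simpa using hy⟩,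
      by simp⟩

/-- **A family stack has `Σ_k f(k)` points.** [cite: MaininiSchmidt2020, Proposition 3.2 (#C_s = #C)] -/
theorem card_familyStack (hD : IsNestedMinimizerFamily D) (f : ℕ → ℕ) (T : ℕ) :
    #(familyStack D f T) = ∑ k ∈ range T, f k := by
  rw [familyStack, card_biUnion]
  · refine sum_congr rfl fun k _ => ?_
    rw [card_image_of_injective _ ((Fin.cons_injective2 (α := fun _ : Fin 3 => ℤ)).right _),
      hD.card_eq]
  · intro k _ k' _ hkk'
    rw [Function.onFun, Finset.disjoint_left]
    intro x hx hx'
    obtain ⟨y, -, rfl⟩ := mem_image.1 hx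
    obtain ⟨y', -, h⟩ := mem_image.1 hx'
    have h0 := congrFun h 0
    simp only [Fin.cons_zero, Nat.cast_inj] at h0
    exact hkk' h0.symm

/-- A member of a nested family of planar minimizers with `m` points has `2⌈2√m⌉` boundary pairs.
[cite: MaininiPiovanoSchmidtStefanelli2019, §2 (θ_d = 2⌈2√d⌉)] -/
theorem IsNestedMinimizerFamily.card_boundaryPairs_eq (hD : IsNestedMinimizerFamily D) (m : ℕ) :
    #(boundaryPairs (D m)) = 2 * halfPerim m := by
  have h := (isEIPMinimizer_iff_card_boundaryPairs_eq (D m)).1 (hD.isEIPMinimizer m)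
  rw [hD.card_eq] at h
  rw [h, halfPerim_def]

/-- **The edge perimeter of a sorted family stack**: `Σ_{k<T} 2⌈2√f(k)⌉ + 2·f(0)` for a nonincreasing
positive profile vanishing from `T` on. [cite: MaininiSchmidt2020, Proposition 3.2; AgnarssonLauria2013, Observation 3.1] -/
theorem card_boundaryPairs_familyStack (hD : IsNestedMinimizerFamily D) (hpos : ∀ k, k < T → 0 < f k)
    (hf : Antitone f) (hT : f T = 0) :
    #(boundaryPairs (familyStack D f T)) = ∑ k ∈ range T, 2 * halfPerim (f k) + 2 * f 0 := by
  have hT' : ∀ k, T ≤ k → f k = 0 := fun k hk => Nat.le_zero.1 (hT ▸ hf hk)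
  have hinj : Set.InjOn (Nat.cast : ℕ → ℤ) ↑(range T) := fun a _ b _ h => by exact_mod_cast h
  rw [card_boundaryPairs_eq_sum_sliceAt_add (familyStack D f T),
    card_vertBoundaryPairs_eq_sum (familyStack D f T),
    card_vertBoundaryPairs_eq_sum (familyStack D f T),
    firstCoords_familyStack hD hpos, sum_image hinj, sum_image hinj, sum_image hinj]
  simp only [if_true, Bool.false_eq_true, if_false]
  have hs1 : ∑ k ∈ range T, #(boundaryPairs (sliceAt (familyStack D f T) (k : ℤ))) =
      ∑ k ∈ range T, 2 * halfPerim (f k) := by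
    refine sum_congr rfl fun k _ => ?_
    rw [sliceAt_familyStack_natCast hD hT', hD.card_boundaryPairs_eq]
  have hs2 : ∑ k ∈ range T, #(sliceAt (familyStack D f T) (k : ℤ) \
      sliceAt (familyStack D f T) (k + 1)) = f 0 := by
    have : ∀ k ∈ range T, #(sliceAt (familyStack D f T) (k : ℤ) \
        sliceAt (familyStack D f T) (k + 1)) = f k - f (k + 1) := by
      intro k _
      rw [show (k : ℤ) + 1 = ((k + 1 : ℕ) : ℤ) by push_cast; ring,
        sliceAt_familyStack_natCast hD hT', sliceAt_familyStack_natCast hD hT', hD.card_sdiff]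
    rw [sum_congr rfl this, sum_range_sub_succ_of_antitone hf, hT, Nat.sub_zero]
  have hs3 : ∑ k ∈ range T, #(sliceAt (familyStack D f T) (k : ℤ) \
      sliceAt (familyStack D f T) (k + -1)) = f 0 := by
    cases T with
    | zero => rw [sum_range_zero, hT]
    | succ S =>
      rw [sum_range_succ']
      have h0 : #(sliceAt (familyStack D f (S + 1)) ((0 : ℕ) : ℤ) \
          sliceAt (familyStack D f (S + 1)) ((0 : ℕ) + -1)) = f 0 := by
        rw [show ((0 : ℕ) : ℤ) + -1 = -1 by simp, sliceAt_familyStack_neg_one, sdiff_empty,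
          sliceAt_familyStack_natCast hD hT', hD.card_eq]
      have h1 : ∀ k ∈ range S, #(sliceAt (familyStack D f (S + 1)) ((k + 1 : ℕ) : ℤ) \
          sliceAt (familyStack D f (S + 1)) ((k + 1 : ℕ) + -1)) = 0 := by
        intro k _
        rw [show ((k + 1 : ℕ) : ℤ) + -1 = ((k : ℕ) : ℤ) by push_cast; ring,
          sliceAt_familyStack_natCast hD hT', sliceAt_familyStack_natCast hD hT', hD.card_sdiff]
        exact Nat.sub_eq_zero_of_le (hf (Nat.le_succ k))
      rw [sum_congr rfl h1, sum_const_zero, h0, zero_add]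
  rw [hs1, hs2, hs3]
  ring

/-- A family stack with empty top member is the shorter stack. [folklore] -/
private theorem familyStack_succ_of_eq_zero (hD : IsNestedMinimizerFamily D) (hT : f T = 0) :
    familyStack D f (T + 1) = familyStack D f T := by
  ext x
  rw [mem_familyStack, mem_familyStack]
  constructor
  · rintro ⟨k, hk, h0, hy⟩
    rcases Nat.lt_succ_iff_lt_or_eq.1 hk with hk' | rfl
    · exact ⟨k, hk', h0, hy⟩
    · have h0' : D (f k) = ∅ := by rw [← card_eq_zero, hD.card_eq, hT]
      rw [h0'] at hy; simp at hy
  · rintro ⟨k, hk, h0, hy⟩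
    exact ⟨k, Nat.lt_succ_of_lt hk, h0, hy⟩

/-! #### Transposed daisies: a nested planar family filling columns first -/

/-- The transposed daisy `D_mᵀ` (`daisyOf m` with its two coordinates exchanged): a nested family of
planar minimizers that fills a new COLUMN before a new row — Agnarsson–Lauria's planar cubicles
`⟦m⟧²` (`[s,1]² = [s+1] × [s]`). [cite: AgnarssonLauria2013, Definition 5.1 and §5 (recursive definition of ⟦n⟧^d, d = 2)] -/
noncomputable def daisyOfT (m : ℕ) : Finset (Site 2) :=
  (daisyOf m).image (relabel (Equiv.swap 0 1))

/-- Membership in the transposed daisy. [cite: AgnarssonLauria2013, §5 (recursive definition of ⟦n⟧^d, d = 2)] -/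
theorem mem_daisyOfT {m : ℕ} {z : Site 2} :
    z ∈ daisyOfT m ↔ relabel (Equiv.swap 0 1) z ∈ daisyOf m := by
  rw [daisyOfT, mem_image]
  constructor
  · rintro ⟨y, hy, rfl⟩
    rwa [show relabel (Equiv.swap 0 1) (relabel (Equiv.swap 0 1) y) = y from by
      funext i; simp [relabel]]
  · intro h
    exact ⟨_, h, by funext i; simp [relabel]⟩

/-- **The transposed daisies are a nested family of `EIP²` minimizers.**
[cite: MaininiSchmidt2020, Theorem 2.2 (nested solutions, d = 2); AgnarssonLauria2013, Proposition 5.7] -/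
theorem isNestedMinimizerFamily_daisyOfT : IsNestedMinimizerFamily daisyOfT where
  card_eq m := by
    rw [daisyOfT, card_image_of_injective _ (relabel_injective _), card_daisyOf]
  mono := fun a b hab => image_subset_image (daisyOf_mono hab)
  isEIPMinimizer m := (isEIPMinimizer_daisyOf m).image_relabel _

/-- Coordinate bounds in the transposed daisy with `m` points, `s = ⌊√m⌋`: both coordinates lie in
`[1, s+1]`, the second reaches `s + 1` only if `m ≥ s² + s + 1`, the first only if `m ≥ s² + 1`.
[cite: MaininiPiovanoSchmidtStefanelli2019, §2 (daisies)] -/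
theorem daisyOfT_bounds {m : ℕ} {z : Site 2} (hz : z ∈ daisyOfT m) :
    1 ≤ z 0 ∧ 1 ≤ z 1 ∧ z 0 ≤ Nat.sqrt m + 1 ∧ z 1 ≤ Nat.sqrt m + 1 ∧
      (z 1 = Nat.sqrt m + 1 → Nat.sqrt m ^ 2 + Nat.sqrt m + 1 ≤ m) ∧
      (z 0 = Nat.sqrt m + 1 → Nat.sqrt m ^ 2 + 1 ≤ m) := by
  rw [mem_daisyOfT, mem_daisyOf] at hz
  simp only [relabel, Equiv.swap_apply_left, Equiv.swap_apply_right] at hz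
  have h1 := Nat.sqrt_le' m
  have h2 : m < (Nat.sqrt m + 1) ^ 2 := Nat.lt_succ_sqrt' m
  have h3 : (Nat.sqrt m + 1) ^ 2 = Nat.sqrt m ^ 2 + 2 * Nat.sqrt m + 1 := by ring
  rw [h3] at h2
  rcases hz with h | h | h <;> omega

/-- `D_{s²}ᵀ = [1, s]²`. [cite: MaininiPiovanoSchmidtStefanelli2019, §2 (R(s,s))] -/
theorem mem_daisyOfT_sq {s : ℕ} {z : Site 2} :
    z ∈ daisyOfT (s ^ 2) ↔ 1 ≤ z 0 ∧ z 0 ≤ s ∧ 1 ≤ z 1 ∧ z 1 ≤ s := by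
  rw [mem_daisyOfT, mem_daisyOf_sq]
  simp only [relabel, Equiv.swap_apply_left, Equiv.swap_apply_right]
  tauto

/-- `D_{s(s+1)}ᵀ = [1, s+1] × [1, s]`. [cite: MaininiPiovanoSchmidtStefanelli2019, §2 (R(s,s+1))] -/
theorem mem_daisyOfT_mul_succ {s : ℕ} {z : Site 2} :
    z ∈ daisyOfT (s * (s + 1)) ↔ 1 ≤ z 0 ∧ z 0 ≤ s + 1 ∧ 1 ≤ z 1 ∧ z 1 ≤ s := by
  rw [mem_daisyOfT, mem_daisyOf, show s * (s + 1) = s ^ 2 + s by ring,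
    Nat.sqrt_add_eq' s (by omega)]
  simp only [relabel, Equiv.swap_apply_left, Equiv.swap_apply_right]
  push_cast
  omega

/-! #### The layer profile `F, …, F, r` and its stacks -/

/-- The profile of a quasi-cube of `m` layers of the face `F` topped by a layer of `r` points.
[cite: AgnarssonLauria2013, §5 (recursive definition ⟦n⟧^d = ⟦m,ℓ⟧^d ∪ λ_{ℓ+1;m+1}(⟦n − [m,ℓ]^d⟧^{d−1}) before Proposition 5.7)] -/
def cubicleProfile (m F r : ℕ) : ℕ → ℕ := fun k => if k < m then F else if k = m then r else 0

/-- The profile is nonincreasing when `r ≤ F`. [cite: AgnarssonLauria2013, §5 (recursive definition of ⟦n⟧^d)] -/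
theorem antitone_cubicleProfile {m F r : ℕ} (hr : r ≤ F) : Antitone (cubicleProfile m F r) := by
  intro a b hab
  dsimp only [cubicleProfile]
  split_ifs <;> omega

/-- A profile stack has `m·F + r` points. [cite: AgnarssonLauria2013, Proposition 5.7] -/
theorem card_familyStack_cubicleProfile (hD : IsNestedMinimizerFamily D) (m F r : ℕ) :
    #(familyStack D (cubicleProfile m F r) (m + 1)) = m * F + r := by
  have hfk : ∀ k ∈ range m, cubicleProfile m F r k = F := fun k hk => by
    simp only [cubicleProfile, if_pos (mem_range.1 hk)]
  rw [card_familyStack hD, sum_range_succ, sum_congr rfl hfk, sum_const, card_range, smul_eq_mul]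
  simp [cubicleProfile]

/-- **The edge perimeter of a profile stack**: `2(F + m⌈2√F⌉ + ⌈2√r⌉)` (`m ≥ 1`, `r ≤ F`) — `m`
nested planar minimizers of `F` points and one of `r` points on top.
[cite: AgnarssonLauria2013, §5 (recursions for F_d after Definition 5.11) and Observation 5.12; MaininiSchmidt2020, Proposition 3.2] -/
theorem card_boundaryPairs_familyStack_cubicleProfile (hD : IsNestedMinimizerFamily D) {m F r : ℕ}
    (hm : 1 ≤ m) (hF : 1 ≤ F) (hr : r ≤ F) :
    #(boundaryPairs (familyStack D (cubicleProfile m F r) (m + 1))) =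
      2 * (F + m * halfPerim F + halfPerim r) := by
  have hf0 : cubicleProfile m F r 0 = F := by simp only [cubicleProfile, if_pos (show 0 < m by omega)]
  have hfm : cubicleProfile m F r m = r := by simp [cubicleProfile]
  have hsumg : ∑ k ∈ range m, 2 * halfPerim (cubicleProfile m F r k) = m * (2 * halfPerim F) := by
    have hfk : ∀ k ∈ range m, 2 * halfPerim (cubicleProfile m F r k) = 2 * halfPerim F :=
      fun k hk => by simp only [cubicleProfile, if_pos (mem_range.1 hk)]
    rw [sum_congr rfl hfk, sum_const, card_range, smul_eq_mul]
  rcases Nat.eq_zero_or_pos r with hr0 | hrpos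
  · rw [familyStack_succ_of_eq_zero hD (by rw [hfm, hr0]),
      card_boundaryPairs_familyStack hD (fun k hk => by simp only [cubicleProfile, if_pos hk]; omega)
        (antitone_cubicleProfile hr) (by rw [hfm, hr0]), hsumg, hf0, hr0, halfPerim_zero]
    ring
  · rw [card_boundaryPairs_familyStack hD (T := m + 1)
        (fun k hk => by
          dsimp only [cubicleProfile]
          split_ifs <;> omega) (antitone_cubicleProfile hr) (by simp [cubicleProfile]),
      sum_range_succ, hsumg, hfm, hf0]
    ring

/-! #### The three cubicle shapes -/

/-- The lattice box `{1,…,a} × {1,…,b} × {1,…,c}`. [cite: AlonsoCerf1996, §3 (parallelepipeds j₁ × j₂ × j₃)] -/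
noncomputable def box3 (a b c : ℕ) : Finset (Site 3) :=
  Fintype.piFinset ![Icc (1 : ℤ) a, Icc (1 : ℤ) b, Icc (1 : ℤ) c]

/-- Membership in a box. [cite: AlonsoCerf1996, §3] -/
theorem mem_box3 {a b c : ℕ} {z : Site 3} :
    z ∈ box3 a b c ↔ 1 ≤ z 0 ∧ z 0 ≤ a ∧ 1 ≤ z 1 ∧ z 1 ≤ b ∧ 1 ≤ z 2 ∧ z 2 ≤ c := by
  rw [box3, Fintype.mem_piFinset, Fin.forall_fin_succ, Fin.forall_fin_succ, Fin.forall_fin_succ]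
  simp [and_assoc]

/-- `#box = abc`. [cite: AlonsoCerf1996, §3] -/
theorem card_box3 (a b c : ℕ) : #(box3 a b c) = a * b * c := by
  rw [box3, Fintype.card_piFinset, Fin.prod_univ_three]
  simp only [Matrix.cons_val_zero, Matrix.cons_val_one, Matrix.cons_val_two, Matrix.head_cons,
    Matrix.tail_cons, Int.card_Icc]
  have e1 : ((a : ℤ) + 1 - 1).toNat = a := by omega
  have e2 : ((b : ℤ) + 1 - 1).toNat = b := by omega
  have e3 : ((c : ℤ) + 1 - 1).toNat = c := by omega
  rw [e1, e2, e3]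

/-- The **bottom-regime cubicle** `[m,0]³ ∪ layer`: `m` layers of the `m × m` square stacked along
`e₀` (heights `1,…,m`) plus the transposed daisy of `r` points in the plane `x₀ = m + 1`.
[cite: AgnarssonLauria2013, §5 (recursive definition of ⟦n⟧^d, ℓ_d = 0)] -/
noncomputable def cubicleBot (m r : ℕ) : Finset (Site 3) :=
  (familyStack daisyOfT (cubicleProfile m (m ^ 2) r) (m + 1)).image fun x => x + unitStep 0 true

/-- The **middle-regime cubicle** `[m,1]³ ∪ layer`: `m` layers of the `(m+1) × m` rectangle stacked
along `e₁` plus the transposed daisy of `r` points in the plane `x₁ = m + 1`.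
[cite: AgnarssonLauria2013, §5 (recursive definition of ⟦n⟧^d, ℓ_d = 1)] -/
noncomputable def cubicleMid (m r : ℕ) : Finset (Site 3) :=
  ((familyStack daisyOfT (cubicleProfile m (m * (m + 1)) r) (m + 1)).image
    (relabel (Equiv.swap 0 1))).image fun x => x + unitStep 1 true

/-- The **top-regime cubicle** `[m,2]³ ∪ layer`: `m` layers of the `(m+1) × (m+1)` square stacked
along `e₂` plus the transposed daisy of `r` points in the plane `x₂ = m + 1`.
[cite: AgnarssonLauria2013, §5 (recursive definition of ⟦n⟧^d, ℓ_d = 2)] -/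
noncomputable def cubicleTop (m r : ℕ) : Finset (Site 3) :=
  ((familyStack daisyOfT (cubicleProfile m ((m + 1) ^ 2) r) (m + 1)).image
    (relabel (finRotate 3))).image fun x => x + unitStep 2 true

/-- `#cubicleBot m r = m³ + r`. [cite: AgnarssonLauria2013, Proposition 5.7] -/
theorem card_cubicleBot (m r : ℕ) : #(cubicleBot m r) = m * m ^ 2 + r := by
  rw [cubicleBot, card_image_of_injective _ (add_left_injective _),
    card_familyStack_cubicleProfile isNestedMinimizerFamily_daisyOfT]

/-- `#cubicleMid m r = m²(m+1) + r`. [cite: AgnarssonLauria2013, Proposition 5.7] -/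
theorem card_cubicleMid (m r : ℕ) : #(cubicleMid m r) = m * (m * (m + 1)) + r := by
  rw [cubicleMid, card_image_of_injective _ (add_left_injective _),
    card_image_of_injective _ (relabel_injective _),
    card_familyStack_cubicleProfile isNestedMinimizerFamily_daisyOfT]

/-- `#cubicleTop m r = m(m+1)² + r`. [cite: AgnarssonLauria2013, Proposition 5.7] -/
theorem card_cubicleTop (m r : ℕ) : #(cubicleTop m r) = m * (m + 1) ^ 2 + r := by
  rw [cubicleTop, card_image_of_injective _ (add_left_injective _),
    card_image_of_injective _ (relabel_injective _),
    card_familyStack_cubicleProfile isNestedMinimizerFamily_daisyOfT]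

/-- Edge perimeter of the bottom-regime cubicle. [cite: AgnarssonLauria2013, §5 (recursions for F_d after Definition 5.11) and Observation 5.12] -/
theorem card_boundaryPairs_cubicleBot {m r : ℕ} (hm : 1 ≤ m) (hr : r ≤ m ^ 2) :
    #(boundaryPairs (cubicleBot m r)) = 2 * (m ^ 2 + m * halfPerim (m ^ 2) + halfPerim r) := by
  rw [cubicleBot, card_boundaryPairs_image_add_right,
    card_boundaryPairs_familyStack_cubicleProfile isNestedMinimizerFamily_daisyOfT hm
      (Nat.one_le_pow _ _ hm) hr]

/-- Edge perimeter of the middle-regime cubicle. [cite: AgnarssonLauria2013, §5 (recursions for F_d after Definition 5.11) and Observation 5.12] -/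
theorem card_boundaryPairs_cubicleMid {m r : ℕ} (hm : 1 ≤ m) (hr : r ≤ m * (m + 1)) :
    #(boundaryPairs (cubicleMid m r)) =
      2 * (m * (m + 1) + m * halfPerim (m * (m + 1)) + halfPerim r) := by
  rw [cubicleMid, card_boundaryPairs_image_add_right, card_boundaryPairs_image_relabel,
    card_boundaryPairs_familyStack_cubicleProfile isNestedMinimizerFamily_daisyOfT hm
      (by nlinarith) hr]

/-- Edge perimeter of the top-regime cubicle. [cite: AgnarssonLauria2013, §5 (recursions for F_d after Definition 5.11) and Observation 5.12] -/
theorem card_boundaryPairs_cubicleTop {m r : ℕ} (hm : 1 ≤ m) (hr : r ≤ (m + 1) ^ 2) :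
    #(boundaryPairs (cubicleTop m r)) =
      2 * ((m + 1) ^ 2 + m * halfPerim ((m + 1) ^ 2) + halfPerim r) := by
  rw [cubicleTop, card_boundaryPairs_image_add_right, card_boundaryPairs_image_relabel,
    card_boundaryPairs_familyStack_cubicleProfile isNestedMinimizerFamily_daisyOfT hm
      (Nat.one_le_pow _ _ (by omega)) hr]

/-- Monotonicity of the shapes in the size of the layer. [cite: AgnarssonLauria2013, Proposition 5.7] -/
theorem cubicleBot_mono (m : ℕ) {r r' : ℕ} (h : r ≤ r') : cubicleBot m r ⊆ cubicleBot m r' :=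
  image_subset_image (familyStack_mono isNestedMinimizerFamily_daisyOfT
    (fun k => by dsimp only [cubicleProfile]; split_ifs <;> omega) le_rfl)

/-- Monotonicity of the shapes in the size of the layer. [cite: AgnarssonLauria2013, Proposition 5.7] -/
theorem cubicleMid_mono (m : ℕ) {r r' : ℕ} (h : r ≤ r') : cubicleMid m r ⊆ cubicleMid m r' :=
  image_subset_image (image_subset_image (familyStack_mono isNestedMinimizerFamily_daisyOfT
    (fun k => by dsimp only [cubicleProfile]; split_ifs <;> omega) le_rfl))

/-- Monotonicity of the shapes in the size of the layer. [cite: AgnarssonLauria2013, Proposition 5.7] -/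
theorem cubicleTop_mono (m : ℕ) {r r' : ℕ} (h : r ≤ r') : cubicleTop m r ⊆ cubicleTop m r' :=
  image_subset_image (image_subset_image (familyStack_mono isNestedMinimizerFamily_daisyOfT
    (fun k => by dsimp only [cubicleProfile]; split_ifs <;> omega) le_rfl))

/-! #### Boxes containing the shapes; the three regime transitions -/

/-- Coordinates of `x + e₀`. [folklore] -/
private theorem shift0_apply (x : Site 3) :
    (x + unitStep 0 true : Site 3) 0 = x 0 + 1 ∧ (x + unitStep 0 true : Site 3) 1 = x 1 ∧
      (x + unitStep 0 true : Site 3) 2 = x 2 := by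
  simp [unitStep]

/-- Coordinates of `Φ₁(x) = (x₁, x₀ + 1, x₂)`. [folklore] -/
private theorem shift1_apply (x : Site 3) :
    (relabel (Equiv.swap 0 1) x + unitStep 1 true : Site 3) 0 = x 1 ∧
      (relabel (Equiv.swap 0 1) x + unitStep 1 true : Site 3) 1 = x 0 + 1 ∧
      (relabel (Equiv.swap 0 1) x + unitStep 1 true : Site 3) 2 = x 2 := by
  simp [relabel, unitStep, Equiv.swap_apply_of_ne_of_ne]

/-- Coordinates of `Φ₂(x) = (x₁, x₂, x₀ + 1)`. [folklore] -/
private theorem shift2_apply (x : Site 3) :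
    (relabel (finRotate 3) x + unitStep 2 true : Site 3) 0 = x 1 ∧
      (relabel (finRotate 3) x + unitStep 2 true : Site 3) 1 = x 2 ∧
      (relabel (finRotate 3) x + unitStep 2 true : Site 3) 2 = x 0 + 1 := by
  simp [relabel, unitStep]

/-- Points of a profile stack of transposed daisies (`r ≤ F`): height `k ≤ m` (`k < m` if `r = 0`)
and a tail in `D_Fᵀ`. [folklore] -/
private theorem familyStack_cubicleProfile_bounds {m F r : ℕ} (hr : r ≤ F) {x : Site 3}
    (hx : x ∈ familyStack daisyOfT (cubicleProfile m F r) (m + 1)) :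
    ∃ k : ℕ, k ≤ m ∧ x 0 = k ∧ Fin.tail x ∈ daisyOfT F ∧ (r = 0 → k < m) := by
  obtain ⟨k, hk, h0, hy⟩ := mem_familyStack.1 hx
  refine ⟨k, by omega, h0, isNestedMinimizerFamily_daisyOfT.mono
    (show cubicleProfile m F r k ≤ F by dsimp only [cubicleProfile]; split_ifs <;> omega) hy,
    fun hr0 => ?_⟩
  by_contra hkm
  have hk0 : cubicleProfile m F r k = 0 := by
    dsimp only [cubicleProfile]
    split_ifs <;> omega
  rw [hk0, card_eq_zero.1 (isNestedMinimizerFamily_daisyOfT.card_eq 0)] at hy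
  exact absurd hy (by simp)

/-- Coordinate bounds in the bottom-regime cubicle. [cite: AgnarssonLauria2013, §5 (⟦n⟧^d ⊆ ⟦m_d+1,0⟧^d, proof of Lemma 5.10)] -/
theorem cubicleBot_bounds {m r : ℕ} (hr : r ≤ m ^ 2) {z : Site 3} (hz : z ∈ cubicleBot m r) :
    1 ≤ z 0 ∧ z 0 ≤ m + 1 ∧ 1 ≤ z 1 ∧ z 1 ≤ m ∧ 1 ≤ z 2 ∧ z 2 ≤ m ∧ (r = 0 → z 0 ≤ m) := by
  obtain ⟨x, hx, rfl⟩ := mem_image.1 hz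
  obtain ⟨k, hkm, h0, hy, hk0⟩ := familyStack_cubicleProfile_bounds hr hx
  obtain ⟨h1, h2, h3, h4⟩ := mem_daisyOfT_sq.1 hy
  have e1 : Fin.tail x 0 = x 1 := rfl
  have e2 : Fin.tail x 1 = x 2 := rfl
  rw [e1] at h1 h2
  rw [e2] at h3 h4
  obtain ⟨c0, c1, c2⟩ := shift0_apply x
  rw [c0, c1, c2, h0]
  omega

/-- Coordinate bounds in the middle-regime cubicle. [cite: AgnarssonLauria2013, §5 (⟦n⟧^d ⊆ ⟦m_d+1,0⟧^d, proof of Lemma 5.10)] -/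
theorem cubicleMid_bounds {m r : ℕ} (hr : r ≤ m * (m + 1)) {z : Site 3} (hz : z ∈ cubicleMid m r) :
    1 ≤ z 0 ∧ z 0 ≤ m + 1 ∧ 1 ≤ z 1 ∧ z 1 ≤ m + 1 ∧ 1 ≤ z 2 ∧ z 2 ≤ m ∧ (r = 0 → z 1 ≤ m) := by
  obtain ⟨y, hy', rfl⟩ := mem_image.1 hz
  obtain ⟨x, hx, rfl⟩ := mem_image.1 hy'
  obtain ⟨k, hkm, h0, hy, hk0⟩ := familyStack_cubicleProfile_bounds hr hx
  obtain ⟨h1, h2, h3, h4⟩ := mem_daisyOfT_mul_succ.1 hy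
  have e1 : Fin.tail x 0 = x 1 := rfl
  have e2 : Fin.tail x 1 = x 2 := rfl
  rw [e1] at h1 h2
  rw [e2] at h3 h4
  obtain ⟨c0, c1, c2⟩ := shift1_apply x
  rw [c0, c1, c2, h0]
  omega

/-- Coordinate bounds in the top-regime cubicle. [cite: AgnarssonLauria2013, §5 (⟦n⟧^d ⊆ ⟦m_d+1,0⟧^d, proof of Lemma 5.10)] -/
theorem cubicleTop_bounds {m r : ℕ} (hr : r ≤ (m + 1) ^ 2) {z : Site 3} (hz : z ∈ cubicleTop m r) :
    1 ≤ z 0 ∧ z 0 ≤ m + 1 ∧ 1 ≤ z 1 ∧ z 1 ≤ m + 1 ∧ 1 ≤ z 2 ∧ z 2 ≤ m + 1 ∧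
      (r = 0 → z 2 ≤ m) := by
  obtain ⟨y, hy', rfl⟩ := mem_image.1 hz
  obtain ⟨x, hx, rfl⟩ := mem_image.1 hy'
  obtain ⟨k, hkm, h0, hy, hk0⟩ := familyStack_cubicleProfile_bounds hr hx
  obtain ⟨h1, h2, h3, h4⟩ := mem_daisyOfT_sq.1 hy
  have e1 : Fin.tail x 0 = x 1 := rfl
  have e2 : Fin.tail x 1 = x 2 := rfl
  rw [e1] at h1 h2
  rw [e2] at h3 h4
  obtain ⟨c0, c1, c2⟩ := shift2_apply x
  rw [c0, c1, c2, h0]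
  omega

/-- `cubicleBot m r ⊆ [1,m+1] × [1,m]²`. [cite: AgnarssonLauria2013, §5 (recursive definition of ⟦n⟧^d)] -/
theorem cubicleBot_subset_box3 {m r : ℕ} (hr : r ≤ m ^ 2) : cubicleBot m r ⊆ box3 (m + 1) m m := by
  intro z hz
  have h := cubicleBot_bounds hr hz
  rw [mem_box3]
  push_cast
  omega

/-- `cubicleBot m 0 = [1,m]³` as a subset. [cite: AgnarssonLauria2013, §5 (recursive definition of ⟦n⟧^d)] -/
theorem cubicleBot_zero_subset_box3 (m : ℕ) : cubicleBot m 0 ⊆ box3 m m m := by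
  intro z hz
  have h := cubicleBot_bounds (Nat.zero_le _) hz
  rw [mem_box3]
  omega

/-- `cubicleMid m r ⊆ [1,m+1]² × [1,m]`. [cite: AgnarssonLauria2013, §5 (recursive definition of ⟦n⟧^d)] -/
theorem cubicleMid_subset_box3 {m r : ℕ} (hr : r ≤ m * (m + 1)) :
    cubicleMid m r ⊆ box3 (m + 1) (m + 1) m := by
  intro z hz
  have h := cubicleMid_bounds hr hz
  rw [mem_box3]
  push_cast
  omega

/-- `cubicleMid m 0 ⊆ [1,m+1] × [1,m]²`. [cite: AgnarssonLauria2013, §5 (recursive definition of ⟦n⟧^d)] -/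
theorem cubicleMid_zero_subset_box3 (m : ℕ) : cubicleMid m 0 ⊆ box3 (m + 1) m m := by
  intro z hz
  have h := cubicleMid_bounds (Nat.zero_le _) hz
  rw [mem_box3]
  push_cast
  omega

/-- `cubicleTop m r ⊆ [1,m+1]³`. [cite: AgnarssonLauria2013, §5 (recursive definition of ⟦n⟧^d)] -/
theorem cubicleTop_subset_box3 {m r : ℕ} (hr : r ≤ (m + 1) ^ 2) :
    cubicleTop m r ⊆ box3 (m + 1) (m + 1) (m + 1) := by
  intro z hz
  have h := cubicleTop_bounds hr hz
  rw [mem_box3]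
  push_cast
  omega

/-- `cubicleTop m 0 ⊆ [1,m+1]² × [1,m]`. [cite: AgnarssonLauria2013, §5 (recursive definition of ⟦n⟧^d)] -/
theorem cubicleTop_zero_subset_box3 (m : ℕ) : cubicleTop m 0 ⊆ box3 (m + 1) (m + 1) m := by
  intro z hz
  have h := cubicleTop_bounds (Nat.zero_le _) hz
  rw [mem_box3]
  push_cast
  omega

/-- A full bottom-regime cubicle is the box `[1,m+1] × [1,m]²`.
[cite: AgnarssonLauria2013, Definition 5.1 (⟦m,ℓ⟧^d = [m+1]^ℓ × [m]^{d−ℓ}) with the recursive definition of ⟦n⟧^d] -/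
theorem cubicleBot_sq_eq_box3 (m : ℕ) : cubicleBot m (m ^ 2) = box3 (m + 1) m m :=
  eq_of_subset_of_card_le (cubicleBot_subset_box3 le_rfl)
    (by rw [card_box3, card_cubicleBot]; exact le_of_eq (by ring))

/-- An exact bottom-regime cubicle is the cube `[1,m]³`. [cite: AgnarssonLauria2013, Definition 5.1 (⟦m,ℓ⟧^d = [m+1]^ℓ × [m]^{d−ℓ})] -/
theorem cubicleBot_zero_eq_box3 (m : ℕ) : cubicleBot m 0 = box3 m m m :=
  eq_of_subset_of_card_le (cubicleBot_zero_subset_box3 m)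
    (by rw [card_box3, card_cubicleBot]; exact le_of_eq (by ring))

/-- `cubicleMid m 0 = [1,m+1] × [1,m]²`. [cite: AgnarssonLauria2013, Definition 5.1 (⟦m,ℓ⟧^d = [m+1]^ℓ × [m]^{d−ℓ})] -/
theorem cubicleMid_zero_eq_box3 (m : ℕ) : cubicleMid m 0 = box3 (m + 1) m m :=
  eq_of_subset_of_card_le (cubicleMid_zero_subset_box3 m)
    (by rw [card_box3, card_cubicleMid]; exact le_of_eq (by ring))

/-- A full middle-regime cubicle is the box `[1,m+1]² × [1,m]`. [cite: AgnarssonLauria2013, Definition 5.1 (⟦m,ℓ⟧^d = [m+1]^ℓ × [m]^{d−ℓ})] -/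
theorem cubicleMid_full_eq_box3 (m : ℕ) : cubicleMid m (m * (m + 1)) = box3 (m + 1) (m + 1) m :=
  eq_of_subset_of_card_le (cubicleMid_subset_box3 le_rfl)
    (by rw [card_box3, card_cubicleMid]; exact le_of_eq (by ring))

/-- `cubicleTop m 0 = [1,m+1]² × [1,m]`. [cite: AgnarssonLauria2013, Definition 5.1 (⟦m,ℓ⟧^d = [m+1]^ℓ × [m]^{d−ℓ})] -/
theorem cubicleTop_zero_eq_box3 (m : ℕ) : cubicleTop m 0 = box3 (m + 1) (m + 1) m :=
  eq_of_subset_of_card_le (cubicleTop_zero_subset_box3 m)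
    (by rw [card_box3, card_cubicleTop]; exact le_of_eq (by ring))

/-- A full top-regime cubicle is the cube `[1,m+1]³`. [cite: AgnarssonLauria2013, Definition 5.1 (⟦m,ℓ⟧^d = [m+1]^ℓ × [m]^{d−ℓ})] -/
theorem cubicleTop_sq_eq_box3 (m : ℕ) : cubicleTop m ((m + 1) ^ 2) = box3 (m + 1) (m + 1) (m + 1) :=
  eq_of_subset_of_card_le (cubicleTop_subset_box3 le_rfl)
    (by rw [card_box3, card_cubicleTop]; exact le_of_eq (by ring))

/-! #### The cubicles `⟦n⟧³` and Theorem 2.2 of Mainini–Schmidt in `ℤ³` -/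

/-- **The cubicle `⟦n⟧³ ⊂ ℤ³` of `n` points** (Agnarsson–Lauria): with `m = ⌊∛n⌋` and `mF` the
largest quasi-cube `≤ n` (`F ∈ {m², m(m+1), (m+1)²}`), the box of that quasi-cube inside `[1,m+1]³`
together with the transposed daisy of the remaining `n − mF` points in the next coordinate plane —
orthogonal to `e₀`, `e₁`, `e₂` in the three regimes, so that consecutive cubicles are nested.
[cite: AgnarssonLauria2013, §5 (recursive definition of ⟦n⟧^d), Proposition 5.7 and Definition 5.8; MaininiSchmidt2020, Theorem 2.2 (d = 3)] -/
noncomputable def cubicle (n : ℕ) : Finset (Site 3) :=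
  if latticeRootFloor 3 n * (latticeRootFloor 3 n + 1) ^ 2 ≤ n then
    cubicleTop (latticeRootFloor 3 n) (n - latticeRootFloor 3 n * (latticeRootFloor 3 n + 1) ^ 2)
  else if latticeRootFloor 3 n ^ 2 * (latticeRootFloor 3 n + 1) ≤ n then
    cubicleMid (latticeRootFloor 3 n) (n - latticeRootFloor 3 n ^ 2 * (latticeRootFloor 3 n + 1))
  else cubicleBot (latticeRootFloor 3 n) (n - latticeRootFloor 3 n ^ 3)

/-- The cubicle in the top regime. [cite: AgnarssonLauria2013, §5 (recursive definition of ⟦n⟧^d, ℓ_d = 2)] -/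
theorem cubicle_of_top {n m : ℕ} (h1 : m ^ 3 ≤ n) (h2 : n < (m + 1) ^ 3)
    (htop : m * (m + 1) ^ 2 ≤ n) : cubicle n = cubicleTop m (n - m * (m + 1) ^ 2) := by
  rw [cubicle, latticeRootFloor_three_eq h1 h2, if_pos htop]

/-- The cubicle in the middle regime. [cite: AgnarssonLauria2013, §5 (recursive definition of ⟦n⟧^d, ℓ_d = 1)] -/
theorem cubicle_of_mid {n m : ℕ} (h1 : m ^ 3 ≤ n) (h2 : n < (m + 1) ^ 3)
    (hlt : n < m * (m + 1) ^ 2) (hmid : m ^ 2 * (m + 1) ≤ n) :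
    cubicle n = cubicleMid m (n - m ^ 2 * (m + 1)) := by
  rw [cubicle, latticeRootFloor_three_eq h1 h2, if_neg (not_le.2 hlt), if_pos hmid]

/-- The cubicle in the bottom regime. [cite: AgnarssonLauria2013, §5 (recursive definition of ⟦n⟧^d, ℓ_d = 0)] -/
theorem cubicle_of_bot {n m : ℕ} (h1 : m ^ 3 ≤ n) (h2 : n < (m + 1) ^ 3)
    (hlt : n < m ^ 2 * (m + 1)) : cubicle n = cubicleBot m (n - m ^ 3) := by
  have h0 : ¬m * (m + 1) ^ 2 ≤ n := by
    have : m ^ 2 * (m + 1) ≤ m * (m + 1) ^ 2 := by nlinarith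
    omega
  rw [cubicle, latticeRootFloor_three_eq h1 h2, if_neg h0, if_neg (not_le.2 hlt)]

/-- **`⟦n⟧³` has `n` points.** [cite: AgnarssonLauria2013, Proposition 5.7] -/
theorem card_cubicle (n : ℕ) : #(cubicle n) = n := by
  obtain ⟨h1, h2⟩ := latticeRootFloor_three_spec n
  obtain ⟨m, hm⟩ : ∃ m, latticeRootFloor 3 n = m := ⟨_, rfl⟩
  rw [hm] at h1 h2
  have e2 : m * (m + 1) ^ 2 = m ^ 2 * (m + 1) + m * (m + 1) := by ring
  have e3 : m ^ 2 * (m + 1) = m ^ 3 + m ^ 2 := by ring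
  have e9 : m * (m * (m + 1)) = m ^ 2 * (m + 1) := by ring
  have e10 : m * m ^ 2 = m ^ 3 := by ring
  by_cases htop : m * (m + 1) ^ 2 ≤ n
  · rw [cubicle_of_top h1 h2 htop, card_cubicleTop]
    omega
  · by_cases hmid : m ^ 2 * (m + 1) ≤ n
    · rw [cubicle_of_mid h1 h2 (not_le.1 htop) hmid, card_cubicleMid, e9]
      omega
    · rw [cubicle_of_bot h1 h2 (not_le.1 hmid), card_cubicleBot, e10]
      omega

/-- **`⟦n⟧³` has edge perimeter `2·G₃(n)`.** [cite: AgnarssonLauria2013, Definition 5.11 and Observation 5.12 (d = 3); AlonsoCerf1996, Corollary 3.4] -/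
theorem card_boundaryPairs_cubicle (n : ℕ) : #(boundaryPairs (cubicle n)) = 2 * cubicEIP n := by
  rcases Nat.eq_zero_or_pos n with rfl | hn
  · rw [card_eq_zero.1 (card_cubicle 0), cubicEIP_zero]
    simp [boundaryPairs]
  obtain ⟨h1, h2⟩ := latticeRootFloor_three_spec n
  obtain ⟨m, hm⟩ : ∃ m, latticeRootFloor 3 n = m := ⟨_, rfl⟩
  rw [hm] at h1 h2
  have hm1 : 1 ≤ m := by
    by_contra h
    have h0 : m = 0 := by omega
    rw [h0] at h2
    omega
  have e1 : (m + 1) ^ 3 = m * (m + 1) ^ 2 + (m + 1) ^ 2 := by ring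
  have e2 : m * (m + 1) ^ 2 = m ^ 2 * (m + 1) + m * (m + 1) := by ring
  have e3 : m ^ 2 * (m + 1) = m ^ 3 + m ^ 2 := by ring
  have e9 : m * (m * (m + 1)) = m ^ 2 * (m + 1) := by ring
  have e10 : m * m ^ 2 = m ^ 3 := by ring
  by_cases htop : m * (m + 1) ^ 2 ≤ n
  · rw [cubicle_of_top h1 h2 htop, cubicEIP_eq hn.ne' h1 h2 (cubicFace_of_top htop),
      card_boundaryPairs_cubicleTop hm1 (by omega)]
  · by_cases hmid : m ^ 2 * (m + 1) ≤ n
    · rw [cubicle_of_mid h1 h2 (not_le.1 htop) hmid,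
        cubicEIP_eq hn.ne' h1 h2 (cubicFace_of_mid (not_le.1 htop) hmid),
        card_boundaryPairs_cubicleMid hm1 (by omega), e9]
    · rw [cubicle_of_bot h1 h2 (not_le.1 hmid),
        cubicEIP_eq hn.ne' h1 h2 (cubicFace_of_bot (not_le.1 hmid)),
        card_boundaryPairs_cubicleBot hm1 (by omega), e10]

/-- **Every cubicle `⟦n⟧³` is an edge-isoperimetric minimizer in `ℤ³`.**
[cite: AgnarssonLauria2013, Theorem 6.4 (d = 3); MaininiSchmidt2020, Theorem 2.2 (d = 3); AlonsoCerf1996, Theorem 3.1] -/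
theorem isEIPMinimizer_cubicle (n : ℕ) : IsEIPMinimizer (cubicle n) :=
  (isEIPMinimizer_iff_card_boundaryPairs_eq_three _).2 (by rw [card_boundaryPairs_cubicle, card_cubicle])

/-- **Consecutive cubicles are nested**: `⟦n⟧³ ⊆ ⟦n+1⟧³`. [cite: AgnarssonLauria2013, Proposition 5.7; MaininiSchmidt2020, Theorem 2.2] -/
theorem cubicle_subset_succ (n : ℕ) : cubicle n ⊆ cubicle (n + 1) := by
  obtain ⟨h1, h2⟩ := latticeRootFloor_three_spec n
  obtain ⟨m, hm⟩ : ∃ m, latticeRootFloor 3 n = m := ⟨_, rfl⟩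
  rw [hm] at h1 h2
  have e1 : (m + 1) ^ 3 = m * (m + 1) ^ 2 + (m + 1) ^ 2 := by ring
  have e2 : m * (m + 1) ^ 2 = m ^ 2 * (m + 1) + m * (m + 1) := by ring
  have e3 : m ^ 2 * (m + 1) = m ^ 3 + m ^ 2 := by ring
  have e4 : (m + 1) ^ 2 = m * (m + 1) + (m + 1) := by ring
  by_cases htop : m * (m + 1) ^ 2 ≤ n
  · rw [cubicle_of_top h1 h2 htop]
    by_cases hlast : n + 1 < (m + 1) ^ 3
    · rw [cubicle_of_top (m := m) (by omega) hlast (by omega)]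
      exact cubicleTop_mono m (by omega)
    · have hn1 : n + 1 = (m + 1) ^ 3 := by omega
      have e5 : (m + 1) ^ 3 < (m + 1) ^ 2 * (m + 1 + 1) := by nlinarith
      have e6 : (m + 1) ^ 3 < (m + 1 + 1) ^ 3 := Nat.pow_lt_pow_left (by omega) (by norm_num)
      rw [cubicle_of_bot (m := m + 1) (by omega) (by omega) (by omega), hn1, Nat.sub_self,
        cubicleBot_zero_eq_box3, ← cubicleTop_sq_eq_box3]
      exact cubicleTop_mono m (by omega)
  · by_cases hmid : m ^ 2 * (m + 1) ≤ n
    · rw [cubicle_of_mid h1 h2 (not_le.1 htop) hmid]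
      by_cases hlast : n + 1 < m * (m + 1) ^ 2
      · rw [cubicle_of_mid (m := m) (by omega) (by omega) hlast (by omega)]
        exact cubicleMid_mono m (by omega)
      · have hn1 : n + 1 = m * (m + 1) ^ 2 := by omega
        rw [cubicle_of_top (m := m) (by omega) (by omega) (by omega), hn1, Nat.sub_self,
          cubicleTop_zero_eq_box3, ← cubicleMid_full_eq_box3]
        exact cubicleMid_mono m (by omega)
    · rw [cubicle_of_bot h1 h2 (not_le.1 hmid)]
      by_cases hlast : n + 1 < m ^ 2 * (m + 1)
      · rw [cubicle_of_bot (m := m) (by omega) (by omega) hlast]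
        exact cubicleBot_mono m (by omega)
      · have hn1 : n + 1 = m ^ 2 * (m + 1) := by omega
        have e5 : m ^ 2 * (m + 1) < m * (m + 1) ^ 2 := by
          rcases Nat.eq_zero_or_pos m with h0 | h0
          · exfalso
            rw [h0] at hn1
            norm_num at hn1
          · nlinarith
        rw [cubicle_of_mid (m := m) (by omega) (by omega) (by omega) (by omega), hn1, Nat.sub_self,
          cubicleMid_zero_eq_box3, ← cubicleBot_sq_eq_box3]
        exact cubicleBot_mono m (by omega)

/-- **Mainini–Schmidt 2020, Theorem 2.2 for `d = 3` (nested solutions of the EIP in `ℤ³`), PROVED:**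
the cubicles `⟦n⟧³` form a nested family of edge-isoperimetric minimizers, `#⟦n⟧³ = n`.  (The printed
theorem is about the initial segments of the Ahlswede–Bezrukov order `≺` in every dimension; proved
here is the consequence it is quoted for at `d = 3` — "a nested sequence of solutions for any given
cardinality" — realised by the Agnarsson–Lauria cubicles, up to the labelling of the coordinates;
their identification with the `≺`-initial segments is not asserted.)
[cite: MaininiSchmidt2020, Theorem 2.2 (d = 3); AgnarssonLauria2013, Theorem 6.4 with Proposition 5.7 (d = 3)] -/
theorem isNestedMinimizerFamily_cubicle : IsNestedMinimizerFamily cubicle :=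
  ⟨card_cubicle, monotone_nat_of_le_succ cubicle_subset_succ, isEIPMinimizer_cubicle⟩

/-- **Nested solutions exist in `ℤ³`** (the hypothesis of `MaininiSchmidt2020_cor33_of_nested` at
`n = 3`). [cite: MaininiSchmidt2020, Theorem 2.2 (d = 3)] -/
theorem exists_isNestedMinimizerFamily_three :
    ∃ D : ℕ → Finset (Site 3), IsNestedMinimizerFamily D :=
  ⟨cubicle, isNestedMinimizerFamily_cubicle⟩

/-- **[MS20] Corollary 3.3 for `d = 4`, PROVED**: every three-dimensional section
`S_{s,k}(C) = C ∩ {x_s = k}` of an edge-isoperimetric minimizer `C ⊂ ℤ⁴` is an `EIP³` minimizer —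
the `d = 4` instance of the named fact `MaininiSchmidt2020_cor33` of
`EdgeIsoperimetricFluctuations.lean`, by rearrangement along nested cubicles
(`IsNestedMinimizerFamily.isEIPMinimizer_latticeSection`). [cite: MaininiSchmidt2020, Corollary 3.3 (d = 4) with Theorem 2.2 (d = 3)] -/
theorem MaininiSchmidt2020_cor33_four (C : Finset (Site 4)) (hC : IsEIPMinimizer C) (s : Fin 4)
    (k : ℤ) : IsEIPMinimizer (latticeSection s k C) :=
  isNestedMinimizerFamily_cubicle.isEIPMinimizer_latticeSection hC s k

/-- Corollary: every three-dimensional section of an `EIP⁴` minimizer with `m` points has edge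
perimeter exactly `2·G₃(m)`. [cite: MaininiSchmidt2020, Corollary 3.3 (d = 4); AlonsoCerf1996, Corollary 3.4] -/
theorem card_boundaryPairs_latticeSection_four {C : Finset (Site 4)} (hC : IsEIPMinimizer C)
    (s : Fin 4) (k : ℤ) :
    #(boundaryPairs (latticeSection s k C)) = 2 * cubicEIP #(latticeSection s k C) :=
  (isEIPMinimizer_iff_card_boundaryPairs_eq_three _).1 (MaininiSchmidt2020_cor33_four C hC s k)

end Nested

/-! ### The bond form: at most `3n − G₃(n)` unit bonds ([AL13] Theorem 6.4 at `d = 3`) -/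

section Bonds

/-- `G₃(n) ≤ 3n` (a configuration has at most `6n` boundary pairs). [cite: AgnarssonLauria2013, Theorem 6.4 (E_d(n) = dn − δ_d(n) ≥ 0, d = 3)] -/
theorem cubicEIP_le_three_mul (n : ℕ) : cubicEIP n ≤ 3 * n := by
  obtain ⟨M, hM, hΘ⟩ := exists_card_boundaryPairs_eq_two_mul_cubicEIP n
  have h := card_boundaryPairs_add_card_adjPairs M
  rw [hM, hΘ] at h
  omega

/-- **Agnarsson–Lauria, Theorem 6.4 for `d = 3` (the bound): `n` points of `ℤ³` induce at most
`E₃(n) = 3n − δ₃(n)` edges of the grid graph**, `δ₃(n) = G₃(n)` (`cubicEIP`; for the `3`-PCR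
`n = [m,ℓ]³ + [m₂,ℓ₂]² (+ [m₁,0]¹)` the printed discrepancy
`Σ_i (ℓ_i[m_i,ℓ_i−1]^{i−1} + (i−ℓ_i)[m_i,ℓ_i]^{i−1})` is `F + m⌈2√F⌉ + ⌈2√r⌉`) — here with ORDERED
adjacent pairs, `#{(x,y) ∈ C × C : x ∼ y} ≤ 2(3n − G₃(n))`; equivalently ([MPSS19] §1–2) the energy
`−b(C_n)` of `n` sticky particles in `ℤ³` is at least `−(3n − G₃(n))`.
[cite: AgnarssonLauria2013, Theorem 6.4 (d = 3); MaininiPiovanoSchmidtStefanelli2019, §2 (#Θ(C_n) + 2b(C_n) = 6n)] -/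
theorem card_adjPairs_le_three (C : Finset (Site 3)) :
    #((C ×ˢ C).filter fun p => (zdGraph 3).Adj p.1 p.2) ≤ 2 * (3 * #C - cubicEIP #C) := by
  have h1 := card_boundaryPairs_add_card_adjPairs C
  have h2 := two_mul_cubicEIP_le_card_boundaryPairs C
  have h3 := cubicEIP_le_three_mul #C
  omega

/-- **Agnarsson–Lauria, Theorem 6.4 for `d = 3` (attainment): some `n`-point configuration (the
cubicle `⟦n⟧³`) induces exactly `3n − G₃(n)` edges** (`2(3n − G₃(n))` ordered adjacent pairs).
[cite: AgnarssonLauria2013, Theorem 6.4 with Definition 5.11 (d = 3)] -/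
theorem card_adjPairs_cubicle (n : ℕ) :
    #((cubicle n ×ˢ cubicle n).filter fun p => (zdGraph 3).Adj p.1 p.2) = 2 * (3 * n - cubicEIP n) := by
  have h1 := card_boundaryPairs_add_card_adjPairs (cubicle n)
  rw [card_boundaryPairs_cubicle, card_cubicle] at h1
  have h3 := cubicEIP_le_three_mul n
  omega

/-- **The bond characterisation of `EIP³` minimizers** ([MPSS19]: "`C_n` is a minimizer for the
`EIP_n` if and only if it maximizes the number of unit bonds"), made quantitative: `C ⊂ ℤ³` is an
`EIP³` minimizer iff it has exactly `3·#C − G₃(#C)` unit bonds (`2(3·#C − G₃(#C))` ordered adjacent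
pairs). [cite: MaininiPiovanoSchmidtStefanelli2019, §2 (minimizers maximize the number of unit bonds); AgnarssonLauria2013, Theorem 6.4 (d = 3)] -/
theorem isEIPMinimizer_iff_card_adjPairs_eq_three (C : Finset (Site 3)) :
    IsEIPMinimizer C ↔
      #((C ×ˢ C).filter fun p => (zdGraph 3).Adj p.1 p.2) = 2 * (3 * #C - cubicEIP #C) := by
  rw [isEIPMinimizer_iff_card_boundaryPairs_eq_three]
  have h1 := card_boundaryPairs_add_card_adjPairs C
  have h3 := cubicEIP_le_three_mul #C
  omega

end Bonds

end Literature.MathematicalPhysics.StatisticalMechanics
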